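import Literature.MathematicalPhysics.QuantumFieldTheory.Balaban1983to89.B6RandomWalkHom
import Literature.MathematicalPhysics.QuantumFieldTheory.Balaban1983to89.B9Thm37Sum

/-!
# Balaban, *Propagators for Lattice Gauge Theories in a Background Field* (CMP 99, 1985) — Theorem 3.7, first entry
# (v2: also the LEFT entries ∇_UG′, Δ_UG′ and the walks of Corollary 3.8; v3: the lattice Leibniz rule of ∇_U in components),
# with the bound (3.89) DISCHARGED: a glue module

T. Balaban, Commun. Math. Phys. **99** (1985) 389–434 [`Balaban1985BackgroundPropagators`, "B9"]; [4] = T. Balaban,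
*Propagators and renormalization transformations for lattice gauge theories. II*, Commun. Math. Phys. **96** (1984)
223–250 [`Balaban1984PropagatorsII`].

This is a GLUE module and contains no mathematics of its own.  It imports the two kernel modules
`…Balaban1983to89.B9Thm37Sum` (the summation step of Theorem 3.7, pp. 408–410: `thm37_entry1`, whose free inputs are the
localized majorants `hT` of the terms h_□G′_□h_□ of (3.87) and `h389` = the bound (3.89) for the terms K(h_□)G′_□h_□ of
(3.88), the identities `hinv`, `h388`, and Lemma 2.1 of [4]) and `…Balaban1983to89.B6RandomWalkHom` (the two-space
block-majorant calculus: `b9_389_localized` derives (3.89) — in the localized indicator shape `h389` asks for — from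
entries 1, 2 of (3.42) for G′_□ and the local coefficient operators of K(h_□), p. 409: *"Using the inequalities (3.42)
for G′_□, we get the bound … (3.89)"*), and composes them:

* `h389_of_342` — the hypothesis `h389` of `B9Thm37Sum.thm37_entry1`, cube by cube, from: K(h_□) = P_□∘D + C_□ (D the
  covariant derivative ∇_U, ABSTRACT; P_□ a bond → site operator and C_□ a site operator with entrywise kernels K_P,
  K_C ≧ 0 of range ≦ ρ whose row-sums against L^{j″}η, (L^{j″}η)² are ≦ κ₁1_{S′_□}, κ₂1_{S′_□} — the shape of the
  coefficients ∂h_□, Δh_□ of K(h) in [4] (2.39)–(2.40) pp. 229–230, supported near □; their SIZES ∂h_□ = O((ML^jη)^{−1}),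
  Δh_□ = O((ML^jη)^{−2}) are implicit in (1.118) [`Balaban1984PropagatorsI`] / (2.36)–(2.40) [4] pp. 229–230 and are NOT
  displayed in print — κ₁, κ₂ are free binders here), entries 1, 2 of (3.42)
  for G′_□ (Corollary 3.6: *"satisfy all the inequalities of Theorems 3.1–3.3 correspondingly"*, p. 409), and
  |h_□| ≦ 1 (multiplication by h_□ preserves block supports and bounds);
* `thm37_entry1_of_342` — **Theorem 3.7 ⇒ (3.42)₁ for G′** with BOTH `hT` (by `B9Thm37Sum.hasMajorant_sandwich_local`)
  and `h389` (by `h389_of_342`) discharged, i.e. from: Corollary 3.6 entries 1, 2 for every G′_□; the partition of unity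
  {h_□} (|h_□| ≦ 1, supp h_□ within the blocks of S_□, overlap counts N, N′ of the S_□, S′_□); the commutator structure of
  K(h_□) as above; G′Δ′_a = I and (3.88) in the form Δ′_a Σ_□h_□G′_□h_□ = I − Σ_□K(h_□)G′_□h_□; Lemma 2.1 of [4] at the
  exponent α; and the located smallness N′θc₁(α) < 1 with θ = B₀e^{δ₀ρ}(κ₁ + κ₂) (*"for M sufficiently large"*:
  θ = O(M^{−1}) is the displayed size of the composite term, (3.89) p. 409 / [4] (2.44) p. 230; the expected κ₁,
  κ₂ = O(M^{−1}) are not displayed).  p. 410 ll. 1–5 (verbatim): *"This theorem follows simply from Corollary 3.6 holding for all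
  G′_□, □∈𝒟, from the bound (3.89) and Lemma 2.1. The arguments are exactly the same as in proofs of Proposition 1.2
  [3] and Proposition 2.2 [4], so we will not repeat them here. Theorem 3.7 implies that all the inequalities
  (3.42)–(3.47) hold for G′, thus we have completed the proof of Theorem 3.1."*

NOT ASSERTED here (hypotheses, as in the two imported modules): Corollary 3.6 / (3.42) for the G′_□; the decomposition
K(h_□) = P_□∘∇_U + C_□ and the sizes κ₁, κ₂ of its coefficients; (3.88) and the local inverse property; Lemma 2.1 of
[4] ((2.61), (2.63)); the counts N, N′.  Both block maps (sites `blk`, bonds `blkY`) and the geometry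
`B9Thm34Ext.toB6 g R H` are shared by the two imported modules — that they compose without adapters is the (only)
content of this file.  Value: kernel-checked bookkeeping, NOT summit progress.  (v2 ADDENDUM — the left entries
∇_UG′, Δ_UG′ of (3.42) for G′ and the walks of Corollary 3.8 — see the second module docstring below; the v1
declarations are unchanged.  v3 ADDENDUM — the covariant derivative ∇_U of (3.3) in components, its lattice Leibniz
rule through M_{h_□}, and entry 2 of (3.42) for G′ with `hLeib` discharged — see the third module docstring; the v1/v2
declarations are unchanged.)
-/

namespace Literature.MathematicalPhysics.QuantumFieldTheory.Balaban1983to89.B9Thm37Glue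

open Literature.MathematicalPhysics.QuantumFieldTheory.Balaban1983to89
open Finset B6RandomWalk B6RandomWalkHom B9Thm37Sum B9Thm34Ext

variable {g : B9.Geometry} [Fintype g.Site] [DecidableEq g.Site] {R : ℝ} {H : Prop} {X Y : Type}

/-- **(3.89), localized, cube by cube** — the hypothesis `h389` of `B9Thm37Sum.thm37_entry1` from entries 1, 2 of
(3.42) for the G′_□, the decomposition K(h_□) = P_□∘D + C_□ with local nonnegative coefficient kernels of row-sums
≦ κ₁1_{S′_□} (against L^{j″}η), ≦ κ₂1_{S′_□} (against (L^{j″}η)²), and |h_□| ≦ 1: each K(h_□)G′_□h_□ has the block-sup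
majorant 1_{S′_□}(y)·B₀e^{δ₀ρ}(κ₁ + κ₂)e^{−δ₀d(y,y′)} (`B6RandomWalkHom.b9_389_localized` with M_{h_□} = `mulOp h_□`).
[cite: Balaban1985BackgroundPropagators, (3.88)–(3.89) p.409; Balaban1984PropagatorsII, (2.40)–(2.44) p.230] -/
theorem h389_of_342 (blk : X → g.Site) (blkY : Y → g.Site) (δ₀ ρ B₀ κ₁ κ₂ : ℝ) {ι : Type}
    (S' : ι → Finset g.Site) (h : ι → X → ℝ) (KP KC : ι → g.Site → g.Site → ℝ)
    (hB₀ : 0 ≤ B₀) (hδ₀ : 0 ≤ δ₀) (htri : Triangle254 (toB6 g R H)) (hlen : ∀ y : g.Site, 0 ≤ g.len y)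
    (hh : ∀ i x, |h i x| ≤ 1)
    (hKP : ∀ i a b, 0 ≤ KP i a b) (hlocP : ∀ i a y'', KP i a y'' ≠ 0 → g.dist a y'' ≤ ρ)
    (hrowP : ∀ i (a : g.Site), ∑ y'' : g.Site, KP i a y'' * g.len y'' ≤ if a ∈ S' i then κ₁ else 0)
    (hKC : ∀ i a b, 0 ≤ KC i a b) (hlocC : ∀ i a y'', KC i a y'' ≠ 0 → g.dist a y'' ≤ ρ)
    (hrowC : ∀ i (a : g.Site), ∑ y'' : g.Site, KC i a y'' * g.len y'' ^ 2 ≤ if a ∈ S' i then κ₂ else 0)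
    {Gsq Cop : ι → Module.End ℝ (X → ℝ)} {D : (X → ℝ) →ₗ[ℝ] (Y → ℝ)} {P : ι → (Y → ℝ) →ₗ[ℝ] (X → ℝ)}
    (h342_1 : ∀ i, HasMajorant (g := toB6 g R H) blk (Gsq i)
      (fun a b => B₀ * g.len a ^ 2 * Real.exp (-(δ₀ * g.dist a b))))
    (h342_2 : ∀ i, HasMajorantHom (g := toB6 g R H) blk blkY (D ∘ₗ Gsq i)
      (fun a b => B₀ * g.len a * Real.exp (-(δ₀ * g.dist a b))))
    (hP : ∀ i, HasMajorantHom (g := toB6 g R H) blkY blk (P i) (KP i))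
    (hC : ∀ i, HasMajorant (g := toB6 g R H) blk (Cop i) (KC i)) :
    ∀ i, HasMajorant (g := toB6 g R H) blk ((P i ∘ₗ D + Cop i) * Gsq i * mulOp (h i))
      (fun (a b : g.Site) => if a ∈ S' i then B₀ * Real.exp (δ₀ * ρ) * (κ₁ + κ₂) * Real.exp (-(δ₀ * g.dist a b))
        else 0) :=
  fun i => b9_389_localized (R := R) (H := H) blk blkY δ₀ ρ B₀ κ₁ κ₂ (S' i) (KP i) (KC i) hB₀ hδ₀ htri hlen (hKP i)
    (hlocP i) (hrowP i) (hKC i) (hlocC i) (hrowC i) (h342_1 i) (h342_2 i) (hP i) (hC i)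
    (fun y' μ B hμ => blockSupp_map_of_mul (g := toB6 g R H) blk (h i) (hh i) (mulOp (h i)) (fun _ _ => rfl) y' μ B hμ)
    rfl

/-- **Theorem 3.7 ⇒ (3.42)₁ for G′ = G′(U), from Corollary 3.6 for the G′_□ and the STRUCTURE of the expansion only**
(p. 410 ll. 1–5: *"This theorem follows simply from Corollary 3.6 holding for all G′_□, □∈𝒟, from the bound (3.89) and
Lemma 2.1."*): `B9Thm37Sum.thm37_entry1` with its localized-majorant inputs discharged — `hT` by
`B9Thm37Sum.hasMajorant_sandwich_local` (h_□G′_□h_□ from (3.42)₁ for G′_□, |h_□| ≦ 1, supp h_□ within the blocks of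
S_□) and `h389` by `h389_of_342` ((3.89) from (3.42)₁,₂ for G′_□ and the local coefficient operators of K(h_□)).
Conclusion: |(G′λ)(x)| ≦ NB₀c₁(α)(1 − N′θc₁(α))^{−1}(L^jη)²e^{−(1−α)δ₀d(y,y′)}|λ| for x ∈ Δ(y), supp λ ⊂ Δ(y′), with
θ = B₀e^{δ₀ρ}(κ₁ + κ₂) — (3.42)₁ for G′ with B₀ ↦ NB₀c₁(α)/(1 − N′θc₁(α)), δ₀ ↦ (1 − α)δ₀; *"M sufficiently large"*
LOCATED as N′B₀e^{δ₀ρ}(κ₁ + κ₂)c₁(α) < 1 (κ₁, κ₂ = O(M^{−1}) expected for the partition of unity of [4] Sect. A;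
sizes not displayed in print, cf. the module docstring).
[cite: Balaban1985BackgroundPropagators, Thm 3.7 + proof pp.408–410; Balaban1984PropagatorsII, Prop 2.2 (2.64)–(2.67) p.234] -/
theorem thm37_entry1_of_342 [Fintype X] [DecidableEq X] (blk : X → g.Site) (blkY : Y → g.Site) (d : ℕ)
    (δ₀ α ρ B₀ κ₁ κ₂ N N' : ℝ) {ι : Type} [Fintype ι] (S S' : ι → Finset g.Site) (h : ι → X → ℝ)
    (KP KC : ι → g.Site → g.Site → ℝ) {G' Δ : Module.End ℝ (X → ℝ)}
    (hB₀ : 0 ≤ B₀) (hδ₀ : 0 ≤ δ₀) (hκ : 0 ≤ κ₁ + κ₂) (hN : 0 ≤ N) (hN' : 0 ≤ N') (hαδ : 0 ≤ (1 - α) * δ₀)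
    (htri : Triangle254 (toB6 g R H)) (hrefl : ∀ y : g.Site, g.dist y y = 0)
    (hdnn : ∀ y y' : g.Site, 0 ≤ g.dist y y') (hlen : ∀ y : g.Site, 0 ≤ g.len y)
    (h261 : Ineq261 d (toB6 g R H) δ₀ α) (h263 : Ineq263 d (toB6 g R H) δ₀ α)
    (hsmall : N' * (B₀ * Real.exp (δ₀ * ρ) * (κ₁ + κ₂)) * B6.c1 d δ₀ α < 1)
    (hh : ∀ i x, |h i x| ≤ 1) (hS : ∀ i x, h i x ≠ 0 → blk x ∈ S i)
    (hcnt : ∀ a : g.Site, (∑ i, if a ∈ S i then (1 : ℝ) else 0) ≤ N)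
    (hcnt' : ∀ a : g.Site, (∑ i, if a ∈ S' i then (1 : ℝ) else 0) ≤ N')
    (hKP : ∀ i a b, 0 ≤ KP i a b) (hlocP : ∀ i a y'', KP i a y'' ≠ 0 → g.dist a y'' ≤ ρ)
    (hrowP : ∀ i (a : g.Site), ∑ y'' : g.Site, KP i a y'' * g.len y'' ≤ if a ∈ S' i then κ₁ else 0)
    (hKC : ∀ i a b, 0 ≤ KC i a b) (hlocC : ∀ i a y'', KC i a y'' ≠ 0 → g.dist a y'' ≤ ρ)
    (hrowC : ∀ i (a : g.Site), ∑ y'' : g.Site, KC i a y'' * g.len y'' ^ 2 ≤ if a ∈ S' i then κ₂ else 0)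
    {Gsq Cop : ι → Module.End ℝ (X → ℝ)} {D : (X → ℝ) →ₗ[ℝ] (Y → ℝ)} {P : ι → (Y → ℝ) →ₗ[ℝ] (X → ℝ)}
    (h342_1 : ∀ i, HasMajorant (g := toB6 g R H) blk (Gsq i)
      (fun a b => B₀ * g.len a ^ 2 * Real.exp (-(δ₀ * g.dist a b))))
    (h342_2 : ∀ i, HasMajorantHom (g := toB6 g R H) blk blkY (D ∘ₗ Gsq i)
      (fun a b => B₀ * g.len a * Real.exp (-(δ₀ * g.dist a b))))
    (hP : ∀ i, HasMajorantHom (g := toB6 g R H) blkY blk (P i) (KP i))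
    (hC : ∀ i, HasMajorant (g := toB6 g R H) blk (Cop i) (KC i))
    (hinv : G' * Δ = 1)
    (h388 : Δ * (∑ i, mulOp (h i) * Gsq i * mulOp (h i)) = 1 - ∑ i, (P i ∘ₗ D + Cop i) * Gsq i * mulOp (h i)) :
    HasMajorant (g := toB6 g R H) blk G'
      (fun (a b : g.Site) => N * B₀ * B6.c1 d δ₀ α * (1 - N' * (B₀ * Real.exp (δ₀ * ρ) * (κ₁ + κ₂)) * B6.c1 d δ₀ α)⁻¹ *
        g.len a ^ 2 * Real.exp (-((1 - α) * δ₀ * g.dist a b))) :=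
  thm37_entry1 (R := R) (H := H) blk d δ₀ α (B₀ * Real.exp (δ₀ * ρ) * (κ₁ + κ₂)) B₀ N N' S S'
    (fun i => mulOp (h i) * Gsq i * mulOp (h i)) (fun i => (P i ∘ₗ D + Cop i) * Gsq i * mulOp (h i)) hB₀
    (mul_nonneg (mul_nonneg hB₀ (Real.exp_nonneg _)) hκ) hN hN' hαδ htri hrefl hdnn h261 h263 hsmall
    (fun i => hasMajorant_sandwich_local (R := R) (H := H) blk (h342_1 i) (h i) (hh i) (S i) (hS i)) hcnt
    (h389_of_342 (R := R) (H := H) blk blkY δ₀ ρ B₀ κ₁ κ₂ S' h KP KC hB₀ hδ₀ htri hlen hh hKP hlocP hrowP hKC hlocC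
      hrowC h342_1 h342_2 hP hC)
    hcnt' hinv h388

/-! ## v2 ADDENDUM — Theorem 3.7 for the LEFT entries ∇_UG′, Δ_UG′ of (3.42), and the walks of Corollary 3.8, from
Corollary 3.6 for the G′_□ and the structure of the expansion

p. 409, Theorem 3.7 (verbatim): *"For M sufficiently large, and a configuration U satisfying (3.35), the operator G′
can be represented as G′ = G′₀(I − R′)^{−1} = G′₀Σ_{n=0}^∞R′ⁿ = Σ_ω h_{□₀}G′_{□₀}h_{□₀}K(h_{□₁})G′_{□₁}h_{□₁}·…·
K(h_{□ₙ})G′_{□ₙ}h_{□ₙ}, (3.90) where ω = (□₀, □₁, ⋯, □ₙ), □ᵢ∈𝒟, □ᵢ∩□ᵢ₊₁ ≠ ∅. The expansion is convergent in all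
norms appearing in the inequalities (3.42)–(3.47)."*; p. 410: *"Theorem 3.7 implies that all the inequalities
(3.42)–(3.47) hold for G′"*; [4] p. 234 (proof of Proposition 2.2, after (2.66)): *"The similar inequalities hold for
a derivative of G′λ and for a Hölder norm of a derivative, but with (L^jη)² replaced by L^jη and (L^jη)^{1−α}
correspondingly."* … (2.67) *"The random walk representation (2.50) is convergent in the norms defined by these
inequalities."*

* `thm37_leftEntry_of_342` — **Theorem 3.7 ⇒ the E-entry of (3.42) for G′, for a LEFT entry E** (E = ∇_U: entry 2,
  weight W(y) = L^jη, E : site functions → bond functions; E = Δ_U: entry 4, weight W ≡ 1), from: Corollary 3.6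
  entries 1, 2 and E for every G′_□ (`h342_1`, `h342_2`, `h342_E`); the partition of unity {h_□} and the structure
  K(h_□) = P_□∘∇_U + C_□ exactly as in `thm37_entry1_of_342`; and ONE further NAMED structural hypothesis, the
  Leibniz rule of E through the multiplication by h_□ — `hLeib : E∘M_{h_□} = M_{h^Z_□}∘E + (P′_□∘∇_U + C′_□)` with
  |h^Z_□| ≦ 1 supported within the blocks of S_□ and local nonnegative coefficient kernels of weighted row-sums
  ≦ κ₃W1_{S′_□} (against L^{j″}η), ≦ κ₄W1_{S′_□} (against (L^{j″}η)²) — the shape of the first line of (3.88), p. 409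
  (verbatim): *"Using (3.50) we get for x∈Δ(y), y∈Λ_j, (Δ′_a hλ)(x) = h(x)(Δ′_aλ)(x) − Σ_{b∈st(x)}(∂h)(b)(Dλ)(b) +
  (Δh)(x)λ(x) + …"*, cf. [4] (2.39)–(2.40) pp. 229–230 (for E = ∇_U: the lattice Leibniz rule of the covariant
  derivative of a product, P′_□ = 0).  Mechanism (the tree's `B6RandomWalkHom`, nothing new): the fixed point
  G′ = G′₀ + G′R′ of (3.88)/(3.90) passes to EG′ = EG′₀ + (EG′)R′ (`leftEntry_fixpoint`); EG′₀ = Σ_□[h^Z_□(EG′_□)h_□ +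
  (P′_□∇_U + C′_□)G′_□h_□] is a finite sum of localized two-space operators with majorant
  B₀(N + N′e^{δ₀ρ}(κ₃ + κ₄))W(y)e^{−δ₀d(y,y′)} (`hom_majorant_localLeft_comp` and the overlap counts N, N′); the
  Neumann series in the two-space calculus is `hom_majorant_of_fixedPoint_266` ([4] (2.66) via Lemma 2.1).
  Conclusion: |(EG′λ)(v)| ≦ B₀(N + N′e^{δ₀ρ}(κ₃ + κ₄))c₁(α)(1 − N′θc₁(α))^{−1}W(y)e^{−(1−α)δ₀d(y,y′)}|λ| for v in the
  block of y, supp λ ⊂ Δ(y′), θ = B₀e^{δ₀ρ}(κ₁ + κ₂) — the E-entry of (3.42) for G′ under the SAME located smallness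
  N′θc₁(α) < 1 as entry 1 (p. 410: *"if we take another norm we get another factor with a different power of
  L^jη"*);
* `thm37_entry2_of_342` — the specialisation E = ∇_U (=: D; entry 2 of (3.42): W = L^jη, `h342_E := h342_2`);
* `cor38_walk_of_342` — the walk bound behind Corollary 3.8 (`B9Thm37Sum.cor38_walk_majorant`: the term of (3.90)
  indexed by ω = (□₀, …, □ₙ) has majorant 1_{S_{□₀}}(y)B₀(L^jη)²(θc₁(α))ⁿe^{−(1−α)δ₀d_ω(y,y′)}) with its inputs `hT0`,
  `hR` DISCHARGED from (3.42)₁,₂ for the G′_{□ᵢ} (`B9Thm37Sum.hasMajorant_sandwich_local`, `h389_of_342`);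
* helpers (two-space bookkeeping, [folklore]): `hasMajorantHom_sandwich_local`, `hasMajorantHom_fintypeSum`,
  `localPair_comp_majorant` (= `B6RandomWalkHom.b9_389_of_342` with a third target lattice), `leftEntry_cube_majorant`.

NOT ASSERTED in the addendum (hypotheses): everything listed above for v1; the E-entry of (3.42) for the G′_□
(Corollary 3.6); the Leibniz identities `hLeib` for E = ∇_U, Δ_U and the sizes κ₃, κ₄ of their coefficient kernels
(expected O(M^{−1}), O(M^{−2}) for the partition of unity of [4] Sect. A — implicit in (1.118) [`Balaban1984PropagatorsI`]
/ (2.36)–(2.40) [4] pp. 229–230, NOT displayed in print).  The RIGHT entries G′∇*_U, ‖ζ∇_UG′λ‖_α, ‖ζG′∇*_Uλ‖_α of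
(3.42)–(3.47) (entries 3, 4, 5 of [4] (2.67)) are NOT typed here (they need the divergence form of V′(U), p. 409,
resp. the Hölder seminorms).  Value: kernel-checked bookkeeping + a located residual, NOT summit progress. -/

section LeftEntries

variable {Z : Type}

/-- Two-space form of `B9Thm37Sum.hasMajorant_sandwich_local`: if T : (functions on X) → (functions on Z) has the
majorant K, |h| ≦ 1 on X, |h^Z| ≦ 1 on Z and supp h^Z only meets the blocks of z ∈ S, then M_{h^Z}∘T∘M_h has the
majorant 1_S(z)K(z, y′) (the term h^Z_□(EG′_□)h_□ of EG′₀). [folklore] -/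
theorem hasMajorantHom_sandwich_local (blk : X → g.Site) (blkZ : Z → g.Site) {T : (X → ℝ) →ₗ[ℝ] (Z → ℝ)}
    {K : g.Site → g.Site → ℝ} (hT : HasMajorantHom (g := toB6 g R H) blk blkZ T K) (h : X → ℝ) (hZ : Z → ℝ)
    (hh : ∀ x, |h x| ≤ 1) (hhZ : ∀ v, |hZ v| ≤ 1) (S : Finset g.Site) (hS : ∀ v, hZ v ≠ 0 → blkZ v ∈ S) :
    HasMajorantHom (g := toB6 g R H) blk blkZ (mulOp hZ ∘ₗ T ∘ₗ mulOp h)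
      (fun (a b : g.Site) => if a ∈ S then K a b else 0) := by
  intro y' μ B hμ v
  have hb : |T (mulOp h μ) v| ≤ K (blkZ v) y' * B :=
    hT y' (mulOp h μ) B (blockSupp_map_of_mul (g := toB6 g R H) blk h hh (mulOp h) (fun _ _ => rfl) y' μ B hμ) v
  have hKB : 0 ≤ K (blkZ v) y' * B := (abs_nonneg _).trans hb
  show |hZ v * T (mulOp h μ) v| ≤ (if blkZ v ∈ S then K (blkZ v) y' else 0) * B
  rw [abs_mul]
  by_cases hv : hZ v = 0
  · rw [hv, abs_zero, zero_mul]
    split_ifs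
    · exact hKB
    · rw [zero_mul]
  · rw [if_pos (hS v hv)]
    calc |hZ v| * |T (mulOp h μ) v| ≤ 1 * (K (blkZ v) y' * B) :=
        mul_le_mul (hhZ v) hb (abs_nonneg _) zero_le_one
      _ = K (blkZ v) y' * B := one_mul _

omit [DecidableEq g.Site] in
/-- Finite sums of two-space operators over a `Fintype` index (the cubes □ ∈ 𝒟): the majorants add up ([4] p. 232
*"A summation preserves it also"*). [folklore] -/
theorem hasMajorantHom_fintypeSum (blk : X → g.Site) (blkZ : Z → g.Site) {ι : Type} [Fintype ι]
    (T : ι → (X → ℝ) →ₗ[ℝ] (Z → ℝ)) (K : ι → g.Site → g.Site → ℝ)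
    (hT : ∀ i, HasMajorantHom (g := toB6 g R H) blk blkZ (T i) (K i)) :
    HasMajorantHom (g := toB6 g R H) blk blkZ (∑ i, T i) (fun (a b : g.Site) => ∑ i, K i a b) := by
  intro y' μ B hμ v
  show |(∑ i, T i) μ v| ≤ (∑ i, K i (blkZ v) y') * B
  rw [LinearMap.sum_apply, Finset.sum_apply, Finset.sum_mul]
  exact (Finset.abs_sum_le_sum_abs _ _).trans (Finset.sum_le_sum fun i _ => hT i y' μ B hμ v)

omit [DecidableEq g.Site] in
/-- `B6RandomWalkHom.b9_389_of_342` with a THIRD target lattice Z: a local pair (P′ : bond functions → Z-functions,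
C′ : site functions → Z-functions, nonnegative kernels of range ≦ ρ and weighted row-sums ≦ p, q) composed with
∇_U∘T resp. T, for a cube term T obeying (3.42)₁,₂, has the majorant B₀e^{δ₀ρ}(p + q)(y)e^{−δ₀d(y,y′)} — the
commutator term (P′_□∇_U + C′_□)G′_□h_□ of EG′₀ (and, with Z = sites, (3.89) itself). [cite: Balaban1985BackgroundPropagators, (3.88)–(3.89) p.409; Balaban1984PropagatorsII, (2.40)–(2.44) p.230] -/
theorem localPair_comp_majorant (blk : X → g.Site) (blkY : Y → g.Site) (blkZ : Z → g.Site) (δ₀ ρ B₀ : ℝ)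
    (p q : g.Site → ℝ) (KP KC : g.Site → g.Site → ℝ)
    (hB₀ : 0 ≤ B₀) (hδ₀ : 0 ≤ δ₀) (htri : Triangle254 (toB6 g R H)) (hlen : ∀ y : g.Site, 0 ≤ g.len y)
    (hKP : ∀ a b, 0 ≤ KP a b) (hlocP : ∀ a y'', KP a y'' ≠ 0 → g.dist a y'' ≤ ρ)
    (hrowP : ∀ a, ∑ y'' : g.Site, KP a y'' * g.len y'' ≤ p a)
    (hKC : ∀ a b, 0 ≤ KC a b) (hlocC : ∀ a y'', KC a y'' ≠ 0 → g.dist a y'' ≤ ρ)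
    (hrowC : ∀ a, ∑ y'' : g.Site, KC a y'' * g.len y'' ^ 2 ≤ q a)
    {T : Module.End ℝ (X → ℝ)} {D : (X → ℝ) →ₗ[ℝ] (Y → ℝ)} {P : (Y → ℝ) →ₗ[ℝ] (Z → ℝ)}
    {C : (X → ℝ) →ₗ[ℝ] (Z → ℝ)}
    (hT1 : HasMajorantHom (g := toB6 g R H) blk blk T
      (fun a b => B₀ * g.len a ^ 2 * Real.exp (-(δ₀ * g.dist a b))))
    (hT2 : HasMajorantHom (g := toB6 g R H) blk blkY (D ∘ₗ T)
      (fun a b => B₀ * g.len a * Real.exp (-(δ₀ * g.dist a b))))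
    (hP : HasMajorantHom (g := toB6 g R H) blkY blkZ P KP) (hC : HasMajorantHom (g := toB6 g R H) blk blkZ C KC) :
    HasMajorantHom (g := toB6 g R H) blk blkZ ((P ∘ₗ D + C) ∘ₗ T)
      (fun (a b : g.Site) => B₀ * Real.exp (δ₀ * ρ) * (p a + q a) * Real.exp (-(δ₀ * g.dist a b))) := by
  have hPterm : HasMajorantHom (g := toB6 g R H) blk blkZ (P ∘ₗ (D ∘ₗ T))
      (fun a b => B₀ * Real.exp (δ₀ * ρ) * p a * Real.exp (-(δ₀ * (toB6 g R H).dist a b))) :=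
    hom_majorant_localLeft_comp (g := toB6 g R H) blk blkY blkZ δ₀ ρ B₀ (fun y => g.len y) p KP hB₀ hlen hδ₀ htri
      hKP hlocP hrowP hP (by simpa only [toB6_dist] using hT2)
  have hCterm : HasMajorantHom (g := toB6 g R H) blk blkZ (C ∘ₗ T)
      (fun a b => B₀ * Real.exp (δ₀ * ρ) * q a * Real.exp (-(δ₀ * (toB6 g R H).dist a b))) :=
    hom_majorant_localLeft_comp (g := toB6 g R H) blk blk blkZ δ₀ ρ B₀ (fun y => g.len y ^ 2) q KC hB₀
      (fun y => sq_nonneg _) hδ₀ htri hKC hlocC hrowC hC (by simpa only [toB6_dist] using hT1)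
  rw [LinearMap.add_comp, LinearMap.comp_assoc]
  refine hasMajorantHom_mono (g := toB6 g R H) blk blkZ (hasMajorantHom_add (g := toB6 g R H) blk blkZ hPterm hCterm)
    fun a b => le_of_eq ?_
  show B₀ * Real.exp (δ₀ * ρ) * p a * Real.exp (-(δ₀ * (toB6 g R H).dist a b)) +
      B₀ * Real.exp (δ₀ * ρ) * q a * Real.exp (-(δ₀ * (toB6 g R H).dist a b)) =
    B₀ * Real.exp (δ₀ * ρ) * (p a + q a) * Real.exp (-(δ₀ * (toB6 g R H).dist a b))
  ring

/-- **One term of EG′₀ = Σ_□E(h_□G′_□h_□)** (p. 409 (3.87) with a left entry E applied): by the Leibniz rule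
`hLeib`, E(h_□G′_□h_□) = h^Z_□(EG′_□)h_□ + (P′_□∇_U + C′_□)G′_□h_□; the first term is localized to S_□ with the
majorant of the E-entry of (3.42) for G′_□ (`hasMajorantHom_sandwich_local`), the second is a local pair on a cube
term (`localPair_comp_majorant`, from (3.42)₁,₂ for G′_□), localized to S′_□ by the row-sum hypotheses.  Majorant:
[1_{S_□}(y)B₀W(y) + 1_{S′_□}(y)B₀e^{δ₀ρ}(κ₃ + κ₄)W(y)]e^{−δ₀d(y,y′)}. [cite: Balaban1985BackgroundPropagators, (3.87)–(3.89) p.409; Balaban1984PropagatorsII, (2.37)–(2.44) pp.229–230] -/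
theorem leftEntry_cube_majorant (blk : X → g.Site) (blkY : Y → g.Site) (blkZ : Z → g.Site) (δ₀ ρ B₀ κ₃ κ₄ : ℝ)
    (W : g.Site → ℝ) (S S' : Finset g.Site) (h : X → ℝ) (hZ : Z → ℝ) (KP KC : g.Site → g.Site → ℝ)
    (hB₀ : 0 ≤ B₀) (hδ₀ : 0 ≤ δ₀) (htri : Triangle254 (toB6 g R H)) (hlen : ∀ y : g.Site, 0 ≤ g.len y)
    (hh : ∀ x, |h x| ≤ 1) (hhZ : ∀ v, |hZ v| ≤ 1) (hSZ : ∀ v, hZ v ≠ 0 → blkZ v ∈ S)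
    (hKP : ∀ a b, 0 ≤ KP a b) (hlocP : ∀ a y'', KP a y'' ≠ 0 → g.dist a y'' ≤ ρ)
    (hrowP : ∀ a, ∑ y'' : g.Site, KP a y'' * g.len y'' ≤ if a ∈ S' then κ₃ * W a else 0)
    (hKC : ∀ a b, 0 ≤ KC a b) (hlocC : ∀ a y'', KC a y'' ≠ 0 → g.dist a y'' ≤ ρ)
    (hrowC : ∀ a, ∑ y'' : g.Site, KC a y'' * g.len y'' ^ 2 ≤ if a ∈ S' then κ₄ * W a else 0)
    {Gsq : Module.End ℝ (X → ℝ)} {D : (X → ℝ) →ₗ[ℝ] (Y → ℝ)} {E : (X → ℝ) →ₗ[ℝ] (Z → ℝ)}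
    {PL : (Y → ℝ) →ₗ[ℝ] (Z → ℝ)} {CL : (X → ℝ) →ₗ[ℝ] (Z → ℝ)}
    (h342_1 : HasMajorant (g := toB6 g R H) blk Gsq (fun a b => B₀ * g.len a ^ 2 * Real.exp (-(δ₀ * g.dist a b))))
    (h342_2 : HasMajorantHom (g := toB6 g R H) blk blkY (D ∘ₗ Gsq)
      (fun a b => B₀ * g.len a * Real.exp (-(δ₀ * g.dist a b))))
    (h342_E : HasMajorantHom (g := toB6 g R H) blk blkZ (E ∘ₗ Gsq)
      (fun a b => B₀ * W a * Real.exp (-(δ₀ * g.dist a b))))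
    (hPL : HasMajorantHom (g := toB6 g R H) blkY blkZ PL KP) (hCL : HasMajorantHom (g := toB6 g R H) blk blkZ CL KC)
    (hLeib : E ∘ₗ mulOp h = mulOp hZ ∘ₗ E + (PL ∘ₗ D + CL)) :
    HasMajorantHom (g := toB6 g R H) blk blkZ (E ∘ₗ (mulOp h * Gsq * mulOp h))
      (fun (a b : g.Site) => ((if a ∈ S then (1 : ℝ) else 0) * (B₀ * W a) +
        (if a ∈ S' then (1 : ℝ) else 0) * (B₀ * Real.exp (δ₀ * ρ) * (κ₃ + κ₄) * W a)) *
        Real.exp (-(δ₀ * g.dist a b))) := by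
  have hMh : ∀ (y' : g.Site) (μ : X → ℝ) (B : ℝ), BlockSupp (g := toB6 g R H) blk μ y' B →
      BlockSupp (g := toB6 g R H) blk (mulOp h μ) y' B :=
    fun y' μ B hμ => blockSupp_map_of_mul (g := toB6 g R H) blk h hh (mulOp h) (fun _ _ => rfl) y' μ B hμ
  have hsplit : E ∘ₗ (mulOp h * Gsq * mulOp h) =
      mulOp hZ ∘ₗ (E ∘ₗ Gsq) ∘ₗ mulOp h + (PL ∘ₗ D + CL) ∘ₗ (Gsq ∘ₗ mulOp h) := by
    have h1 : E ∘ₗ (mulOp h * Gsq * mulOp h) = (E ∘ₗ mulOp h) ∘ₗ (Gsq ∘ₗ mulOp h) := by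
      simp only [Module.End.mul_eq_comp, LinearMap.comp_assoc]
    rw [h1, hLeib, LinearMap.add_comp]
    simp only [LinearMap.comp_assoc]
  -- the main term h^Z_□(EG′_□)h_□, localized by supp h^Z_□
  have hA : HasMajorantHom (g := toB6 g R H) blk blkZ (mulOp hZ ∘ₗ (E ∘ₗ Gsq) ∘ₗ mulOp h)
      (fun (a b : g.Site) => if a ∈ S then B₀ * W a * Real.exp (-(δ₀ * g.dist a b)) else 0) :=
    hasMajorantHom_sandwich_local blk blkZ h342_E h hZ hh hhZ S hSZ
  -- the commutator term (P′_□∇_U + C′_□)G′_□h_□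
  have hT1 : HasMajorantHom (g := toB6 g R H) blk blk (Gsq ∘ₗ mulOp h)
      (fun a b => B₀ * g.len a ^ 2 * Real.exp (-(δ₀ * g.dist a b))) :=
    hasMajorantHom_comp_suppPreserving (g := toB6 g R H) blk blk
      ((hasMajorantHom_iff (g := toB6 g R H) blk Gsq _).mpr h342_1) hMh
  have hT2 : HasMajorantHom (g := toB6 g R H) blk blkY (D ∘ₗ (Gsq ∘ₗ mulOp h))
      (fun a b => B₀ * g.len a * Real.exp (-(δ₀ * g.dist a b))) := by
    rw [← LinearMap.comp_assoc]
    exact hasMajorantHom_comp_suppPreserving (g := toB6 g R H) blk blkY h342_2 hMh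
  have hB := localPair_comp_majorant blk blkY blkZ δ₀ ρ B₀ (fun a => if a ∈ S' then κ₃ * W a else 0)
    (fun a => if a ∈ S' then κ₄ * W a else 0) KP KC hB₀ hδ₀ htri hlen hKP hlocP hrowP hKC hlocC hrowC hT1 hT2
    hPL hCL
  rw [hsplit]
  refine hasMajorantHom_mono (g := toB6 g R H) blk blkZ (hasMajorantHom_add (g := toB6 g R H) blk blkZ hA hB)
    fun a b => le_of_eq ?_
  show (if a ∈ S then B₀ * W a * Real.exp (-(δ₀ * g.dist a b)) else 0) +
      B₀ * Real.exp (δ₀ * ρ) * ((if a ∈ S' then κ₃ * W a else 0) + (if a ∈ S' then κ₄ * W a else 0)) *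
        Real.exp (-(δ₀ * g.dist a b)) =
    ((if a ∈ S then (1 : ℝ) else 0) * (B₀ * W a) +
      (if a ∈ S' then (1 : ℝ) else 0) * (B₀ * Real.exp (δ₀ * ρ) * (κ₃ + κ₄) * W a)) *
      Real.exp (-(δ₀ * g.dist a b))
  split_ifs <;> ring

/-- **Theorem 3.7 ⇒ the E-entry of (3.42) for G′ = G′(U), for a LEFT entry E (E = ∇_U: entry 2, W = L^jη;
E = Δ_U: entry 4, W ≡ 1), from Corollary 3.6 for the G′_□ and the STRUCTURE of the expansion only** — p. 409:
*"The expansion is convergent in all norms appearing in the inequalities (3.42)–(3.47)."*, p. 410: *"Theorem 3.7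
implies that all the inequalities (3.42)–(3.47) hold for G′"*, [4] p. 234: *"The similar inequalities hold for a
derivative of G′λ …, but with (L^jη)² replaced by L^jη"*.  Inputs: entries 1, 2, E of (3.42) for every G′_□; the
partition of unity (|h_□| ≦ 1; |h^Z_□| ≦ 1 with supp h^Z_□ within the blocks of S_□; overlap counts N, N′ of the
S_□, S′_□); K(h_□) = P_□∘∇_U + C_□ (row-sums ≦ κ₁1_{S′_□}, κ₂1_{S′_□}) and the Leibniz rule `hLeib` of E through
M_{h_□} (row-sums ≦ κ₃W1_{S′_□}, κ₄W1_{S′_□}); G′Δ′_a = I and (3.88); Lemma 2.1 of [4] at the exponent α; the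
located smallness N′θc₁(α) < 1, θ = B₀e^{δ₀ρ}(κ₁ + κ₂).  Conclusion: EG′ has the majorant
B₀(N + N′e^{δ₀ρ}(κ₃ + κ₄))c₁(α)(1 − N′θc₁(α))^{−1}W(y)e^{−(1−α)δ₀d(y,y′)} — the E-entry of (3.42) for G′ with
B₀ ↦ B₀(N + N′e^{δ₀ρ}(κ₃ + κ₄))c₁(α)/(1 − N′θc₁(α)), δ₀ ↦ (1 − α)δ₀.
[cite: Balaban1985BackgroundPropagators, Thm 3.7 (3.87)–(3.90) pp.409–410; Balaban1984PropagatorsII, Prop 2.2 (2.64)–(2.67) p.234] -/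
theorem thm37_leftEntry_of_342 [Fintype X] [DecidableEq X] [Fintype Z] [DecidableEq Z]
    (blk : X → g.Site) (blkY : Y → g.Site) (blkZ : Z → g.Site) (d : ℕ)
    (δ₀ α ρ B₀ κ₁ κ₂ κ₃ κ₄ N N' : ℝ) (W : g.Site → ℝ) {ι : Type} [Fintype ι] (S S' : ι → Finset g.Site)
    (h : ι → X → ℝ) (hZ : ι → Z → ℝ) (KP KC KP' KC' : ι → g.Site → g.Site → ℝ) {G' Δ : Module.End ℝ (X → ℝ)}
    (hB₀ : 0 ≤ B₀) (hδ₀ : 0 ≤ δ₀) (hκ : 0 ≤ κ₁ + κ₂) (hκ' : 0 ≤ κ₃ + κ₄) (hN : 0 ≤ N) (hN' : 0 ≤ N')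
    (hW : ∀ y, 0 ≤ W y) (hαδ : 0 ≤ (1 - α) * δ₀)
    (htri : Triangle254 (toB6 g R H)) (hrefl : ∀ y : g.Site, g.dist y y = 0)
    (hdnn : ∀ y y' : g.Site, 0 ≤ g.dist y y') (hlen : ∀ y : g.Site, 0 ≤ g.len y)
    (h261 : Ineq261 d (toB6 g R H) δ₀ α) (h263 : Ineq263 d (toB6 g R H) δ₀ α)
    (hsmall : N' * (B₀ * Real.exp (δ₀ * ρ) * (κ₁ + κ₂)) * B6.c1 d δ₀ α < 1)
    (hh : ∀ i x, |h i x| ≤ 1) (hhZ : ∀ i v, |hZ i v| ≤ 1) (hSZ : ∀ i v, hZ i v ≠ 0 → blkZ v ∈ S i)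
    (hcnt : ∀ a : g.Site, (∑ i, if a ∈ S i then (1 : ℝ) else 0) ≤ N)
    (hcnt' : ∀ a : g.Site, (∑ i, if a ∈ S' i then (1 : ℝ) else 0) ≤ N')
    (hKP : ∀ i a b, 0 ≤ KP i a b) (hlocP : ∀ i a y'', KP i a y'' ≠ 0 → g.dist a y'' ≤ ρ)
    (hrowP : ∀ i (a : g.Site), ∑ y'' : g.Site, KP i a y'' * g.len y'' ≤ if a ∈ S' i then κ₁ else 0)
    (hKC : ∀ i a b, 0 ≤ KC i a b) (hlocC : ∀ i a y'', KC i a y'' ≠ 0 → g.dist a y'' ≤ ρ)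
    (hrowC : ∀ i (a : g.Site), ∑ y'' : g.Site, KC i a y'' * g.len y'' ^ 2 ≤ if a ∈ S' i then κ₂ else 0)
    (hKP' : ∀ i a b, 0 ≤ KP' i a b) (hlocP' : ∀ i a y'', KP' i a y'' ≠ 0 → g.dist a y'' ≤ ρ)
    (hrowP' : ∀ i (a : g.Site), ∑ y'' : g.Site, KP' i a y'' * g.len y'' ≤ if a ∈ S' i then κ₃ * W a else 0)
    (hKC' : ∀ i a b, 0 ≤ KC' i a b) (hlocC' : ∀ i a y'', KC' i a y'' ≠ 0 → g.dist a y'' ≤ ρ)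
    (hrowC' : ∀ i (a : g.Site), ∑ y'' : g.Site, KC' i a y'' * g.len y'' ^ 2 ≤ if a ∈ S' i then κ₄ * W a else 0)
    {Gsq Cop : ι → Module.End ℝ (X → ℝ)} {D : (X → ℝ) →ₗ[ℝ] (Y → ℝ)} {P : ι → (Y → ℝ) →ₗ[ℝ] (X → ℝ)}
    {E : (X → ℝ) →ₗ[ℝ] (Z → ℝ)} {PL : ι → (Y → ℝ) →ₗ[ℝ] (Z → ℝ)} {CL : ι → (X → ℝ) →ₗ[ℝ] (Z → ℝ)}
    (h342_1 : ∀ i, HasMajorant (g := toB6 g R H) blk (Gsq i)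
      (fun a b => B₀ * g.len a ^ 2 * Real.exp (-(δ₀ * g.dist a b))))
    (h342_2 : ∀ i, HasMajorantHom (g := toB6 g R H) blk blkY (D ∘ₗ Gsq i)
      (fun a b => B₀ * g.len a * Real.exp (-(δ₀ * g.dist a b))))
    (h342_E : ∀ i, HasMajorantHom (g := toB6 g R H) blk blkZ (E ∘ₗ Gsq i)
      (fun a b => B₀ * W a * Real.exp (-(δ₀ * g.dist a b))))
    (hP : ∀ i, HasMajorantHom (g := toB6 g R H) blkY blk (P i) (KP i))
    (hC : ∀ i, HasMajorant (g := toB6 g R H) blk (Cop i) (KC i))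
    (hPL : ∀ i, HasMajorantHom (g := toB6 g R H) blkY blkZ (PL i) (KP' i))
    (hCL : ∀ i, HasMajorantHom (g := toB6 g R H) blk blkZ (CL i) (KC' i))
    (hLeib : ∀ i, E ∘ₗ mulOp (h i) = mulOp (hZ i) ∘ₗ E + (PL i ∘ₗ D + CL i))
    (hinv : G' * Δ = 1)
    (h388 : Δ * (∑ i, mulOp (h i) * Gsq i * mulOp (h i)) = 1 - ∑ i, (P i ∘ₗ D + Cop i) * Gsq i * mulOp (h i)) :
    HasMajorantHom (g := toB6 g R H) blk blkZ (E ∘ₗ G')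
      (fun (a b : g.Site) => B₀ * (N + N' * Real.exp (δ₀ * ρ) * (κ₃ + κ₄)) * B6.c1 d δ₀ α *
        (1 - N' * (B₀ * Real.exp (δ₀ * ρ) * (κ₁ + κ₂)) * B6.c1 d δ₀ α)⁻¹ * W a *
        Real.exp (-((1 - α) * δ₀ * g.dist a b))) := by
  have hθ : 0 ≤ B₀ * Real.exp (δ₀ * ρ) * (κ₁ + κ₂) := mul_nonneg (mul_nonneg hB₀ (Real.exp_nonneg _)) hκ
  have hA : 0 ≤ B₀ * (N + N' * Real.exp (δ₀ * ρ) * (κ₃ + κ₄)) :=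
    mul_nonneg hB₀ (add_nonneg hN (mul_nonneg (mul_nonneg hN' (Real.exp_nonneg _)) hκ'))
  -- EG′₀ = Σ_□ E(h_□G′_□h_□): a finite sum of localized two-space operators ((3.87) with E applied)
  have hcube : ∀ i, HasMajorantHom (g := toB6 g R H) blk blkZ (E ∘ₗ (mulOp (h i) * Gsq i * mulOp (h i)))
      (fun (a b : g.Site) => ((if a ∈ S i then (1 : ℝ) else 0) * (B₀ * W a) +
        (if a ∈ S' i then (1 : ℝ) else 0) * (B₀ * Real.exp (δ₀ * ρ) * (κ₃ + κ₄) * W a)) *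
        Real.exp (-(δ₀ * g.dist a b))) := fun i =>
    leftEntry_cube_majorant blk blkY blkZ δ₀ ρ B₀ κ₃ κ₄ W (S i) (S' i) (h i) (hZ i) (KP' i) (KC' i) hB₀ hδ₀ htri
      hlen (hh i) (hhZ i) (hSZ i) (hKP' i) (hlocP' i) (hrowP' i) (hKC' i) (hlocC' i) (hrowC' i) (h342_1 i)
      (h342_2 i) (h342_E i) (hPL i) (hCL i) (hLeib i)
  have hsumE : E ∘ₗ (∑ i, mulOp (h i) * Gsq i * mulOp (h i)) = ∑ i, E ∘ₗ (mulOp (h i) * Gsq i * mulOp (h i)) := by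
    apply LinearMap.ext
    intro μ
    rw [LinearMap.comp_apply, LinearMap.sum_apply, LinearMap.sum_apply, map_sum]
    rfl
  have hS₀ : HasMajorantHom (g := toB6 g R H) blk blkZ (E ∘ₗ ∑ i, mulOp (h i) * Gsq i * mulOp (h i))
      (fun (a b : g.Site) => B₀ * (N + N' * Real.exp (δ₀ * ρ) * (κ₃ + κ₄)) * W a *
        Real.exp (-(δ₀ * g.dist a b))) := by
    rw [hsumE]
    refine hasMajorantHom_mono (g := toB6 g R H) blk blkZ
      (hasMajorantHom_fintypeSum blk blkZ (fun i => E ∘ₗ (mulOp (h i) * Gsq i * mulOp (h i))) _ hcube)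
      fun a b => ?_
    have h1 : 0 ≤ B₀ * W a := mul_nonneg hB₀ (hW a)
    have h2 : 0 ≤ B₀ * Real.exp (δ₀ * ρ) * (κ₃ + κ₄) * W a :=
      mul_nonneg (mul_nonneg (mul_nonneg hB₀ (Real.exp_nonneg _)) hκ') (hW a)
    calc (∑ i, ((if a ∈ S i then (1 : ℝ) else 0) * (B₀ * W a) +
            (if a ∈ S' i then (1 : ℝ) else 0) * (B₀ * Real.exp (δ₀ * ρ) * (κ₃ + κ₄) * W a)) *
            Real.exp (-(δ₀ * g.dist a b)))
        = ((∑ i, if a ∈ S i then (1 : ℝ) else 0) * (B₀ * W a) +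
            (∑ i, if a ∈ S' i then (1 : ℝ) else 0) * (B₀ * Real.exp (δ₀ * ρ) * (κ₃ + κ₄) * W a)) *
            Real.exp (-(δ₀ * g.dist a b)) := by
          simp only [Finset.sum_mul, add_mul, Finset.sum_add_distrib]
      _ ≤ (N * (B₀ * W a) + N' * (B₀ * Real.exp (δ₀ * ρ) * (κ₃ + κ₄) * W a)) * Real.exp (-(δ₀ * g.dist a b)) :=
          mul_le_mul_of_nonneg_right (add_le_add (mul_le_mul_of_nonneg_right (hcnt a) h1)
            (mul_le_mul_of_nonneg_right (hcnt' a) h2)) (Real.exp_nonneg _)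
      _ = B₀ * (N + N' * Real.exp (δ₀ * ρ) * (κ₃ + κ₄)) * W a * Real.exp (-(δ₀ * g.dist a b)) := by ring
  -- R′ = Σ_□ K(h_□)G′_□h_□ has majorant N′θe^{−δ₀d} ((3.89) summed, exactly as in `B9Thm37Sum.thm37_entry1`)
  have h389 := h389_of_342 (R := R) (H := H) blk blkY δ₀ ρ B₀ κ₁ κ₂ S' h KP KC hB₀ hδ₀ htri hlen hh hKP hlocP
    hrowP hKC hlocC hrowC h342_1 h342_2 hP hC
  have h389' : ∀ i, HasMajorant (g := toB6 g R H) blk ((P i ∘ₗ D + Cop i) * Gsq i * mulOp (h i))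
      (fun (a b : g.Site) => (if a ∈ S' i then (1 : ℝ) else 0) *
        (B₀ * Real.exp (δ₀ * ρ) * (κ₁ + κ₂) * Real.exp (-(δ₀ * g.dist a b)))) :=
    fun i => hasMajorant_mono (g := toB6 g R H) blk (h389 i) fun a b => le_of_eq (by split_ifs <;> simp)
  have hR : HasMajorant (g := toB6 g R H) blk (∑ i, (P i ∘ₗ D + Cop i) * Gsq i * mulOp (h i))
      (fun (a b : g.Site) => N' * (B₀ * Real.exp (δ₀ * ρ) * (κ₁ + κ₂)) * Real.exp (-(δ₀ * g.dist a b))) := by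
    have hloc := hasMajorant_localSum (G := toB6 g R H) blk (fun i => (P i ∘ₗ D + Cop i) * Gsq i * mulOp (h i))
      (fun i (a : g.Site) => if a ∈ S' i then 1 else 0)
      (fun (a b : g.Site) => B₀ * Real.exp (δ₀ * ρ) * (κ₁ + κ₂) * Real.exp (-(δ₀ * g.dist a b))) N'
      (fun a b => mul_nonneg hθ (Real.exp_nonneg _)) h389' hcnt'
    exact hasMajorant_mono (g := toB6 g R H) blk hloc fun a b => le_of_eq (by ring)
  -- G′ = G′₀ + G′R′ ((3.88)/(3.90)) passes to EG′ = EG′₀ + (EG′)R′; the Neumann series is (2.66) via Lemma 2.1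
  have hfix : G' = (∑ i, mulOp (h i) * Gsq i * mulOp (h i)) +
      G' * ∑ i, (P i ∘ₗ D + Cop i) * Gsq i * mulOp (h i) := fixedPoint_of_388 hinv h388
  have hmain := hom_majorant_of_fixedPoint_266 (g := toB6 g R H) blk blkZ d δ₀ α
    (N' * (B₀ * Real.exp (δ₀ * ρ) * (κ₁ + κ₂))) (B₀ * (N + N' * Real.exp (δ₀ * ρ) * (κ₃ + κ₄))) W hA hW
    (mul_nonneg hN' hθ) hαδ htri hrefl hdnn h261 h263 hsmall hS₀ hR (leftEntry_fixpoint E hfix)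
  refine hasMajorantHom_mono (g := toB6 g R H) blk blkZ hmain fun a b => le_of_eq ?_
  simp only [toB6_dist]

/-- **Entry 2 of (3.42) for G′** — `thm37_leftEntry_of_342` at E = ∇_U =: D (bond functions; W(y) = L^jη, so that
`h342_E` is `h342_2` itself): |(∇_UG′λ)(b)| has the majorant B₀(N + N′e^{δ₀ρ}(κ₃ + κ₄))c₁(α)(1 − N′θc₁(α))^{−1}L^jη
e^{−(1−α)δ₀d(y,y′)} — [4] p. 234: *"with (L^jη)² replaced by L^jη"*.  The Leibniz rule of ∇_U through M_{h_□} and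
the sizes of its coefficients are the hypotheses `hLeib`, `hrowP'`, `hrowC'` (NOT asserted).
[cite: Balaban1985BackgroundPropagators, Thm 3.7 pp.409–410, (3.42) p.397; Balaban1984PropagatorsII, Prop 2.2 (2.67) p.234] -/
theorem thm37_entry2_of_342 [Fintype X] [DecidableEq X] [Fintype Y] [DecidableEq Y]
    (blk : X → g.Site) (blkY : Y → g.Site) (d : ℕ) (δ₀ α ρ B₀ κ₁ κ₂ κ₃ κ₄ N N' : ℝ) {ι : Type} [Fintype ι]
    (S S' : ι → Finset g.Site) (h : ι → X → ℝ) (hY : ι → Y → ℝ) (KP KC KP' KC' : ι → g.Site → g.Site → ℝ)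
    {G' Δ : Module.End ℝ (X → ℝ)}
    (hB₀ : 0 ≤ B₀) (hδ₀ : 0 ≤ δ₀) (hκ : 0 ≤ κ₁ + κ₂) (hκ' : 0 ≤ κ₃ + κ₄) (hN : 0 ≤ N) (hN' : 0 ≤ N')
    (hαδ : 0 ≤ (1 - α) * δ₀)
    (htri : Triangle254 (toB6 g R H)) (hrefl : ∀ y : g.Site, g.dist y y = 0)
    (hdnn : ∀ y y' : g.Site, 0 ≤ g.dist y y') (hlen : ∀ y : g.Site, 0 ≤ g.len y)
    (h261 : Ineq261 d (toB6 g R H) δ₀ α) (h263 : Ineq263 d (toB6 g R H) δ₀ α)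
    (hsmall : N' * (B₀ * Real.exp (δ₀ * ρ) * (κ₁ + κ₂)) * B6.c1 d δ₀ α < 1)
    (hh : ∀ i x, |h i x| ≤ 1) (hhY : ∀ i v, |hY i v| ≤ 1) (hSY : ∀ i v, hY i v ≠ 0 → blkY v ∈ S i)
    (hcnt : ∀ a : g.Site, (∑ i, if a ∈ S i then (1 : ℝ) else 0) ≤ N)
    (hcnt' : ∀ a : g.Site, (∑ i, if a ∈ S' i then (1 : ℝ) else 0) ≤ N')
    (hKP : ∀ i a b, 0 ≤ KP i a b) (hlocP : ∀ i a y'', KP i a y'' ≠ 0 → g.dist a y'' ≤ ρ)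
    (hrowP : ∀ i (a : g.Site), ∑ y'' : g.Site, KP i a y'' * g.len y'' ≤ if a ∈ S' i then κ₁ else 0)
    (hKC : ∀ i a b, 0 ≤ KC i a b) (hlocC : ∀ i a y'', KC i a y'' ≠ 0 → g.dist a y'' ≤ ρ)
    (hrowC : ∀ i (a : g.Site), ∑ y'' : g.Site, KC i a y'' * g.len y'' ^ 2 ≤ if a ∈ S' i then κ₂ else 0)
    (hKP' : ∀ i a b, 0 ≤ KP' i a b) (hlocP' : ∀ i a y'', KP' i a y'' ≠ 0 → g.dist a y'' ≤ ρ)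
    (hrowP' : ∀ i (a : g.Site), ∑ y'' : g.Site, KP' i a y'' * g.len y'' ≤ if a ∈ S' i then κ₃ * g.len a else 0)
    (hKC' : ∀ i a b, 0 ≤ KC' i a b) (hlocC' : ∀ i a y'', KC' i a y'' ≠ 0 → g.dist a y'' ≤ ρ)
    (hrowC' : ∀ i (a : g.Site), ∑ y'' : g.Site, KC' i a y'' * g.len y'' ^ 2 ≤
      if a ∈ S' i then κ₄ * g.len a else 0)
    {Gsq Cop : ι → Module.End ℝ (X → ℝ)} {D : (X → ℝ) →ₗ[ℝ] (Y → ℝ)} {P : ι → (Y → ℝ) →ₗ[ℝ] (X → ℝ)}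
    {PL : ι → (Y → ℝ) →ₗ[ℝ] (Y → ℝ)} {CL : ι → (X → ℝ) →ₗ[ℝ] (Y → ℝ)}
    (h342_1 : ∀ i, HasMajorant (g := toB6 g R H) blk (Gsq i)
      (fun a b => B₀ * g.len a ^ 2 * Real.exp (-(δ₀ * g.dist a b))))
    (h342_2 : ∀ i, HasMajorantHom (g := toB6 g R H) blk blkY (D ∘ₗ Gsq i)
      (fun a b => B₀ * g.len a * Real.exp (-(δ₀ * g.dist a b))))
    (hP : ∀ i, HasMajorantHom (g := toB6 g R H) blkY blk (P i) (KP i))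
    (hC : ∀ i, HasMajorant (g := toB6 g R H) blk (Cop i) (KC i))
    (hPL : ∀ i, HasMajorantHom (g := toB6 g R H) blkY blkY (PL i) (KP' i))
    (hCL : ∀ i, HasMajorantHom (g := toB6 g R H) blk blkY (CL i) (KC' i))
    (hLeib : ∀ i, D ∘ₗ mulOp (h i) = mulOp (hY i) ∘ₗ D + (PL i ∘ₗ D + CL i))
    (hinv : G' * Δ = 1)
    (h388 : Δ * (∑ i, mulOp (h i) * Gsq i * mulOp (h i)) = 1 - ∑ i, (P i ∘ₗ D + Cop i) * Gsq i * mulOp (h i)) :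
    HasMajorantHom (g := toB6 g R H) blk blkY (D ∘ₗ G')
      (fun (a b : g.Site) => B₀ * (N + N' * Real.exp (δ₀ * ρ) * (κ₃ + κ₄)) * B6.c1 d δ₀ α *
        (1 - N' * (B₀ * Real.exp (δ₀ * ρ) * (κ₁ + κ₂)) * B6.c1 d δ₀ α)⁻¹ * g.len a *
        Real.exp (-((1 - α) * δ₀ * g.dist a b))) :=
  thm37_leftEntry_of_342 blk blkY blkY d δ₀ α ρ B₀ κ₁ κ₂ κ₃ κ₄ N N' (fun y => g.len y) S S' h hY KP KC KP' KC' hB₀ hδ₀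
    hκ hκ' hN hN' hlen hαδ htri hrefl hdnn hlen h261 h263 hsmall hh hhY hSY hcnt hcnt' hKP hlocP hrowP hKC hlocC hrowC
    hKP' hlocP' hrowP' hKC' hlocC' hrowC' h342_1 h342_2 h342_2 hP hC hPL hCL hLeib hinv h388

end LeftEntries

section Cor38

/-- **The walks of Corollary 3.8 from (3.42) for the G′_□** — `B9Thm37Sum.cor38_walk_majorant` (the term of (3.90)
indexed by ω = (□₀, □₁, …, □ₙ): h_{□₀}G′_{□₀}h_{□₀}K(h_{□₁})G′_{□₁}h_{□₁}⋯K(h_{□ₙ})G′_{□ₙ}h_{□ₙ} has the majorant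
1_{S_{□₀}}(y)B₀(L^jη)²(θc₁(α))ⁿe^{−(1−α)δ₀d_ω(y,y′)} for any d_ω certified by the walk's supports, `LB`) with its two
free inputs DISCHARGED: `hT0` (the factor h_{□₀}G′_{□₀}h_{□₀}) by `B9Thm37Sum.hasMajorant_sandwich_local` from (3.42)₁
for G′_{□₀}, and `hR` (the factors K(h_{□ᵢ})G′_{□ᵢ}h_{□ᵢ}, i ≥ 1) by `h389_of_342` from (3.42)₁,₂ for G′_{□ᵢ} and the
structure of K(h_{□ᵢ}); θ = B₀e^{δ₀ρ}(κ₁ + κ₂).  p. 410, Corollary 3.8: *"… for y∈□₀∩Λ_j, y′∈□ₙ. Similar estimates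
hold for the other norms."* — the print shape of (3.94) (the split of θ^{|ω|} into O(M^{−1/2})^{|ω|}M^{−½|ω|}, α = ½,
d_ω = d(ω, y, y′) of (3.93)) is `B9Thm37Sum.cor38_bound_394`, whose inputs `hT0`, `hR` are discharged by the same
two lines (θ₀M^{−1} := B₀e^{δ₀ρ}(κ₁ + κ₂)); it is not repeated here.
[cite: Balaban1985BackgroundPropagators, Cor. 3.8 (3.90)–(3.94) pp.409–410] -/
theorem cor38_walk_of_342 (blk : X → g.Site) (blkY : Y → g.Site) (d : ℕ) (δ₀ α ρ B₀ κ₁ κ₂ : ℝ) {ι : Type}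
    (S S' : ι → Finset g.Site) (h : ι → X → ℝ) (KP KC : ι → g.Site → g.Site → ℝ)
    (ω : ℕ → ι) (F : ℕ → Module.End ℝ (X → ℝ)) (Sw : ℕ → Finset g.Site) (dω : g.Site → g.Site → ℝ) (n : ℕ)
    (hB₀ : 0 ≤ B₀) (hδ₀ : 0 ≤ δ₀) (hκ : 0 ≤ κ₁ + κ₂) (hdnn : ∀ y y' : g.Site, 0 ≤ g.dist y y')
    (hαδ : 0 ≤ α * δ₀) (h1αδ : 0 ≤ (1 - α) * δ₀) (htri : Triangle254 (toB6 g R H))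
    (hlen : ∀ y : g.Site, 0 ≤ g.len y) (h261 : Ineq261 d (toB6 g R H) δ₀ α)
    (hh : ∀ i x, |h i x| ≤ 1) (hS : ∀ i x, h i x ≠ 0 → blk x ∈ S i)
    (hKP : ∀ i a b, 0 ≤ KP i a b) (hlocP : ∀ i a y'', KP i a y'' ≠ 0 → g.dist a y'' ≤ ρ)
    (hrowP : ∀ i (a : g.Site), ∑ y'' : g.Site, KP i a y'' * g.len y'' ≤ if a ∈ S' i then κ₁ else 0)
    (hKC : ∀ i a b, 0 ≤ KC i a b) (hlocC : ∀ i a y'', KC i a y'' ≠ 0 → g.dist a y'' ≤ ρ)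
    (hrowC : ∀ i (a : g.Site), ∑ y'' : g.Site, KC i a y'' * g.len y'' ^ 2 ≤ if a ∈ S' i then κ₂ else 0)
    {Gsq Cop : ι → Module.End ℝ (X → ℝ)} {D : (X → ℝ) →ₗ[ℝ] (Y → ℝ)} {P : ι → (Y → ℝ) →ₗ[ℝ] (X → ℝ)}
    (h342_1 : ∀ i, HasMajorant (g := toB6 g R H) blk (Gsq i)
      (fun a b => B₀ * g.len a ^ 2 * Real.exp (-(δ₀ * g.dist a b))))
    (h342_2 : ∀ i, HasMajorantHom (g := toB6 g R H) blk blkY (D ∘ₗ Gsq i)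
      (fun a b => B₀ * g.len a * Real.exp (-(δ₀ * g.dist a b))))
    (hP : ∀ i, HasMajorantHom (g := toB6 g R H) blkY blk (P i) (KP i))
    (hC : ∀ i, HasMajorant (g := toB6 g R H) blk (Cop i) (KC i))
    (hF0 : F 0 = mulOp (h (ω 0)) * Gsq (ω 0) * mulOp (h (ω 0)))
    (hF : ∀ k, 1 ≤ k → k ≤ n → F k = (P (ω k) ∘ₗ D + Cop (ω k)) * Gsq (ω k) * mulOp (h (ω k)))
    (hSw0 : Sw 0 = S (ω 0)) (hSw : ∀ k, 1 ≤ k → k ≤ n → Sw k = S' (ω k))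
    (hdω : ∀ a b : g.Site, LB g.dist Sw n a b (dω a b)) :
    HasMajorant (g := toB6 g R H) blk (lprod F n)
      (fun (a b : g.Site) => (if a ∈ S (ω 0) then B₀ * g.len a ^ 2 else 0) *
        (B₀ * Real.exp (δ₀ * ρ) * (κ₁ + κ₂) * B6.c1 d δ₀ α) ^ n * Real.exp (-((1 - α) * δ₀ * dω a b))) := by
  have hθ : 0 ≤ B₀ * Real.exp (δ₀ * ρ) * (κ₁ + κ₂) := mul_nonneg (mul_nonneg hB₀ (Real.exp_nonneg _)) hκ
  have hT0 : HasMajorant (g := toB6 g R H) blk (F 0)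
      (fun (a b : g.Site) => if a ∈ Sw 0 then B₀ * g.len a ^ 2 * Real.exp (-(δ₀ * g.dist a b)) else 0) := by
    rw [hF0, hSw0]
    exact hasMajorant_sandwich_local (R := R) (H := H) blk (h342_1 (ω 0)) (h (ω 0)) (hh (ω 0)) (S (ω 0)) (hS (ω 0))
  have h389 := h389_of_342 (R := R) (H := H) blk blkY δ₀ ρ B₀ κ₁ κ₂ S' h KP KC hB₀ hδ₀ htri hlen hh hKP hlocP
    hrowP hKC hlocC hrowC h342_1 h342_2 hP hC
  have hR : ∀ k, 1 ≤ k → k ≤ n → HasMajorant (g := toB6 g R H) blk (F k)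
      (fun (a b : g.Site) => if a ∈ Sw k then
        B₀ * Real.exp (δ₀ * ρ) * (κ₁ + κ₂) * Real.exp (-(δ₀ * g.dist a b)) else 0) := by
    intro k hk hkn
    rw [hF k hk hkn, hSw k hk hkn]
    exact h389 (ω k)
  have hmain := cor38_walk_majorant (R := R) (H := H) blk d δ₀ α (B₀ * Real.exp (δ₀ * ρ) * (κ₁ + κ₂)) B₀ Sw F dω n
    hB₀ hθ hdnn hαδ h1αδ h261 hT0 hR hdω
  refine hasMajorant_mono (g := toB6 g R H) blk hmain fun a b => le_of_eq ?_
  rw [hSw0]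

end Cor38

/-! ## v3 ADDENDUM — the lattice Leibniz rule of the covariant derivative D = ∇_U through the multiplication by a
scalar lattice function h (the h_□ of the partition of unity), in COMPONENTS, and entry 2 of (3.42) for G′ with the
hypothesis `hLeib` of `thm37_entry2_of_342` DISCHARGED

p. 390 (verbatim): *"Let us recall that R(U)X = UXU^{−1}."* … *"Let us introduce covariant derivatives. For a matrix
valued function A defined at points of the lattice we put (D^η_{U₀}A)(b) = η^{−1}(R(U₀(b))A(b₊) − A(b₋)),"*; p. 391
(verbatim): *"or (D^η_{U₀,μ}A)(x) = (D^η_{U₀}A)(x, x + ηe_μ), μ = 1,…,d. (3.3)"* … *"Let us also drop the symbols η, U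
in the symbols denoting covariant derivatives, thus we write simply D, D_μ."*; p. 409, the first line of (3.88)
(verbatim): *"Using (3.50) we get for x∈Δ(y), y∈Λ_j, (Δ′_a hλ)(x) = h(x)(Δ′_aλ)(x) − Σ_{b∈st(x)}(∂h)(b)(Dλ)(b) +
(Δh)(x)λ(x) + …"*; [4] p. 229 (verbatim): *"(K(h)λ)(x) = Σ_{b∈st(x)}(∂h)(b)(∂λ)(b) − (Δh)(x)λ(x) − a_j(L^jη)^{−2}
Σ_{x′∈B^j(y^j(x))}L^{−jd}(∂h)(Γ^{(j)}_{x,y^j(x),x′})λ(x′) if x ∈ B^j(Λ_j). (2.39) The derivatives above are on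
η-scale."*, p. 230 (verbatim): *"|(K(h_□)G′(□)h_□λ)(x)| ≦ O(M^{−1})e^{−δ₀|x−y|}|λ| (2.44)"*.

THE COMPONENT MODEL (cell record D-pv21g5.1; of it, only the displayed definition of D is in print).  The sites of
the η-lattice form a type `St`, its (oriented) bonds a type `Bd` with end points `src b` = b₋, `tgt b` = b₊; a matrix
valued function is a real function on `St × Cp`, `Cp` a finite set indexing real components of the matrix space; the
rotation R(U(b)) acts on the components at b through an ARBITRARY real matrix `Rm b : Cp → Cp → ℝ`, and the prefactor
η^{−1} is an ARBITRARY real weight `c b` (so rescaled derivatives are covered as well).  Then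
`covD src tgt c Rm : (St × Cp → ℝ) →ₗ[ℝ] (Bd × Cp → ℝ)`, (covD f)(b, i) = c(b)(Σ_j Rm(b)_{ij}f(b₊, j) − f(b₋, i)), is
the displayed D read in components, and for a SCALAR (real valued) lattice function h — multiplying every component
at x by the same number h(x), `mulOp (h ∘ Prod.fst)`, hence commuting with R(U(b)) — one has, bond by bond, the
lattice Leibniz rule
    D(hf)(b) = h(b₊)(Df)(b) + (∂h)(b)f(b₋),   (∂h)(b) := c(b)(h(b₊) − h(b₋))                                    (L)
(`covD_comp_mulOp`: `covD ∘ₗ M_{h∘pr₁} = M_{h∘b₊∘pr₁} ∘ₗ covD + leibRem h`, (leibRem h f)(b, i) = (∂h)(b)f(b₋, i)) —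
exactly the shape `hLeib : D∘M_{h_□} = M_{h^Y_□}∘D + (P′_□∘D + C′_□)` asked for by `thm37_leftEntry_of_342` /
`thm37_entry2_of_342`, with h^Y_□ = h_□∘b₊, P′_□ = 0, C′_□ = leibRem h_□ (the term −Σ_{b∈st(x)}(∂h)(b)(Dλ)(b) of
(3.88) is this commutator seen from the Laplacian).  (L) is an algebraic identity: no smallness, R(U(b)) arbitrary.

* `covD`, `covD_apply`, `leibRem`, `leibRem_apply`, `covD_comp_mulOp` — the model and the identity (L);
* `leibRem_majorant` — the two-space majorant of the commutator: if |(∂h_□)(b)| ≦ K′(y, y″) whenever the bond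
  (component) (b, i) lies in the block of y and the site (component) (b₋, i) in the block of y″, for an entrywise
  nonnegative kernel K′, then `leibRem h_□` has the majorant K′ (the hypothesis `hCL` of `thm37_entry2_of_342`);
* `thm37_entry2_of_342_lattice` — **entry 2 of (3.42) for G′ = G′(U)** (*"with (L^jη)² replaced by L^jη"*, [4]
  p. 234) for D = `covD src tgt c Rm` and the partition of unity h_□∘pr₁: `thm37_entry2_of_342` with `hLeib` (by
  `covD_comp_mulOp`), `hPL` (P′_□ = 0, κ₃ = 0), `hCL` (by `leibRem_majorant`), `hhY` (|h_□∘b₊| ≦ 1 from |h_□| ≦ 1)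
  DISCHARGED.  Conclusion: ∇_UG′ has the majorant B₀(N + N′e^{δ₀ρ}κ₄)c₁(α)(1 − N′θc₁(α))^{−1}L^jηe^{−(1−α)δ₀d(y,y′)},
  θ = B₀e^{δ₀ρ}(κ₁ + κ₂).

NOT ASSERTED in this addendum (hypotheses): everything listed for v1/v2 except `hLeib`, `hPL`, `hCL`, `hhY`, namely
Corollary 3.6 entries 1, 2 for the G′_□ (now with D = `covD …`); K(h_□) = P_□∘D + C_□ with its kernels (κ₁, κ₂);
(3.88) `h388` and `hinv`; Lemma 2.1 of [4]; the counts N, N′; the located smallness; and, replacing the SIZE κ₄ of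
v2, the entrywise block domination `hdh` of (∂h_□)(b) = c(b)(h_□(b₊) − h_□(b₋)) by a nonnegative kernel K′_□ of range
≦ ρ with row-sums ≦ κ₄L^jη1_{S′_□} against (L^{j″}η)² — the size ∂h_□ = O((ML^jη)^{−1}) being implicit in (1.118)
[`Balaban1984PropagatorsI`] / (2.36)–(2.40) [4] and NOT displayed in print (cell GAPS G-pv21g4-1 (i), unchanged);
supp(h_□∘b₊) within the bond blocks of S_□ (`hSY`).  The identification of B9's g-valued (matrix valued) functions
and of R(U(b)) with real components / real matrices is the model's, not the paper's (any faithful real-linear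
coordinatisation will do, (L) holding for every `Rm`).  Value: kernel-checked bookkeeping, NOT summit progress. -/

section LatticeLeibniz

variable {St Cp Bd : Type}

/-- **The covariant derivative D = ∇_U in components** (p. 390: *"(D^η_{U₀}A)(b) = η^{−1}(R(U₀(b))A(b₊) − A(b₋))"*,
(3.3) p. 391): (covD f)(b, i) = c(b)(Σ_j Rm(b)_{ij} f(b₊, j) − f(b₋, i)) for a real function f on sites × components,
with b₋ = `src b`, b₊ = `tgt b`, the weight c(b) (= η^{−1}) and the real matrix Rm(b) (= R(U(b)) in components)
arbitrary. [cite: Balaban1985BackgroundPropagators, (3.3) pp.390–391] -/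
def covD [Fintype Cp] (src tgt : Bd → St) (c : Bd → ℝ) (Rm : Bd → Cp → Cp → ℝ) :
    (St × Cp → ℝ) →ₗ[ℝ] (Bd × Cp → ℝ) where
  toFun f := fun q => c q.1 * (∑ j, Rm q.1 q.2 j * f (tgt q.1, j) - f (src q.1, q.2))
  map_add' f f' := by
    funext q
    simp only [Pi.add_apply, mul_add, Finset.sum_add_distrib]
    ring
  map_smul' r f := by
    funext q
    have hs : ∑ j, Rm q.1 q.2 j * (r * f (tgt q.1, j)) = r * ∑ j, Rm q.1 q.2 j * f (tgt q.1, j) := by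
      rw [Finset.mul_sum]
      exact Finset.sum_congr rfl fun j _ => by ring
    simp only [Pi.smul_apply, smul_eq_mul, RingHom.id_apply, hs]
    ring

/-- Unfolding equation of `covD`. [folklore] -/
@[simp] theorem covD_apply [Fintype Cp] (src tgt : Bd → St) (c : Bd → ℝ) (Rm : Bd → Cp → Cp → ℝ) (f : St × Cp → ℝ)
    (q : Bd × Cp) : covD src tgt c Rm f q = c q.1 * (∑ j, Rm q.1 q.2 j * f (tgt q.1, j) - f (src q.1, q.2)) := rfl

/-- **The Leibniz remainder (commutator) of D through the multiplication by a scalar lattice function h**: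
(leibRem h f)(b, i) = (∂h)(b)f(b₋, i) with (∂h)(b) = c(b)(h(b₊) − h(b₋)) the lattice derivative of h along b —
the coefficient ∂h of K(h) in [4] (2.39) p. 229 / the term −Σ_{b∈st(x)}(∂h)(b)(Dλ)(b) of (3.88) p. 409.
[cite: Balaban1985BackgroundPropagators, (3.88) p.409; Balaban1984PropagatorsII, (2.39) p.229] -/
def leibRem (src tgt : Bd → St) (c : Bd → ℝ) (h : St → ℝ) : (St × Cp → ℝ) →ₗ[ℝ] (Bd × Cp → ℝ) where
  toFun f := fun q => c q.1 * (h (tgt q.1) - h (src q.1)) * f (src q.1, q.2)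
  map_add' f f' := by
    funext q
    simp only [Pi.add_apply]
    ring
  map_smul' r f := by
    funext q
    simp only [Pi.smul_apply, smul_eq_mul, RingHom.id_apply]
    ring

/-- Unfolding equation of `leibRem`. [folklore] -/
@[simp] theorem leibRem_apply (src tgt : Bd → St) (c : Bd → ℝ) (h : St → ℝ) (f : St × Cp → ℝ) (q : Bd × Cp) :
    leibRem src tgt c h f q = c q.1 * (h (tgt q.1) - h (src q.1)) * f (src q.1, q.2) := rfl

/-- **The lattice Leibniz rule of the covariant derivative** (L): D∘M_h = M_{h∘b₊}∘D + leibRem h, i.e.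
D(hf)(b) = h(b₊)(Df)(b) + (∂h)(b)f(b₋) bond by bond, for a SCALAR lattice function h (it multiplies every component
at a site by the same real number, so it commutes with R(U(b))) — the shape `hLeib` of `thm37_leftEntry_of_342` with
h^Y = h∘b₊, P′ = 0, C′ = leibRem h; an algebraic identity valid for every weight c and every matrix field Rm (the
computation behind the first line of (3.88), p. 409: *"Using (3.50) we get … (Δ′_a hλ)(x) = h(x)(Δ′_aλ)(x) −
Σ_{b∈st(x)}(∂h)(b)(Dλ)(b) + (Δh)(x)λ(x) + …"*). [cite: Balaban1985BackgroundPropagators, (3.3) pp.390–391 + (3.88) p.409] -/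
theorem covD_comp_mulOp [Fintype Cp] (src tgt : Bd → St) (c : Bd → ℝ) (Rm : Bd → Cp → Cp → ℝ) (h : St → ℝ) :
    covD src tgt c Rm ∘ₗ mulOp (h ∘ Prod.fst) =
      mulOp (h ∘ tgt ∘ Prod.fst) ∘ₗ covD src tgt c Rm + leibRem src tgt c h := by
  apply LinearMap.ext
  intro f
  funext q
  have hs : ∑ j, Rm q.1 q.2 j * (h (tgt q.1) * f (tgt q.1, j)) = h (tgt q.1) * ∑ j, Rm q.1 q.2 j * f (tgt q.1, j) := by
    rw [Finset.mul_sum]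
    exact Finset.sum_congr rfl fun j _ => by ring
  simp only [LinearMap.comp_apply, LinearMap.add_apply, Pi.add_apply, mulOp_apply, covD_apply, leibRem_apply,
    Function.comp_apply, hs]
  ring

omit [DecidableEq g.Site] in
/-- **The two-space majorant of the Leibniz remainder**: if the lattice derivative (∂h_□)(b) = c(b)(h_□(b₊) − h_□(b₋))
is dominated, for every bond component (b, i), by K′(y, y″) ≧ 0 with y the block of the bond component (b, i) (bond
block map `blkY`) and y″ the block of the site component (b₋, i) (site block map `blk`), then `leibRem h_□` has the
majorant K′ in the sense of `B6RandomWalkHom.HasMajorantHom` — the hypothesis `hCL` of `thm37_entry2_of_342` for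
C′_□ = leibRem h_□ (the SIZE of ∂h_□, O((ML^jη)^{−1}) for the partition of unity of [4] Sect. A, is carried by K′
and is not displayed in print). [cite: Balaban1984PropagatorsII, (2.39)–(2.40) pp.229–230 + (2.51) p.232] -/
theorem leibRem_majorant (blk : St × Cp → g.Site) (blkY : Bd × Cp → g.Site) (src tgt : Bd → St) (c : Bd → ℝ)
    (h : St → ℝ) (K : g.Site → g.Site → ℝ) (hK : ∀ a b, 0 ≤ K a b)
    (hdh : ∀ v : Bd × Cp, |c v.1 * (h (tgt v.1) - h (src v.1))| ≤ K (blkY v) (blk (src v.1, v.2))) :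
    HasMajorantHom (g := toB6 g R H) blk blkY (leibRem src tgt c h) K := by
  intro y' μ B hμ v
  show |c v.1 * (h (tgt v.1) - h (src v.1)) * μ (src v.1, v.2)| ≤ K (blkY v) y' * B
  by_cases hx : blk (src v.1, v.2) = y'
  · rw [abs_mul, ← hx]
    exact mul_le_mul (hdh v) (hμ.bound _ hx) (abs_nonneg _) (hK _ _)
  · rw [hμ.off _ hx, mul_zero, abs_zero]
    exact mul_nonneg (hK _ _) hμ.nonneg

/-- **Entry 2 of (3.42) for G′ = G′(U) with the Leibniz rule DISCHARGED** — `thm37_entry2_of_342` for the covariant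
derivative D = `covD src tgt c Rm` of (3.3) in components and the scalar partition of unity {h_□} (h_□∘pr₁ on site
components, h_□∘b₊∘pr₁ on bond components): the structural hypotheses `hLeib` (by `covD_comp_mulOp`), `hPL` (P′_□ = 0,
κ₃ = 0), `hCL` (by `leibRem_majorant` from the entrywise block domination `hdh` of ∂h_□ by K′_□) and `hhY` (from
|h_□| ≦ 1) of the v2 theorem are supplied; the remaining inputs are those of `thm37_entry1_of_342` (Corollary 3.6
entries 1, 2 for the G′_□, K(h_□) = P_□∘D + C_□ with kernels of row-sums ≦ κ₁1_{S′_□}, κ₂1_{S′_□}, G′Δ′_a = I, (3.88),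
Lemma 2.1 of [4], the counts N, N′, the located smallness N′θc₁(α) < 1) plus the kernel K′_□ ≧ 0 of range ≦ ρ and
row-sums ≦ κ₄L^jη1_{S′_□} against (L^{j″}η)² dominating ∂h_□ (its size is NOT displayed in print, cf. the module
docstring) and supp(h_□∘b₊) within the bond blocks of S_□.  Conclusion: |(∇_UG′λ)(b)| ≦ B₀(N + N′e^{δ₀ρ}κ₄)c₁(α)
(1 − N′θc₁(α))^{−1}L^jηe^{−(1−α)δ₀d(y,y′)}|λ| for b in the block of y, supp λ ⊂ Δ(y′) — entry 2 of (3.42) for G′,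
[4] p. 234: *"with (L^jη)² replaced by L^jη"*.
[cite: Balaban1985BackgroundPropagators, (3.3) pp.390–391, Thm 3.7 (3.87)–(3.90) pp.409–410, (3.42) p.397; Balaban1984PropagatorsII, Prop 2.2 (2.67) p.234] -/
theorem thm37_entry2_of_342_lattice [Fintype St] [DecidableEq St] [Fintype Bd] [DecidableEq Bd] [Fintype Cp]
    [DecidableEq Cp]
    (src tgt : Bd → St) (c : Bd → ℝ) (Rm : Bd → Cp → Cp → ℝ)
    (blk : St × Cp → g.Site) (blkY : Bd × Cp → g.Site) (d : ℕ) (δ₀ α ρ B₀ κ₁ κ₂ κ₄ N N' : ℝ) {ι : Type}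
    [Fintype ι] (S S' : ι → Finset g.Site) (hs : ι → St → ℝ) (KP KC KC' : ι → g.Site → g.Site → ℝ)
    {G' Δ : Module.End ℝ (St × Cp → ℝ)}
    (hB₀ : 0 ≤ B₀) (hδ₀ : 0 ≤ δ₀) (hκ : 0 ≤ κ₁ + κ₂) (hκ₄ : 0 ≤ κ₄) (hN : 0 ≤ N) (hN' : 0 ≤ N')
    (hαδ : 0 ≤ (1 - α) * δ₀)
    (htri : Triangle254 (toB6 g R H)) (hrefl : ∀ y : g.Site, g.dist y y = 0)
    (hdnn : ∀ y y' : g.Site, 0 ≤ g.dist y y') (hlen : ∀ y : g.Site, 0 ≤ g.len y)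
    (h261 : Ineq261 d (toB6 g R H) δ₀ α) (h263 : Ineq263 d (toB6 g R H) δ₀ α)
    (hsmall : N' * (B₀ * Real.exp (δ₀ * ρ) * (κ₁ + κ₂)) * B6.c1 d δ₀ α < 1)
    (hh : ∀ i x, |hs i x| ≤ 1) (hSY : ∀ i (v : Bd × Cp), hs i (tgt v.1) ≠ 0 → blkY v ∈ S i)
    (hcnt : ∀ a : g.Site, (∑ i, if a ∈ S i then (1 : ℝ) else 0) ≤ N)
    (hcnt' : ∀ a : g.Site, (∑ i, if a ∈ S' i then (1 : ℝ) else 0) ≤ N')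
    (hKP : ∀ i a b, 0 ≤ KP i a b) (hlocP : ∀ i a y'', KP i a y'' ≠ 0 → g.dist a y'' ≤ ρ)
    (hrowP : ∀ i (a : g.Site), ∑ y'' : g.Site, KP i a y'' * g.len y'' ≤ if a ∈ S' i then κ₁ else 0)
    (hKC : ∀ i a b, 0 ≤ KC i a b) (hlocC : ∀ i a y'', KC i a y'' ≠ 0 → g.dist a y'' ≤ ρ)
    (hrowC : ∀ i (a : g.Site), ∑ y'' : g.Site, KC i a y'' * g.len y'' ^ 2 ≤ if a ∈ S' i then κ₂ else 0)
    (hKC' : ∀ i a b, 0 ≤ KC' i a b) (hlocC' : ∀ i a y'', KC' i a y'' ≠ 0 → g.dist a y'' ≤ ρ)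
    (hrowC' : ∀ i (a : g.Site), ∑ y'' : g.Site, KC' i a y'' * g.len y'' ^ 2 ≤
      if a ∈ S' i then κ₄ * g.len a else 0)
    (hdh : ∀ i (v : Bd × Cp), |c v.1 * (hs i (tgt v.1) - hs i (src v.1))| ≤ KC' i (blkY v) (blk (src v.1, v.2)))
    {Gsq Cop : ι → Module.End ℝ (St × Cp → ℝ)} {P : ι → (Bd × Cp → ℝ) →ₗ[ℝ] (St × Cp → ℝ)}
    (h342_1 : ∀ i, HasMajorant (g := toB6 g R H) blk (Gsq i)
      (fun a b => B₀ * g.len a ^ 2 * Real.exp (-(δ₀ * g.dist a b))))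
    (h342_2 : ∀ i, HasMajorantHom (g := toB6 g R H) blk blkY (covD src tgt c Rm ∘ₗ Gsq i)
      (fun a b => B₀ * g.len a * Real.exp (-(δ₀ * g.dist a b))))
    (hP : ∀ i, HasMajorantHom (g := toB6 g R H) blkY blk (P i) (KP i))
    (hC : ∀ i, HasMajorant (g := toB6 g R H) blk (Cop i) (KC i))
    (hinv : G' * Δ = 1)
    (h388 : Δ * (∑ i, mulOp (hs i ∘ Prod.fst) * Gsq i * mulOp (hs i ∘ Prod.fst)) =
      1 - ∑ i, (P i ∘ₗ covD src tgt c Rm + Cop i) * Gsq i * mulOp (hs i ∘ Prod.fst)) :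
    HasMajorantHom (g := toB6 g R H) blk blkY (covD src tgt c Rm ∘ₗ G')
      (fun (a b : g.Site) => B₀ * (N + N' * Real.exp (δ₀ * ρ) * κ₄) * B6.c1 d δ₀ α *
        (1 - N' * (B₀ * Real.exp (δ₀ * ρ) * (κ₁ + κ₂)) * B6.c1 d δ₀ α)⁻¹ * g.len a *
        Real.exp (-((1 - α) * δ₀ * g.dist a b))) := by
  -- the four structural inputs of `thm37_entry2_of_342`, supplied by the component model
  have hLeib : ∀ i, covD src tgt c Rm ∘ₗ mulOp (hs i ∘ Prod.fst) =
      mulOp (hs i ∘ tgt ∘ Prod.fst) ∘ₗ covD src tgt c Rm +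
        ((0 : (Bd × Cp → ℝ) →ₗ[ℝ] (Bd × Cp → ℝ)) ∘ₗ covD src tgt c Rm + leibRem src tgt c (hs i)) := fun i => by
    rw [LinearMap.zero_comp, zero_add]
    exact covD_comp_mulOp src tgt c Rm (hs i)
  have hPL : ∀ i : ι, HasMajorantHom (g := toB6 g R H) blkY blkY ((fun _ : ι => (0 : (Bd × Cp → ℝ) →ₗ[ℝ] (Bd × Cp → ℝ))) i)
      ((fun (_ : ι) (_ _ : g.Site) => (0 : ℝ)) i) :=
    fun i => hasMajorantHom_zero (g := toB6 g R H) blkY blkY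
  have hCL : ∀ i, HasMajorantHom (g := toB6 g R H) blk blkY (leibRem src tgt c (hs i)) (KC' i) :=
    fun i => leibRem_majorant blk blkY src tgt c (hs i) (KC' i) (hKC' i) (hdh i)
  have hκ' : (0 : ℝ) ≤ 0 + κ₄ := by rw [zero_add]; exact hκ₄
  have hrowP' : ∀ i (a : g.Site), ∑ y'' : g.Site, (fun (_ : ι) (_ _ : g.Site) => (0 : ℝ)) i a y'' * g.len y'' ≤
      if a ∈ S' i then 0 * g.len a else 0 := fun i a => by simp
  have hmain := thm37_entry2_of_342 (R := R) (H := H) blk blkY d δ₀ α ρ B₀ κ₁ κ₂ 0 κ₄ N N' S S'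
    (fun i => hs i ∘ Prod.fst) (fun i => hs i ∘ tgt ∘ Prod.fst) KP KC (fun _ _ _ => 0) KC' hB₀ hδ₀ hκ hκ' hN hN'
    hαδ htri hrefl hdnn hlen h261 h263 hsmall (fun i p => hh i p.1) (fun i v => hh i (tgt v.1)) hSY hcnt hcnt' hKP
    hlocP hrowP hKC hlocC hrowC (fun _ _ _ => le_rfl) (fun _ _ _ h0 => absurd rfl h0) hrowP' hKC' hlocC' hrowC'
    (PL := fun _ => 0) (CL := fun i => leibRem src tgt c (hs i)) h342_1 h342_2 hP hC hPL hCL hLeib hinv h388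
  refine hasMajorantHom_mono (g := toB6 g R H) blk blkY hmain fun a b => le_of_eq ?_
  rw [zero_add]

end LatticeLeibniz

/-! ## v4 ADDENDUM — entry 3 of (3.42) for G′ (the RIGHT entry G′(U)∇*_U) from the structure of the expansion of
Theorem 3.7, TRANSPOSED, and the adjoint D* = ∇*_U of (3.8) in COMPONENTS (cell record D-pv21g5.2)

p. 391 (verbatim): *"In the sequel we will frequently use adjoint operators to derivatives D. The adjoints are taken
with respect to natural L² scalar products for functions with values in N × N hermitian matrices. The inner product
for these matrices is defined"* — p. 392 (verbatim) — *"by X·Y = tr XY. Let us recall that the trace is normalized,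
i.e., tr 1 = 1. For example, for derivative D acting on functions defined at points of the lattice, the adjoint
operator D* is acting on functions A defined at bonds of the lattice by the formulas (D*A)(x) = Σ_{μ=1}^d η^{−1}(R(U(x,
x − ηe_μ))A(x − ηe_μ, x) − A(x, x + ηe_μ)) = Σ_{μ=1}^d (D*_μA_μ)(x) = Σ_{μ=1}^d (DA_μ)(x, x − ηe_μ). (3.8)"*; p. 391
(verbatim): *"U(x, x′) = U^{−1}(x′, x), A(x, x′) = −A(x′, x) for a bond ⟨x, x′⟩. (3.5)"*; p. 397, (3.42), the third
of the four displayed entries: |(G′(U)∇*_Uλ)(x)| ≦ B₀L^jηe^{−δ₀d(y,y′)}|λ| for x∈Δ(y), y∈Λ_j, supp λ ⊂ Δ(y′); p. 409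
(verbatim): *"As in [4] we have to express the operators Δ′_aG′₀, (Q′G′²Q′)C₀, Δ_aG₀ as small perturbations of
identity. Let us start with the operator Δ′_aG′₀."* … *"hence Δ′_aG′₀ = I − Σ_□K(h_□)G′_□h_□ = I − R′."*; Theorem 3.7,
p. 409 (verbatim): *"For M sufficiently large, and a configuration U satisfying (3.35), the operator G′ can be
represented as G′ = G′₀(I − R′)^{−1} = G′₀Σ_{n=0}^∞R′ⁿ = Σ_ω h_{□₀}G′_{□₀}h_{□₀}K(h_{□₁})G′_{□₁}h_{□₁}·…·K(h_{□ₙ})G′_{□ₙ}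
h_{□ₙ}, (3.90) where ω = (□₀, □₁, ⋯, □ₙ), □ᵢ∈𝒟, □ᵢ∩□ᵢ₊₁ ≠ ∅. The expansion is convergent in all norms appearing in
the inequalities (3.42)–(3.47)."*

THE TRANSPOSED EXPANSION.  The printed identities G′Δ′_a = I (`hinv`) and Δ′_aG′₀ = I − R′ (`h388`) give the right
fixed point G′ = G′₀ + G′R′ (`B9Thm37Sum.fixedPoint_of_388`), which closes on the LEFT entries EG′ (v2) but not on a
right entry G′D*: (G′D*) = G′₀D* + G′R′D*.  For the right entry this addendum uses instead the relations
Δ′_aG′ = I — the same `hinv`, the site space being finite dimensional (`mul_eq_one_comm`) — and the TRANSPOSE of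
(3.88), in the form
    G′₀Δ′_a = I − V,   V = Σ_□ h_□G′_□(D*Pᵗ_□ + Cᵗ_□)                                                     (`h388T`)
(for the symmetric operators Δ′_a, G′_□, M_{h_□} of the paper this is (3.88) transposed: M_hΔ′_a = Δ′_aM_h − K(h)ᵗ
with K(h)ᵗ = DᵗPᵗ + Cᵗ = D*Pᵗ + Cᵗ for K(h) = P∘D + C, and h_□G′_□Δ′_a = h_□ from Δ′_aG′_□h_□ = h_□), whence the
LEFT fixed point G′ = G′₀ + VG′ (`fixedPoint_of_388T`) and G′D* = G′₀D* + V(G′D*), closed on T = G′D*.  `h388T` is a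
HYPOTHESIS, exactly as `h388` is in v1/v2; the addendum does not derive it from (3.88).

THE COMPONENT MODEL OF D* (only the displayed (3.8) is in print).  With the v3 model (`St`, `Bd`, `src` = b₋,
`tgt` = b₊, components `Cp`, weight `c b`, real matrix `Rm b`), `covDT src tgt c Rm : (Bd × Cp → ℝ) →ₗ[ℝ] (St × Cp → ℝ)`,
    (covDT g)(x, i) = Σ_{b : b₊ = x} c(b) Σ_k Rm(b)_{ki} g(b, k) − Σ_{b : b₋ = x} c(b) g(b, i),
is the TRANSPOSE of `covD` for the component sums (`sum_covDT_mul` : Σ_p (covDT g)(p)f(p) = Σ_q g(q)(covD f)(q), a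
kernel-checked identity); for R(U(b)) orthogonal on the trace-orthonormal components and the common weight η^d of
sites and bonds it is the displayed D* of (3.8) (A(x − ηe_μ, x) = the bond b = ⟨x − ηe_μ, x⟩ with b₊ = x, rotated by
R(U(x, x − ηe_μ)) = R(U(b))^{−1} = R(U(b))ᵗ, (3.5); −A(x, x + ηe_μ) = the bond with b₋ = x).  For a SCALAR lattice
function h one has, site by site, the right Leibniz rule
    h(x)(D*g)(x) = (D*(h(b₊)g))(x) + Σ_{b : b₋ = x}(∂h)(b)g(b),   (∂h)(b) = c(b)(h(b₊) − h(b₋))                   (Lᵗ)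
(`mulOp_comp_covDT` : M_{h∘pr₁} ∘ covDT = covDT ∘ M_{h∘b₊∘pr₁} + leibRemT h — the transpose of v3's (L)), an
algebraic identity (Rm(b), c(b) arbitrary).

* `fixedPoint_of_388T`; `hasMajorantHom_mulOp_local` (a left factor M_{h_□}, |h_□| ≦ 1, supp h_□ within the blocks
  of S_□, localizes a two-space majorant to 1_{S_□}(y)K);
* `rightEntry_cube_majorant` — the term h_□G′_□h_□D* = h_□G′_□D*h^Y_□ + h_□G′_□C′ᵗ_□ of G′₀D* has the majorant
  (1_{S_□}(y)B₀L^jη + 1_{S′_□}(y′)B₀e^{δ₀ρ}C_ℓκ₄L^jη)e^{−δ₀d(y,y′)} from entries 1, 3 of (3.42) for G′_□, the right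
  Leibniz rule `hLeibT` : M_{h_□}D* = D*M_{h^Y_□} + C′ᵗ_□ and a kernel K_{C′,□} ≧ 0 of range ≦ ρ with COLUMN sums
  Σ_{y″}K_{C′,□}(y″, y′)L^{j′}η ≦ κ₄1_{S′_□}(y′) majorizing C′ᵗ_□, plus the cube comparability L^jη ≦ C_ℓL^{j′}η for
  y ∈ S_□, y′ ∈ S′_□ (`hcomp`; in print both are cubes of 𝒟_j met by one □, C_ℓ ~ L);
* `rightR_cube_majorant` — the term h_□G′_□(D*Pᵗ_□ + Cᵗ_□) of V has the majorant 1_{S′_□}(y′)θ(L^jη/L^{j′}η)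
  e^{−δ₀d(y,y′)}, θ = B₀e^{δ₀ρ}(κ₁ + C_ℓκ₂), from entries 1, 3 of (3.42) for G′_□ and kernels K_{P,□}, K_{C,□} ≧ 0 of
  range ≦ ρ with column sums ≦ κ₁(L^{j′}η)^{−1}1_{S′_□}, κ₂(L^{j′}η)^{−2}1_{S′_□} (the transposes of the v1 shape of the
  coefficients ∂h_□, Δh_□ of K(h_□), [4] (2.39)–(2.40) pp. 229–230; their SIZES O((ML^jη)^{−1}), O((ML^jη)^{−2}) are
  not displayed in print — κ₁, κ₂, κ₄ are free binders, cell GAPS G-pv21g4-1 (i) unchanged);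
* `thm37_rightEntry_of_342` — **Theorem 3.7 ⇒ entry 3 of (3.42) for G′**, D* ABSTRACT: summing the cube majorants
  with the overlap counts N, N′ (`hasMajorantHom_fintypeSum`) and closing the left fixed point with the scale-weighted
  walk bound `B6RandomWalkHom.hom_majorant_of_leftFixedPoint_weighted` (W = L^jη, Q ≡ 1) and Lemma 2.1 of [4] at
  the exponent α: G′D* has the majorant B₀(N + N′e^{δ₀ρ}C_ℓκ₄)c₁(α)(1 − N′θc₁(α))^{−1}L^jηe^{−(1−2α)δ₀d(y,y′)}
  under the located smallness N′θc₁(α) < 1 (*"for M sufficiently large"*);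
* `covDT`, `covDT_apply`, `sum_covDT_mul`, `leibRemT`, `leibRemT_apply`, `mulOp_comp_covDT`, `leibRemT_majorant` —
  the component model of D*, its transposition certificate, (Lᵗ), and the two-space majorant of the remainder
  Σ_{b : b₋ = x}(∂h_□)(b)g(b) from a located domination `hdomT` of Σ|(∂h_□)(b)| by K_{C′,□}(y, y′);
* `thm37_entry3_of_342_lattice` — **entry 3 of (3.42) for G′ with D* = `covDT src tgt c Rm`** and the partition
  h_□∘pr₁: `thm37_rightEntry_of_342` with `hLeibT` (by `mulOp_comp_covDT`, h^Y_□ = h_□∘b₊), `hhY` (|h_□| ≦ 1) and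
  `hCLt` (by `leibRemT_majorant`) DISCHARGED.

NOT ASSERTED in this addendum (hypotheses of `thm37_entry3_of_342_lattice`): Corollary 3.6 entries 1, 3 of (3.42)
for every G′_□ (`h342_1`, `h342_3`, with D* = `covDT …`); `hinv` and the transposed (3.88) `h388T` with its local
operators Pᵗ_□ (sites → bonds), Cᵗ_□ and their kernels (κ₁, κ₂; column sums); the domination `hdomT` of ∂h_□ by
K_{C′,□} (κ₄; column sums) — sizes not displayed in print, as in v1–v3; the partition data |h_□| ≦ 1, supp h_□ within
the blocks of S_□, the counts N, N′ and the comparability constant C_ℓ; Lemma 2.1 of [4] (`h261`, `h263`); the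
geometry d(y, y) = 0, d symmetric and ≧ 0, L^jη > 0, (2.54); the located smallness N′θc₁(α) < 1 and 0 ≦ (1 − 2α)δ₀.
The exponent comes out as (1 − 2α)δ₀ (one α for each use of Lemma 2.1: the sum over cubes inside V(G′D*) and the
walk), where print keeps δ₀ by shrinking it tacitly ([4] p. 234).  The identification of matrix valued functions
with real components and of the L² adjoint with the component transpose is the model's (faithful for trace-orthonormal
components and equal site/bond weights), not the paper's.  Value: kernel-checked bookkeeping, NOT summit progress. -/

section RightEntry

/-- The transposed form of `B9Thm37Sum.fixedPoint_of_388`: Δ′_aG′ = I and G′₀Δ′_a = I − V give G′ = G′₀ + VG′ — a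
LEFT fixed point for G′ and hence for every right entry G′D (the form of the expansion (3.90) obtained by expanding
G′ = (I − V)^{−1}-free: G′₀ = G′₀Δ′_aG′ = (I − V)G′). [folklore] -/
theorem fixedPoint_of_388T {A : Type*} [Ring A] {G' Δ G0 V : A} (hinv : Δ * G' = 1) (h388 : G0 * Δ = 1 - V) :
    G' = G0 + V * G' := by
  have h1 : G0 * Δ * G' = (1 - V) * G' := by rw [h388]
  rw [mul_assoc, hinv, mul_one, sub_mul, one_mul] at h1
  rw [h1, sub_add_cancel]

/-- A LEFT multiplication operator M_h with |h| ≦ 1 and supp h within the blocks of S localizes a two-space majorant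
to 1_S(y)K(y, y′) (the factor h_□ on the left of h_□G′_□(…) in the transposed expansion). [folklore] -/
theorem hasMajorantHom_mulOp_local (blkY : Y → g.Site) (blk : X → g.Site) {T : (Y → ℝ) →ₗ[ℝ] (X → ℝ)}
    {K : g.Site → g.Site → ℝ} (hT : HasMajorantHom (g := toB6 g R H) blkY blk T K) (h : X → ℝ)
    (hh : ∀ x, |h x| ≤ 1) (S : Finset g.Site) (hS : ∀ x, h x ≠ 0 → blk x ∈ S) :
    HasMajorantHom (g := toB6 g R H) blkY blk (mulOp h ∘ₗ T)
      (fun (a b : g.Site) => if a ∈ S then K a b else 0) := by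
  intro y' μ B hμ x
  have hb : |T μ x| ≤ K (blk x) y' * B := hT y' μ B hμ x
  have hKB : 0 ≤ K (blk x) y' * B := (abs_nonneg _).trans hb
  show |h x * T μ x| ≤ (if blk x ∈ S then K (blk x) y' else 0) * B
  rw [abs_mul]
  by_cases hx : h x = 0
  · rw [hx, abs_zero, zero_mul]
    split_ifs
    · exact hKB
    · rw [zero_mul]
  · rw [if_pos (hS x hx)]
    calc |h x| * |T μ x| ≤ 1 * (K (blk x) y' * B) := mul_le_mul (hh x) hb (abs_nonneg _) zero_le_one
      _ = K (blk x) y' * B := one_mul _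

/-- **One term of G′₀∇*_U = Σ_□ h_□G′_□h_□∇*_U** (the transposed reading of (3.87)–(3.88) on a RIGHT entry D*):
by the right Leibniz rule `hLeibT` (M_{h_□}D* = D*M_{h^Y_□} + C′ᵗ_□), h_□G′_□h_□D* = h_□(G′_□D*)h^Y_□ + h_□G′_□C′ᵗ_□;
the first term is localized to S_□ with the majorant of entry 3 of (3.42) for G′_□, the second is entry 1 for G′_□
followed by the LOCAL operator C′ᵗ_□ (kernel ≧ 0 of range ≦ ρ, column sums ≦ κ₄(L^{j′}η)^{−1}1_{S′_□}(y′)), the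
quotient (L^jη)²/(L^{j′}η) being ≦ C_ℓL^jη for blocks y ∈ S_□, y′ ∈ S′_□ meeting one cube (`hcomp`).  Majorant:
[1_{S_□}(y)B₀ + 1_{S′_□}(y′)B₀e^{δ₀ρ}C_ℓκ₄]L^jηe^{−δ₀d(y,y′)}. [cite: Balaban1985BackgroundPropagators, (3.87)–(3.90) p.409, (3.42) p.397; Balaban1984PropagatorsII, (2.52)–(2.55) p.232] -/
theorem rightEntry_cube_majorant (blk : X → g.Site) (blkY : Y → g.Site) (δ₀ ρ B₀ κ₄ Cℓ : ℝ)
    (S S' : Finset g.Site) (h : X → ℝ) (hY : Y → ℝ) (KC' : g.Site → g.Site → ℝ)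
    (hB₀ : 0 ≤ B₀) (hδ₀ : 0 ≤ δ₀) (hκ₄ : 0 ≤ κ₄) (hCℓ : 0 ≤ Cℓ) (htri : Triangle254 (toB6 g R H))
    (hlenpos : ∀ y : g.Site, 0 < g.len y)
    (hh : ∀ x, |h x| ≤ 1) (hS : ∀ x, h x ≠ 0 → blk x ∈ S) (hhY : ∀ v, |hY v| ≤ 1)
    (hcomp : ∀ a b : g.Site, a ∈ S → b ∈ S' → g.len a ≤ Cℓ * g.len b)
    (hKC' : ∀ a b, 0 ≤ KC' a b) (hlocC' : ∀ y'' b, KC' y'' b ≠ 0 → g.dist y'' b ≤ ρ)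
    (hcolC' : ∀ b : g.Site, (∑ y'' : g.Site, KC' y'' b) * g.len b ≤ if b ∈ S' then κ₄ else 0)
    {Gsq : Module.End ℝ (X → ℝ)} {Dstar CLt : (Y → ℝ) →ₗ[ℝ] (X → ℝ)}
    (h342_1 : HasMajorant (g := toB6 g R H) blk Gsq (fun a b => B₀ * g.len a ^ 2 * Real.exp (-(δ₀ * g.dist a b))))
    (h342_3 : HasMajorantHom (g := toB6 g R H) blkY blk (Gsq ∘ₗ Dstar)
      (fun a b => B₀ * g.len a * Real.exp (-(δ₀ * g.dist a b))))
    (hCLt : HasMajorantHom (g := toB6 g R H) blkY blk CLt KC')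
    (hLeibT : mulOp h ∘ₗ Dstar = Dstar ∘ₗ mulOp hY + CLt) :
    HasMajorantHom (g := toB6 g R H) blkY blk ((mulOp h * Gsq * mulOp h) ∘ₗ Dstar)
      (fun (a b : g.Site) => ((if a ∈ S then (1 : ℝ) else 0) * (B₀ * g.len a) +
        (if b ∈ S' then (1 : ℝ) else 0) * (B₀ * Real.exp (δ₀ * ρ) * Cℓ * κ₄ * g.len a)) *
        Real.exp (-(δ₀ * g.dist a b))) := by
  have hsplit : (mulOp h * Gsq * mulOp h) ∘ₗ Dstar =
      mulOp h ∘ₗ (Gsq ∘ₗ (Dstar ∘ₗ mulOp hY)) + mulOp h ∘ₗ (Gsq ∘ₗ CLt) := by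
    have h1 : (mulOp h * Gsq * mulOp h) ∘ₗ Dstar = mulOp h ∘ₗ (Gsq ∘ₗ (mulOp h ∘ₗ Dstar)) := by
      simp only [Module.End.mul_eq_comp, LinearMap.comp_assoc]
    rw [h1, hLeibT]
    simp only [LinearMap.comp_add]
  -- the main term h_□(G′_□D*)h^Y_□, localized by supp h_□
  have hA : HasMajorantHom (g := toB6 g R H) blkY blk (mulOp h ∘ₗ (Gsq ∘ₗ (Dstar ∘ₗ mulOp hY)))
      (fun (a b : g.Site) => if a ∈ S then B₀ * g.len a * Real.exp (-(δ₀ * g.dist a b)) else 0) := by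
    simpa only [LinearMap.comp_assoc] using hasMajorantHom_sandwich_local blkY blk h342_3 hY h hhY hh S hS
  -- the commutator term h_□G′_□C′ᵗ_□: entry 1 followed by a local operator on the right
  have hlen0 : ∀ y : g.Site, 0 ≤ g.len y := fun y => (hlenpos y).le
  have hcol : ∀ b : g.Site, ∑ y'' : g.Site, KC' y'' b ≤ (if b ∈ S' then κ₄ else 0) * (g.len b)⁻¹ := by
    intro b
    rw [← div_eq_mul_inv, le_div_iff₀ (hlenpos b)]
    exact hcolC' b
  have hB0 : HasMajorantHom (g := toB6 g R H) blkY blk (Gsq ∘ₗ CLt)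
      (fun (a b : g.Site) => B₀ * Real.exp (δ₀ * ρ) * (g.len a ^ 2) * ((if b ∈ S' then κ₄ else 0) * (g.len b)⁻¹) *
        Real.exp (-(δ₀ * g.dist a b))) := by
    refine hasMajorantHom_mono (g := toB6 g R H) blkY blk (hom_majorant_comp_localRight (g := toB6 g R H) blkY
      blk blk δ₀ ρ B₀ (fun (a : g.Site) => g.len a ^ 2) (fun (b : g.Site) => (if b ∈ S' then κ₄ else 0) * (g.len b)⁻¹)
      KC' hB₀ (fun y => sq_nonneg _) hδ₀ htri hKC' hlocC' hcol
      ((hasMajorantHom_iff (g := toB6 g R H) blk Gsq _).mpr h342_1) hCLt) fun a b => le_of_eq ?_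
    simp only [toB6_dist]
  have hB := hasMajorantHom_mulOp_local blkY blk hB0 h hh S hS
  rw [hsplit]
  refine hasMajorantHom_mono (g := toB6 g R H) blkY blk (hasMajorantHom_add (g := toB6 g R H) blkY blk hA hB)
    fun (a b : g.Site) => ?_
  have hE : 0 ≤ Real.exp (-(δ₀ * g.dist a b)) := Real.exp_nonneg _
  have hlen0a : 0 ≤ g.len a := hlen0 a
  show (if a ∈ S then B₀ * g.len a * Real.exp (-(δ₀ * g.dist a b)) else 0) +
      (if a ∈ S then B₀ * Real.exp (δ₀ * ρ) * (g.len a ^ 2) * ((if b ∈ S' then κ₄ else 0) * (g.len b)⁻¹) *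
        Real.exp (-(δ₀ * g.dist a b)) else 0) ≤
    ((if a ∈ S then (1 : ℝ) else 0) * (B₀ * g.len a) +
      (if b ∈ S' then (1 : ℝ) else 0) * (B₀ * Real.exp (δ₀ * ρ) * Cℓ * κ₄ * g.len a)) *
      Real.exp (-(δ₀ * g.dist a b))
  by_cases ha : a ∈ S
  · by_cases hb : b ∈ S'
    · have hq : g.len a * (g.len b)⁻¹ ≤ Cℓ := by
        rw [← div_eq_mul_inv, div_le_iff₀ (hlenpos b)]
        exact hcomp a b ha hb
      have h0 : 0 ≤ B₀ * Real.exp (δ₀ * ρ) * κ₄ * g.len a * Real.exp (-(δ₀ * g.dist a b)) :=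
        mul_nonneg (mul_nonneg (mul_nonneg (mul_nonneg hB₀ (Real.exp_nonneg _)) hκ₄) hlen0a) hE
      have key : B₀ * Real.exp (δ₀ * ρ) * g.len a ^ 2 * (κ₄ * (g.len b)⁻¹) * Real.exp (-(δ₀ * g.dist a b)) ≤
          B₀ * Real.exp (δ₀ * ρ) * Cℓ * κ₄ * g.len a * Real.exp (-(δ₀ * g.dist a b)) :=
        calc B₀ * Real.exp (δ₀ * ρ) * g.len a ^ 2 * (κ₄ * (g.len b)⁻¹) * Real.exp (-(δ₀ * g.dist a b))
            = B₀ * Real.exp (δ₀ * ρ) * κ₄ * g.len a * Real.exp (-(δ₀ * g.dist a b)) * (g.len a * (g.len b)⁻¹) := by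
              ring
          _ ≤ B₀ * Real.exp (δ₀ * ρ) * κ₄ * g.len a * Real.exp (-(δ₀ * g.dist a b)) * Cℓ :=
              mul_le_mul_of_nonneg_left hq h0
          _ = B₀ * Real.exp (δ₀ * ρ) * Cℓ * κ₄ * g.len a * Real.exp (-(δ₀ * g.dist a b)) := by ring
      rw [if_pos ha, if_pos ha, if_pos ha, if_pos hb, if_pos hb]
      calc B₀ * g.len a * Real.exp (-(δ₀ * g.dist a b)) +
            B₀ * Real.exp (δ₀ * ρ) * g.len a ^ 2 * (κ₄ * (g.len b)⁻¹) * Real.exp (-(δ₀ * g.dist a b))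
          ≤ B₀ * g.len a * Real.exp (-(δ₀ * g.dist a b)) +
            B₀ * Real.exp (δ₀ * ρ) * Cℓ * κ₄ * g.len a * Real.exp (-(δ₀ * g.dist a b)) := add_le_add le_rfl key
        _ = ((1 : ℝ) * (B₀ * g.len a) + (1 : ℝ) * (B₀ * Real.exp (δ₀ * ρ) * Cℓ * κ₄ * g.len a)) *
            Real.exp (-(δ₀ * g.dist a b)) := by ring
    · rw [if_pos ha, if_pos ha, if_pos ha, if_neg hb, if_neg hb]
      exact le_of_eq (by ring)
  · by_cases hb : b ∈ S'
    · rw [if_neg ha, if_neg ha, if_neg ha, if_pos hb]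
      have h2 : 0 ≤ B₀ * Real.exp (δ₀ * ρ) * Cℓ * κ₄ * g.len a * Real.exp (-(δ₀ * g.dist a b)) :=
        mul_nonneg (mul_nonneg (mul_nonneg (mul_nonneg (mul_nonneg hB₀ (Real.exp_nonneg _)) hCℓ) hκ₄) hlen0a) hE
      calc (0 : ℝ) + 0 = 0 := add_zero 0
        _ ≤ B₀ * Real.exp (δ₀ * ρ) * Cℓ * κ₄ * g.len a * Real.exp (-(δ₀ * g.dist a b)) := h2
        _ = ((0 : ℝ) * (B₀ * g.len a) + (1 : ℝ) * (B₀ * Real.exp (δ₀ * ρ) * Cℓ * κ₄ * g.len a)) *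
            Real.exp (-(δ₀ * g.dist a b)) := by ring
    · rw [if_neg ha, if_neg ha, if_neg ha, if_neg hb]
      exact le_of_eq (by ring)

/-- **One term of V = Σ_□ h_□G′_□K(h_□)ᵗ** (the transposed (3.88): G′₀Δ′_a = I − V, K(h_□)ᵗ = ∇*_UPᵗ_□ + Cᵗ_□ with
LOCAL coefficient operators Pᵗ_□ (site → bond functions), Cᵗ_□ of kernels ≧ 0, range ≦ ρ and COLUMN sums
≦ κ₁(L^{j′}η)^{−1}1_{S′_□}(y′), ≦ κ₂(L^{j′}η)^{−2}1_{S′_□}(y′)): h_□G′_□(D*Pᵗ_□ + Cᵗ_□) = h_□(G′_□D*)Pᵗ_□ + h_□G′_□Cᵗ_□ has,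
by entries 3 and 1 of (3.42) for G′_□ followed by the local operators (`hom_majorant_comp_localRight`), the
localization by h_□ and the cube comparability L^jη ≦ C_ℓL^{j′}η (y ∈ S_□, y′ ∈ S′_□), the SCALE-WEIGHTED majorant
1_{S′_□}(y′)B₀e^{δ₀ρ}(κ₁ + C_ℓκ₂)·L^jη(L^{j′}η)^{−1}·e^{−δ₀d(y,y′)} — the transposed (3.89).
[cite: Balaban1985BackgroundPropagators, (3.88)–(3.89) p.409; Balaban1984PropagatorsII, (2.40)–(2.44) p.230, (2.52)–(2.55) p.232] -/
theorem rightR_cube_majorant (blk : X → g.Site) (blkY : Y → g.Site) (δ₀ ρ B₀ κ₁ κ₂ Cℓ : ℝ)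
    (S S' : Finset g.Site) (h : X → ℝ) (KP KC : g.Site → g.Site → ℝ)
    (hB₀ : 0 ≤ B₀) (hδ₀ : 0 ≤ δ₀) (hκ₁ : 0 ≤ κ₁) (hκ₂ : 0 ≤ κ₂) (hCℓ : 0 ≤ Cℓ) (htri : Triangle254 (toB6 g R H))
    (hlenpos : ∀ y : g.Site, 0 < g.len y)
    (hh : ∀ x, |h x| ≤ 1) (hS : ∀ x, h x ≠ 0 → blk x ∈ S)
    (hcomp : ∀ a b : g.Site, a ∈ S → b ∈ S' → g.len a ≤ Cℓ * g.len b)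
    (hKP : ∀ a b, 0 ≤ KP a b) (hlocP : ∀ y'' b, KP y'' b ≠ 0 → g.dist y'' b ≤ ρ)
    (hcolP : ∀ b : g.Site, (∑ y'' : g.Site, KP y'' b) * g.len b ≤ if b ∈ S' then κ₁ else 0)
    (hKC : ∀ a b, 0 ≤ KC a b) (hlocC : ∀ y'' b, KC y'' b ≠ 0 → g.dist y'' b ≤ ρ)
    (hcolC : ∀ b : g.Site, (∑ y'' : g.Site, KC y'' b) * g.len b ^ 2 ≤ if b ∈ S' then κ₂ else 0)
    {Gsq Ct : Module.End ℝ (X → ℝ)} {Dstar : (Y → ℝ) →ₗ[ℝ] (X → ℝ)} {Pt : (X → ℝ) →ₗ[ℝ] (Y → ℝ)}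
    (h342_1 : HasMajorant (g := toB6 g R H) blk Gsq (fun a b => B₀ * g.len a ^ 2 * Real.exp (-(δ₀ * g.dist a b))))
    (h342_3 : HasMajorantHom (g := toB6 g R H) blkY blk (Gsq ∘ₗ Dstar)
      (fun a b => B₀ * g.len a * Real.exp (-(δ₀ * g.dist a b))))
    (hPt : HasMajorantHom (g := toB6 g R H) blk blkY Pt KP) (hCt : HasMajorant (g := toB6 g R H) blk Ct KC) :
    HasMajorant (g := toB6 g R H) blk (mulOp h * Gsq * (Dstar ∘ₗ Pt + Ct))
      (fun (a b : g.Site) => (if b ∈ S' then (1 : ℝ) else 0) * (B₀ * Real.exp (δ₀ * ρ) * (κ₁ + Cℓ * κ₂)) *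
        (g.len a * (g.len b)⁻¹) * Real.exp (-(δ₀ * g.dist a b))) := by
  have hlen0 : ∀ y : g.Site, 0 ≤ g.len y := fun y => (hlenpos y).le
  have hsplit : mulOp h * Gsq * (Dstar ∘ₗ Pt + Ct) =
      mulOp h ∘ₗ (Gsq ∘ₗ (Dstar ∘ₗ Pt)) + mulOp h ∘ₗ (Gsq ∘ₗ Ct) := by
    simp only [Module.End.mul_eq_comp, LinearMap.comp_add, LinearMap.comp_assoc]
  have hcolP' : ∀ b : g.Site, ∑ y'' : g.Site, KP y'' b ≤ (if b ∈ S' then κ₁ else 0) * (g.len b)⁻¹ := by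
    intro b
    rw [← div_eq_mul_inv, le_div_iff₀ (hlenpos b)]
    exact hcolP b
  have hcolC' : ∀ b : g.Site, ∑ y'' : g.Site, KC y'' b ≤ (if b ∈ S' then κ₂ else 0) * (g.len b ^ 2)⁻¹ := by
    intro b
    rw [← div_eq_mul_inv, le_div_iff₀ (pow_pos (hlenpos b) 2)]
    exact hcolC b
  -- h_□(G′_□D*)Pᵗ_□: entry 3 followed by the local Pᵗ_□
  have hP0 : HasMajorantHom (g := toB6 g R H) blk blk (Gsq ∘ₗ (Dstar ∘ₗ Pt))
      (fun (a b : g.Site) => B₀ * Real.exp (δ₀ * ρ) * g.len a * ((if b ∈ S' then κ₁ else 0) * (g.len b)⁻¹) *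
        Real.exp (-(δ₀ * g.dist a b))) := by
    rw [← LinearMap.comp_assoc]
    refine hasMajorantHom_mono (g := toB6 g R H) blk blk (hom_majorant_comp_localRight (g := toB6 g R H) blk blkY
      blk δ₀ ρ B₀ (fun (a : g.Site) => g.len a) (fun (b : g.Site) => (if b ∈ S' then κ₁ else 0) * (g.len b)⁻¹)
      KP hB₀ hlen0 hδ₀ htri hKP hlocP hcolP' h342_3 hPt) fun a b => le_of_eq ?_
    simp only [toB6_dist]
  -- h_□G′_□Cᵗ_□: entry 1 followed by the local Cᵗ_□
  have hC0 : HasMajorantHom (g := toB6 g R H) blk blk (Gsq ∘ₗ Ct)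
      (fun (a b : g.Site) => B₀ * Real.exp (δ₀ * ρ) * (g.len a ^ 2) * ((if b ∈ S' then κ₂ else 0) * (g.len b ^ 2)⁻¹) *
        Real.exp (-(δ₀ * g.dist a b))) := by
    refine hasMajorantHom_mono (g := toB6 g R H) blk blk (hom_majorant_comp_localRight (g := toB6 g R H) blk blk
      blk δ₀ ρ B₀ (fun (a : g.Site) => g.len a ^ 2) (fun (b : g.Site) => (if b ∈ S' then κ₂ else 0) * (g.len b ^ 2)⁻¹)
      KC hB₀ (fun y => sq_nonneg _) hδ₀ htri hKC hlocC hcolC'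
      ((hasMajorantHom_iff (g := toB6 g R H) blk Gsq _).mpr h342_1)
      ((hasMajorantHom_iff (g := toB6 g R H) blk Ct _).mpr hCt)) fun a b => le_of_eq ?_
    simp only [toB6_dist]
  have hP := hasMajorantHom_mulOp_local blk blk hP0 h hh S hS
  have hC := hasMajorantHom_mulOp_local blk blk hC0 h hh S hS
  rw [hsplit, ← hasMajorantHom_iff (g := toB6 g R H) blk]
  refine hasMajorantHom_mono (g := toB6 g R H) blk blk (hasMajorantHom_add (g := toB6 g R H) blk blk hP hC)
    fun (a b : g.Site) => ?_
  have hE : 0 ≤ Real.exp (-(δ₀ * g.dist a b)) := Real.exp_nonneg _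
  show (if a ∈ S then B₀ * Real.exp (δ₀ * ρ) * g.len a * ((if b ∈ S' then κ₁ else 0) * (g.len b)⁻¹) *
        Real.exp (-(δ₀ * g.dist a b)) else 0) +
      (if a ∈ S then B₀ * Real.exp (δ₀ * ρ) * (g.len a ^ 2) * ((if b ∈ S' then κ₂ else 0) * (g.len b ^ 2)⁻¹) *
        Real.exp (-(δ₀ * g.dist a b)) else 0) ≤
    (if b ∈ S' then (1 : ℝ) else 0) * (B₀ * Real.exp (δ₀ * ρ) * (κ₁ + Cℓ * κ₂)) * (g.len a * (g.len b)⁻¹) *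
      Real.exp (-(δ₀ * g.dist a b))
  by_cases hb : b ∈ S'
  · by_cases ha : a ∈ S
    · have hq0 : 0 ≤ g.len a * (g.len b)⁻¹ := mul_nonneg (hlen0 a) (inv_nonneg.mpr (hlen0 b))
      have hq : g.len a * (g.len b)⁻¹ ≤ Cℓ := by
        rw [← div_eq_mul_inv, div_le_iff₀ (hlenpos b)]
        exact hcomp a b ha hb
      have hsq : g.len a ^ 2 * (g.len b ^ 2)⁻¹ ≤ Cℓ * (g.len a * (g.len b)⁻¹) :=
        calc g.len a ^ 2 * (g.len b ^ 2)⁻¹ = (g.len a * (g.len b)⁻¹) * (g.len a * (g.len b)⁻¹) := by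
              rw [← inv_pow]; ring
          _ ≤ Cℓ * (g.len a * (g.len b)⁻¹) := mul_le_mul_of_nonneg_right hq hq0
      have h0 : 0 ≤ B₀ * Real.exp (δ₀ * ρ) * κ₂ * Real.exp (-(δ₀ * g.dist a b)) :=
        mul_nonneg (mul_nonneg (mul_nonneg hB₀ (Real.exp_nonneg _)) hκ₂) hE
      rw [if_pos ha, if_pos ha, if_pos hb, if_pos hb, if_pos hb]
      calc B₀ * Real.exp (δ₀ * ρ) * g.len a * (κ₁ * (g.len b)⁻¹) * Real.exp (-(δ₀ * g.dist a b)) +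
            B₀ * Real.exp (δ₀ * ρ) * g.len a ^ 2 * (κ₂ * (g.len b ^ 2)⁻¹) * Real.exp (-(δ₀ * g.dist a b))
          = B₀ * Real.exp (δ₀ * ρ) * κ₁ * (g.len a * (g.len b)⁻¹) * Real.exp (-(δ₀ * g.dist a b)) +
            B₀ * Real.exp (δ₀ * ρ) * κ₂ * Real.exp (-(δ₀ * g.dist a b)) * (g.len a ^ 2 * (g.len b ^ 2)⁻¹) := by
              ring
        _ ≤ B₀ * Real.exp (δ₀ * ρ) * κ₁ * (g.len a * (g.len b)⁻¹) * Real.exp (-(δ₀ * g.dist a b)) +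
            B₀ * Real.exp (δ₀ * ρ) * κ₂ * Real.exp (-(δ₀ * g.dist a b)) * (Cℓ * (g.len a * (g.len b)⁻¹)) :=
              add_le_add le_rfl (mul_le_mul_of_nonneg_left hsq h0)
        _ = (1 : ℝ) * (B₀ * Real.exp (δ₀ * ρ) * (κ₁ + Cℓ * κ₂)) * (g.len a * (g.len b)⁻¹) *
            Real.exp (-(δ₀ * g.dist a b)) := by ring
    · rw [if_neg ha, if_neg ha, if_pos hb]
      have h2 : 0 ≤ (1 : ℝ) * (B₀ * Real.exp (δ₀ * ρ) * (κ₁ + Cℓ * κ₂)) * (g.len a * (g.len b)⁻¹) *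
          Real.exp (-(δ₀ * g.dist a b)) :=
        mul_nonneg (mul_nonneg (mul_nonneg zero_le_one (mul_nonneg (mul_nonneg hB₀ (Real.exp_nonneg _))
          (add_nonneg hκ₁ (mul_nonneg hCℓ hκ₂)))) (mul_nonneg (hlen0 a) (inv_nonneg.mpr (hlen0 b)))) hE
      rw [add_zero]
      exact h2
  · rw [if_neg hb, if_neg hb, if_neg hb]
    split_ifs
    · exact le_of_eq (by ring)
    · exact le_of_eq (by ring)

/-- **Theorem 3.7 ⇒ ENTRY 3 of (3.42) for G′ = G′(U) — the RIGHT entry |(G′(U)∇*_Uλ)(x)| ≦ B₀L^jηe^{−δ₀d(y,y′)}|λ|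
— from Corollary 3.6 (entries 1, 3 for the G′_□) and the STRUCTURE of the expansion only**, p. 409: *"The
expansion is convergent in all norms appearing in the inequalities (3.42)–(3.47)."*  The printed (3.88)/(3.90),
G′ = G′₀Σ_n R′ⁿ, closes on LEFT entries EG′ (`thm37_leftEntry_of_342`); a right entry G′D* is reached through the
relations Δ′_aG′ = I (from `hinv` : G′Δ′_a = I, the sites being finite: `mul_eq_one_comm`) and the
TRANSPOSED (3.88), G′₀Δ′_a = I − V, V = Σ_□ h_□G′_□(D*Pᵗ_□ + Cᵗ_□) (`h388T`), which give
the LEFT fixed point G′D* = G′₀D* + V(G′D*) (`fixedPoint_of_388T`).  Inputs: entries 1, 3 of (3.42) for every G′_□;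
the partition of unity (|h_□| ≦ 1 with supp h_□ within the blocks of S_□, |h^Y_□| ≦ 1, overlap counts N, N′ of the
S_□, S′_□, cube comparability L^jη ≦ C_ℓL^{j′}η for y ∈ S_□, y′ ∈ S′_□); the local coefficient operators Pᵗ_□, Cᵗ_□
of V and C′ᵗ_□ of the right Leibniz rule `hLeibT` : M_{h_□}D* = D*M_{h^Y_□} + C′ᵗ_□ (kernels ≧ 0, range ≦ ρ,
column sums ≦ κ₁(L^{j′}η)^{−1}, κ₂(L^{j′}η)^{−2}, κ₄(L^{j′}η)^{−1} on S′_□); Lemma 2.1 of [4] at the exponent α; the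
located smallness N′θc₁(α) < 1, θ = B₀e^{δ₀ρ}(κ₁ + C_ℓκ₂).  Tool: the scale-weighted left fixed point
`B6RandomWalkHom.hom_majorant_of_leftFixedPoint_weighted` (W = L^jη, Q ≡ 1).  Conclusion: G′D* has the majorant
B₀(N + N′e^{δ₀ρ}C_ℓκ₄)c₁(α)(1 − N′θc₁(α))^{−1}L^jηe^{−(1−2α)δ₀d(y,y′)} — entry 3 of (3.42) for G′ with
B₀ ↦ B₀(N + N′e^{δ₀ρ}C_ℓκ₄)c₁(α)/(1 − N′θc₁(α)), δ₀ ↦ (1 − 2α)δ₀.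
[cite: Balaban1985BackgroundPropagators, Thm 3.7 (3.87)–(3.90) pp.409–410, (3.42) p.397; Balaban1984PropagatorsII, Prop 2.2 (2.64)–(2.67) p.234] -/
theorem thm37_rightEntry_of_342 [Fintype X] [DecidableEq X] [Fintype Y] [DecidableEq Y]
    (blk : X → g.Site) (blkY : Y → g.Site) (d : ℕ) (δ₀ α ρ B₀ κ₁ κ₂ κ₄ Cℓ N N' : ℝ) {ι : Type} [Fintype ι]
    (S S' : ι → Finset g.Site) (h : ι → X → ℝ) (hY : ι → Y → ℝ) (KP KC KC' : ι → g.Site → g.Site → ℝ)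
    {G' Δ : Module.End ℝ (X → ℝ)}
    (hB₀ : 0 ≤ B₀) (hδ₀ : 0 ≤ δ₀) (hκ₁ : 0 ≤ κ₁) (hκ₂ : 0 ≤ κ₂) (hκ₄ : 0 ≤ κ₄) (hCℓ : 0 ≤ Cℓ) (hN : 0 ≤ N)
    (hN' : 0 ≤ N') (hαδ : 0 ≤ α * δ₀) (hαδ2 : 0 ≤ (1 - 2 * α) * δ₀)
    (htri : Triangle254 (toB6 g R H)) (hrefl : ∀ y : g.Site, g.dist y y = 0)
    (hsym : ∀ y y' : g.Site, g.dist y y' = g.dist y' y) (hdnn : ∀ y y' : g.Site, 0 ≤ g.dist y y')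
    (hlenpos : ∀ y : g.Site, 0 < g.len y)
    (h261 : Ineq261 d (toB6 g R H) δ₀ α) (h263 : Ineq263 d (toB6 g R H) δ₀ α)
    (hsmall : N' * (B₀ * Real.exp (δ₀ * ρ) * (κ₁ + Cℓ * κ₂)) * B6.c1 d δ₀ α < 1)
    (hh : ∀ i x, |h i x| ≤ 1) (hS : ∀ i x, h i x ≠ 0 → blk x ∈ S i) (hhY : ∀ i v, |hY i v| ≤ 1)
    (hcnt : ∀ a : g.Site, (∑ i, if a ∈ S i then (1 : ℝ) else 0) ≤ N)
    (hcnt' : ∀ b : g.Site, (∑ i, if b ∈ S' i then (1 : ℝ) else 0) ≤ N')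
    (hcomp : ∀ i (a b : g.Site), a ∈ S i → b ∈ S' i → g.len a ≤ Cℓ * g.len b)
    (hKP : ∀ i a b, 0 ≤ KP i a b) (hlocP : ∀ i y'' b, KP i y'' b ≠ 0 → g.dist y'' b ≤ ρ)
    (hcolP : ∀ i (b : g.Site), (∑ y'' : g.Site, KP i y'' b) * g.len b ≤ if b ∈ S' i then κ₁ else 0)
    (hKC : ∀ i a b, 0 ≤ KC i a b) (hlocC : ∀ i y'' b, KC i y'' b ≠ 0 → g.dist y'' b ≤ ρ)
    (hcolC : ∀ i (b : g.Site), (∑ y'' : g.Site, KC i y'' b) * g.len b ^ 2 ≤ if b ∈ S' i then κ₂ else 0)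
    (hKC' : ∀ i a b, 0 ≤ KC' i a b) (hlocC' : ∀ i y'' b, KC' i y'' b ≠ 0 → g.dist y'' b ≤ ρ)
    (hcolC' : ∀ i (b : g.Site), (∑ y'' : g.Site, KC' i y'' b) * g.len b ≤ if b ∈ S' i then κ₄ else 0)
    {Gsq Ct : ι → Module.End ℝ (X → ℝ)} {Dstar : (Y → ℝ) →ₗ[ℝ] (X → ℝ)} {Pt : ι → (X → ℝ) →ₗ[ℝ] (Y → ℝ)}
    {CLt : ι → (Y → ℝ) →ₗ[ℝ] (X → ℝ)}
    (h342_1 : ∀ i, HasMajorant (g := toB6 g R H) blk (Gsq i)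
      (fun a b => B₀ * g.len a ^ 2 * Real.exp (-(δ₀ * g.dist a b))))
    (h342_3 : ∀ i, HasMajorantHom (g := toB6 g R H) blkY blk (Gsq i ∘ₗ Dstar)
      (fun a b => B₀ * g.len a * Real.exp (-(δ₀ * g.dist a b))))
    (hPt : ∀ i, HasMajorantHom (g := toB6 g R H) blk blkY (Pt i) (KP i))
    (hCt : ∀ i, HasMajorant (g := toB6 g R H) blk (Ct i) (KC i))
    (hCLt : ∀ i, HasMajorantHom (g := toB6 g R H) blkY blk (CLt i) (KC' i))
    (hLeibT : ∀ i, mulOp (h i) ∘ₗ Dstar = Dstar ∘ₗ mulOp (hY i) + CLt i)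
    (hinv : G' * Δ = 1)
    (h388T : (∑ i, mulOp (h i) * Gsq i * mulOp (h i)) * Δ = 1 - ∑ i, mulOp (h i) * Gsq i * (Dstar ∘ₗ Pt i + Ct i)) :
    HasMajorantHom (g := toB6 g R H) blkY blk (G' ∘ₗ Dstar)
      (fun (a b : g.Site) => B₀ * (N + N' * Real.exp (δ₀ * ρ) * Cℓ * κ₄) * B6.c1 d δ₀ α *
        (1 - N' * (B₀ * Real.exp (δ₀ * ρ) * (κ₁ + Cℓ * κ₂)) * B6.c1 d δ₀ α)⁻¹ * g.len a *
        Real.exp (-((1 - 2 * α) * δ₀ * g.dist a b))) := by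
  have hlen0 : ∀ y : g.Site, 0 ≤ g.len y := fun y => (hlenpos y).le
  have hθ : 0 ≤ N' * (B₀ * Real.exp (δ₀ * ρ) * (κ₁ + Cℓ * κ₂)) :=
    mul_nonneg hN' (mul_nonneg (mul_nonneg hB₀ (Real.exp_nonneg _)) (add_nonneg hκ₁ (mul_nonneg hCℓ hκ₂)))
  have hA : 0 ≤ B₀ * (N + N' * Real.exp (δ₀ * ρ) * Cℓ * κ₄) :=
    mul_nonneg hB₀ (add_nonneg hN (mul_nonneg (mul_nonneg (mul_nonneg hN' (Real.exp_nonneg _)) hCℓ) hκ₄))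
  -- T₀ = G′₀D* = Σ_□ h_□G′_□h_□D*: a finite sum of localized two-space operators
  have hcube : ∀ i, HasMajorantHom (g := toB6 g R H) blkY blk ((mulOp (h i) * Gsq i * mulOp (h i)) ∘ₗ Dstar)
      (fun (a b : g.Site) => ((if a ∈ S i then (1 : ℝ) else 0) * (B₀ * g.len a) +
        (if b ∈ S' i then (1 : ℝ) else 0) * (B₀ * Real.exp (δ₀ * ρ) * Cℓ * κ₄ * g.len a)) *
        Real.exp (-(δ₀ * g.dist a b))) := fun i =>
    rightEntry_cube_majorant blk blkY δ₀ ρ B₀ κ₄ Cℓ (S i) (S' i) (h i) (hY i) (KC' i) hB₀ hδ₀ hκ₄ hCℓ htri hlenpos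
      (hh i) (hS i) (hhY i) (hcomp i) (hKC' i) (hlocC' i) (hcolC' i) (h342_1 i) (h342_3 i) (hCLt i) (hLeibT i)
  have hsumD : (∑ i, mulOp (h i) * Gsq i * mulOp (h i)) ∘ₗ Dstar = ∑ i, (mulOp (h i) * Gsq i * mulOp (h i)) ∘ₗ Dstar := by
    apply LinearMap.ext
    intro μ
    simp only [LinearMap.comp_apply, LinearMap.sum_apply]
  have hT₀ : HasMajorantHom (g := toB6 g R H) blkY blk ((∑ i, mulOp (h i) * Gsq i * mulOp (h i)) ∘ₗ Dstar)
      (fun (a b : g.Site) => B₀ * (N + N' * Real.exp (δ₀ * ρ) * Cℓ * κ₄) * g.len a * 1 *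
        Real.exp (-(δ₀ * g.dist a b))) := by
    rw [hsumD]
    refine hasMajorantHom_mono (g := toB6 g R H) blkY blk
      (hasMajorantHom_fintypeSum blkY blk (fun i => (mulOp (h i) * Gsq i * mulOp (h i)) ∘ₗ Dstar) _ hcube)
      fun (a b : g.Site) => ?_
    have h1 : 0 ≤ B₀ * g.len a := mul_nonneg hB₀ (hlen0 a)
    have h2 : 0 ≤ B₀ * Real.exp (δ₀ * ρ) * Cℓ * κ₄ * g.len a :=
      mul_nonneg (mul_nonneg (mul_nonneg (mul_nonneg hB₀ (Real.exp_nonneg _)) hCℓ) hκ₄) (hlen0 a)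
    calc (∑ i, ((if a ∈ S i then (1 : ℝ) else 0) * (B₀ * g.len a) +
            (if b ∈ S' i then (1 : ℝ) else 0) * (B₀ * Real.exp (δ₀ * ρ) * Cℓ * κ₄ * g.len a)) *
            Real.exp (-(δ₀ * g.dist a b)))
        = ((∑ i, if a ∈ S i then (1 : ℝ) else 0) * (B₀ * g.len a) +
            (∑ i, if b ∈ S' i then (1 : ℝ) else 0) * (B₀ * Real.exp (δ₀ * ρ) * Cℓ * κ₄ * g.len a)) *
            Real.exp (-(δ₀ * g.dist a b)) := by
          simp only [Finset.sum_mul, add_mul, Finset.sum_add_distrib]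
      _ ≤ (N * (B₀ * g.len a) + N' * (B₀ * Real.exp (δ₀ * ρ) * Cℓ * κ₄ * g.len a)) * Real.exp (-(δ₀ * g.dist a b)) :=
          mul_le_mul_of_nonneg_right (add_le_add (mul_le_mul_of_nonneg_right (hcnt a) h1)
            (mul_le_mul_of_nonneg_right (hcnt' b) h2)) (Real.exp_nonneg _)
      _ = B₀ * (N + N' * Real.exp (δ₀ * ρ) * Cℓ * κ₄) * g.len a * 1 * Real.exp (-(δ₀ * g.dist a b)) := by ring
  -- V = Σ_□ h_□G′_□(D*Pᵗ_□ + Cᵗ_□) has the scale-weighted majorant N′θ·L^jη(L^{j′}η)^{−1}e^{−δ₀d}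
  have hVi : ∀ i, HasMajorantHom (g := toB6 g R H) blk blk (mulOp (h i) * Gsq i * (Dstar ∘ₗ Pt i + Ct i))
      (fun (a b : g.Site) => (if b ∈ S' i then (1 : ℝ) else 0) * (B₀ * Real.exp (δ₀ * ρ) * (κ₁ + Cℓ * κ₂)) *
        (g.len a * (g.len b)⁻¹) * Real.exp (-(δ₀ * g.dist a b))) := fun i =>
    (hasMajorantHom_iff (g := toB6 g R H) blk _ _).mpr
      (rightR_cube_majorant blk blkY δ₀ ρ B₀ κ₁ κ₂ Cℓ (S i) (S' i) (h i) (KP i) (KC i) hB₀ hδ₀ hκ₁ hκ₂ hCℓ htri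
        hlenpos (hh i) (hS i) (hcomp i) (hKP i) (hlocP i) (hcolP i) (hKC i) (hlocC i) (hcolC i) (h342_1 i)
        (h342_3 i) (hPt i) (hCt i))
  have hV : HasMajorant (g := toB6 g R H) blk (∑ i, mulOp (h i) * Gsq i * (Dstar ∘ₗ Pt i + Ct i))
      (fun (a b : g.Site) => N' * (B₀ * Real.exp (δ₀ * ρ) * (κ₁ + Cℓ * κ₂)) * g.len a * (g.len b)⁻¹ *
        Real.exp (-(δ₀ * g.dist a b))) := by
    rw [← hasMajorantHom_iff (g := toB6 g R H) blk]
    refine hasMajorantHom_mono (g := toB6 g R H) blk blk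
      (hasMajorantHom_fintypeSum blk blk (fun i => mulOp (h i) * Gsq i * (Dstar ∘ₗ Pt i + Ct i)) _ hVi)
      fun (a b : g.Site) => ?_
    have h3 : 0 ≤ B₀ * Real.exp (δ₀ * ρ) * (κ₁ + Cℓ * κ₂) * (g.len a * (g.len b)⁻¹) * Real.exp (-(δ₀ * g.dist a b)) :=
      mul_nonneg (mul_nonneg (mul_nonneg (mul_nonneg hB₀ (Real.exp_nonneg _)) (add_nonneg hκ₁ (mul_nonneg hCℓ hκ₂)))
        (mul_nonneg (hlen0 a) (inv_nonneg.mpr (hlen0 b)))) (Real.exp_nonneg _)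
    calc (∑ i, (if b ∈ S' i then (1 : ℝ) else 0) * (B₀ * Real.exp (δ₀ * ρ) * (κ₁ + Cℓ * κ₂)) *
            (g.len a * (g.len b)⁻¹) * Real.exp (-(δ₀ * g.dist a b)))
        = (∑ i, if b ∈ S' i then (1 : ℝ) else 0) * (B₀ * Real.exp (δ₀ * ρ) * (κ₁ + Cℓ * κ₂) *
            (g.len a * (g.len b)⁻¹) * Real.exp (-(δ₀ * g.dist a b))) := by
          rw [Finset.sum_mul]
          exact Finset.sum_congr rfl fun i _ => by ring
      _ ≤ N' * (B₀ * Real.exp (δ₀ * ρ) * (κ₁ + Cℓ * κ₂) * (g.len a * (g.len b)⁻¹) * Real.exp (-(δ₀ * g.dist a b))) :=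
          mul_le_mul_of_nonneg_right (hcnt' b) h3
      _ = N' * (B₀ * Real.exp (δ₀ * ρ) * (κ₁ + Cℓ * κ₂)) * g.len a * (g.len b)⁻¹ * Real.exp (-(δ₀ * g.dist a b)) := by
          ring
  -- the transposed (3.88): G′D* = G′₀D* + V(G′D*)
  have hG : G' = (∑ i, mulOp (h i) * Gsq i * mulOp (h i)) +
      (∑ i, mulOp (h i) * Gsq i * (Dstar ∘ₗ Pt i + Ct i)) * G' :=
    fixedPoint_of_388T (mul_eq_one_comm.mp hinv) h388T
  have hfix : G' ∘ₗ Dstar = (∑ i, mulOp (h i) * Gsq i * mulOp (h i)) ∘ₗ Dstar +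
      (∑ i, mulOp (h i) * Gsq i * (Dstar ∘ₗ Pt i + Ct i)) ∘ₗ (G' ∘ₗ Dstar) := by
    conv_lhs => rw [hG]
    rw [LinearMap.add_comp, Module.End.mul_eq_comp, LinearMap.comp_assoc]
  have htransfer : ∀ a b : g.Site, (1 : ℝ) ≤ 1 * 1 * Real.exp (α * δ₀ * g.dist a b) := fun a b => by
    rw [one_mul, one_mul]
    exact Real.one_le_exp (mul_nonneg hαδ (hdnn a b))
  have hmain := hom_majorant_of_leftFixedPoint_weighted (g := toB6 g R H) blk blkY d δ₀ α
    (N' * (B₀ * Real.exp (δ₀ * ρ) * (κ₁ + Cℓ * κ₂))) (B₀ * (N + N' * Real.exp (δ₀ * ρ) * Cℓ * κ₄)) 1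
    (fun y => g.len y) (fun _ => (1 : ℝ)) hA zero_le_one hlenpos (fun _ => zero_le_one) hθ hαδ hαδ2 htri hrefl hsym
    hdnn h261 h263 hsmall htransfer hT₀ hV hfix
  refine hasMajorantHom_mono (g := toB6 g R H) blkY blk hmain fun (a b : g.Site) => le_of_eq ?_
  simp only [toB6_dist]
  ring

end RightEntry

section LatticeAdjoint

variable {St Cp Bd : Type}

/-- **The adjoint covariant derivative D* = ∇*_U in components** (p. 392: *"for derivative D acting on functions
defined at points of the lattice, the adjoint operator D* is acting on functions A defined at bonds of the lattice by
the formulas (D*A)(x) = Σ_{μ=1}^d η^{−1}(R(U(x, x − ηe_μ))A(x − ηe_μ, x) − A(x, x + ηe_μ))"*, (3.8)): the TRANSPOSE of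
`covD src tgt c Rm` with respect to the component sums (`sum_covDT_mul`),
(covDT g)(x, i) = Σ_{b : b₊ = x} c(b) Σ_k Rm(b)_{ki} g(b, k) − Σ_{b : b₋ = x} c(b) g(b, i) — for an orthogonal Rm(b)
(R(U(b)) a rotation, p. 390) and U(x, x′) = U^{−1}(x′, x) ((3.5) p. 391) this is the displayed D* read in components.
[cite: Balaban1985BackgroundPropagators, (3.8) p.392 + (3.5) p.391] -/
def covDT [Fintype Bd] [Fintype Cp] [DecidableEq St] (src tgt : Bd → St) (c : Bd → ℝ) (Rm : Bd → Cp → Cp → ℝ) :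
    (Bd × Cp → ℝ) →ₗ[ℝ] (St × Cp → ℝ) where
  toFun f := fun p => ∑ b, ((if tgt b = p.1 then c b else 0) * ∑ k, Rm b k p.2 * f (b, k) -
    (if src b = p.1 then c b else 0) * f (b, p.2))
  map_add' f f' := by
    funext p
    simp only [Pi.add_apply, mul_add, Finset.sum_add_distrib, Finset.sum_sub_distrib]
    ring
  map_smul' r f := by
    funext p
    simp only [Pi.smul_apply, smul_eq_mul, RingHom.id_apply, Finset.mul_sum, mul_sub]
    refine Finset.sum_congr rfl fun b _ => ?_
    congr 1
    · exact Finset.sum_congr rfl fun k _ => by ring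
    · ring

/-- Unfolding equation of `covDT`. [folklore] -/
theorem covDT_apply [Fintype Bd] [Fintype Cp] [DecidableEq St] (src tgt : Bd → St) (c : Bd → ℝ)
    (Rm : Bd → Cp → Cp → ℝ) (f : Bd × Cp → ℝ) (p : St × Cp) :
    covDT src tgt c Rm f p = ∑ b, ((if tgt b = p.1 then c b else 0) * ∑ k, Rm b k p.2 * f (b, k) -
      (if src b = p.1 then c b else 0) * f (b, p.2)) :=
  rfl

/-- **`covDT` is the transpose of `covD`** for the component pairing Σ_{(x,i)} (·)(x, i)(·)(x, i) on sites and
Σ_{(b,i)} (·)(b, i)(·)(b, i) on bonds: Σ_p (D*g)(p)f(p) = Σ_q g(q)(Df)(q) — p. 391: *"The adjoints are taken with respect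
to natural L² scalar products for functions with values in N × N hermitian matrices."* (for components orthonormal
for X·Y = tr XY and the common weight η^d of sites and bonds, the component pairing is that scalar product).
[cite: Balaban1985BackgroundPropagators, (3.8) pp.391–392] -/
theorem sum_covDT_mul [Fintype St] [Fintype Bd] [Fintype Cp] [DecidableEq St] (src tgt : Bd → St) (c : Bd → ℝ)
    (Rm : Bd → Cp → Cp → ℝ) (gb : Bd × Cp → ℝ) (f : St × Cp → ℝ) :
    ∑ p, covDT src tgt c Rm gb p * f p = ∑ q, gb q * covD src tgt c Rm f q := by
  -- both sides equal Σ_b c(b) [Σ_j Σ_k Rm(b)_{jk}? no: Σ_j (Σ_k Rm b k j gb(b,k)) f(b₊, j) − Σ_i gb(b,i) f(b₋, i)]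
  have hL : ∑ p, covDT src tgt c Rm gb p * f p =
      ∑ b, c b * ((∑ j, (∑ k, Rm b k j * gb (b, k)) * f (tgt b, j)) - ∑ i, gb (b, i) * f (src b, i)) := by
    calc ∑ p, covDT src tgt c Rm gb p * f p
        = ∑ p : St × Cp, ∑ b, ((if tgt b = p.1 then c b else 0) * (∑ k, Rm b k p.2 * gb (b, k)) * f p -
            (if src b = p.1 then c b else 0) * gb (b, p.2) * f p) := by
          refine Finset.sum_congr rfl fun p _ => ?_
          rw [covDT_apply, Finset.sum_mul]
          exact Finset.sum_congr rfl fun b _ => by ring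
      _ = ∑ b, ∑ p : St × Cp, ((if tgt b = p.1 then c b else 0) * (∑ k, Rm b k p.2 * gb (b, k)) * f p -
            (if src b = p.1 then c b else 0) * gb (b, p.2) * f p) := Finset.sum_comm
      _ = ∑ b, c b * ((∑ j, (∑ k, Rm b k j * gb (b, k)) * f (tgt b, j)) - ∑ i, gb (b, i) * f (src b, i)) := by
          refine Finset.sum_congr rfl fun b _ => ?_
          rw [Finset.sum_sub_distrib, Fintype.sum_prod_type, Fintype.sum_prod_type, mul_sub, Finset.mul_sum,
            Finset.mul_sum]
          congr 1
          · rw [Finset.sum_comm]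
            refine Finset.sum_congr rfl fun j _ => ?_
            rw [show (∑ x : St, (if tgt b = x then c b else 0) * (∑ k, Rm b k (x, j).2 * gb (b, k)) * f (x, j)) =
                ∑ x : St, (if tgt b = x then c b * (∑ k, Rm b k j * gb (b, k)) * f (x, j) else 0) from
              Finset.sum_congr rfl fun x _ => by split_ifs <;> simp]
            rw [Finset.sum_ite_eq]
            simp only [Finset.mem_univ, if_true]
            ring
          · rw [Finset.sum_comm]
            refine Finset.sum_congr rfl fun i _ => ?_
            rw [show (∑ x : St, (if src b = x then c b else 0) * gb (b, (x, i).2) * f (x, i)) =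
                ∑ x : St, (if src b = x then c b * gb (b, i) * f (x, i) else 0) from
              Finset.sum_congr rfl fun x _ => by split_ifs <;> simp]
            rw [Finset.sum_ite_eq]
            simp only [Finset.mem_univ, if_true]
            ring
  have hR : ∑ q, gb q * covD src tgt c Rm f q =
      ∑ b, c b * ((∑ j, (∑ k, Rm b k j * gb (b, k)) * f (tgt b, j)) - ∑ i, gb (b, i) * f (src b, i)) := by
    rw [Fintype.sum_prod_type]
    refine Finset.sum_congr rfl fun b _ => ?_
    have e : ∀ i, gb (b, i) * covD src tgt c Rm f (b, i) =
        c b * (∑ j, Rm b i j * gb (b, i) * f (tgt b, j)) - c b * (gb (b, i) * f (src b, i)) := fun i => by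
      rw [covD_apply, mul_sub, mul_sub, Finset.mul_sum, Finset.mul_sum, Finset.mul_sum]
      congr 1
      · exact Finset.sum_congr rfl fun j _ => by ring
      · ring
    rw [Finset.sum_congr rfl fun i _ => e i, Finset.sum_sub_distrib, ← Finset.mul_sum, ← Finset.mul_sum, ← mul_sub]
    congr 1
    congr 1
    rw [Finset.sum_comm]
    exact Finset.sum_congr rfl fun j _ => by rw [Finset.sum_mul]
  rw [hL, hR]

/-- The remainder of the right Leibniz rule of D* through M_h: (leibRemT h g)(x, i) = Σ_{b : b₋ = x}(∂h)(b)g(b, i),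
(∂h)(b) = c(b)(h(b₊) − h(b₋)) — the transpose of `leibRem h`. [folklore] -/
def leibRemT [Fintype Bd] [DecidableEq St] (src tgt : Bd → St) (c : Bd → ℝ) (h : St → ℝ) :
    (Bd × Cp → ℝ) →ₗ[ℝ] (St × Cp → ℝ) where
  toFun f := fun p => ∑ b, (if src b = p.1 then c b * (h (tgt b) - h (src b)) else 0) * f (b, p.2)
  map_add' f f' := by
    funext p
    simp only [Pi.add_apply, mul_add, Finset.sum_add_distrib]
  map_smul' r f := by
    funext p
    simp only [Pi.smul_apply, smul_eq_mul, RingHom.id_apply, Finset.mul_sum]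
    exact Finset.sum_congr rfl fun b _ => by ring

/-- Unfolding equation of `leibRemT`. [folklore] -/
theorem leibRemT_apply [Fintype Bd] [DecidableEq St] (src tgt : Bd → St) (c : Bd → ℝ) (h : St → ℝ)
    (f : Bd × Cp → ℝ) (p : St × Cp) :
    leibRemT (Cp := Cp) src tgt c h f p = ∑ b, (if src b = p.1 then c b * (h (tgt b) - h (src b)) else 0) * f (b, p.2) :=
  rfl

/-- **The lattice Leibniz rule of D* through the multiplication by a SCALAR lattice function h, on the RIGHT entry
side** — the transpose of `covD_comp_mulOp`: M_{h∘pr₁} ∘ D* = D* ∘ M_{h∘b₊∘pr₁} + leibRemT h, i.e. site by site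
h(x)(D*g)(x) = (D*(h(b₊)g))(x) + Σ_{b : b₋ = x}(∂h)(b)g(b) — the hypothesis `hLeibT` of `thm37_rightEntry_of_342` with
h^Y = h∘b₊, C′ᵗ = leibRemT h.  An algebraic identity (Rm(b), c(b) arbitrary). [cite: Balaban1985BackgroundPropagators, (3.8) p.392, (3.88) p.409; Balaban1984PropagatorsII, (2.39) p.229] -/
theorem mulOp_comp_covDT [Fintype Bd] [Fintype Cp] [DecidableEq St] (src tgt : Bd → St) (c : Bd → ℝ)
    (Rm : Bd → Cp → Cp → ℝ) (h : St → ℝ) :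
    mulOp (h ∘ Prod.fst) ∘ₗ covDT src tgt c Rm =
      covDT src tgt c Rm ∘ₗ mulOp (h ∘ tgt ∘ Prod.fst) + leibRemT src tgt c h := by
  apply LinearMap.ext
  intro f
  funext p
  simp only [LinearMap.comp_apply, LinearMap.add_apply, Pi.add_apply, mulOp_apply, covDT_apply, leibRemT_apply,
    Function.comp_apply]
  rw [Finset.mul_sum, ← Finset.sum_add_distrib]
  refine Finset.sum_congr rfl fun b _ => ?_
  have e1 : ∑ k, Rm b k p.2 * (h (tgt b) * f (b, k)) = h (tgt b) * ∑ k, Rm b k p.2 * f (b, k) := by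
    rw [Finset.mul_sum]
    exact Finset.sum_congr rfl fun k _ => by ring
  rw [e1]
  by_cases ht : tgt b = p.1
  · by_cases hs : src b = p.1
    · rw [if_pos ht, if_pos hs, if_pos hs, ht, hs]
      ring
    · rw [if_pos ht, if_neg hs, if_neg hs, ht]
      ring
  · by_cases hs : src b = p.1
    · rw [if_neg ht, if_pos hs, if_pos hs, hs]
      ring
    · rw [if_neg ht, if_neg hs, if_neg hs]
      ring

/-- **The two-space majorant of the transposed Leibniz remainder**: if, for every site component (x, i) and every
block y′, the lattice derivatives (∂h_□)(b) = c(b)(h_□(b₊) − h_□(b₋)) over the bonds b with b₋ = x whose component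
(b, i) lies in the bond block of y′ have Σ|(∂h_□)(b)| ≦ K′(y, y′), y the block of (x, i), then `leibRemT h_□` has the
majorant K′ (the hypothesis `hCLt` of `thm37_rightEntry_of_342`; the SIZE of ∂h_□ is carried by K′ and is not displayed
in print). [cite: Balaban1984PropagatorsII, (2.39)–(2.40) pp.229–230 + (2.51) p.232] -/
theorem leibRemT_majorant [Fintype Bd] [DecidableEq St] (blk : St × Cp → g.Site) (blkY : Bd × Cp → g.Site)
    (src tgt : Bd → St) (c : Bd → ℝ) (h : St → ℝ) (K : g.Site → g.Site → ℝ)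
    (hdom : ∀ (p : St × Cp) (y' : g.Site),
      ∑ b ∈ Finset.univ.filter (fun b => src b = p.1 ∧ blkY (b, p.2) = y'), |c b * (h (tgt b) - h (src b))| ≤
        K (blk p) y') :
    HasMajorantHom (g := toB6 g R H) blkY blk (leibRemT src tgt c h) K := by
  intro y' μ B hμ p
  rw [leibRemT_apply]
  calc |∑ b, (if src b = p.1 then c b * (h (tgt b) - h (src b)) else 0) * μ (b, p.2)|
      ≤ ∑ b, |(if src b = p.1 then c b * (h (tgt b) - h (src b)) else 0) * μ (b, p.2)| :=
        Finset.abs_sum_le_sum_abs _ _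
    _ ≤ ∑ b, (if src b = p.1 ∧ blkY (b, p.2) = y' then |c b * (h (tgt b) - h (src b))| * B else 0) := by
        refine Finset.sum_le_sum fun b _ => ?_
        by_cases hs : src b = p.1
        · by_cases hy : blkY (b, p.2) = y'
          · rw [if_pos hs, if_pos ⟨hs, hy⟩, abs_mul]
            exact mul_le_mul_of_nonneg_left (hμ.bound _ hy) (abs_nonneg _)
          · rw [hμ.off _ hy, mul_zero, abs_zero, if_neg (fun h2 => hy h2.2)]
        · rw [if_neg hs, zero_mul, abs_zero, if_neg (fun h2 => hs h2.1)]
    _ = (∑ b ∈ Finset.univ.filter (fun b => src b = p.1 ∧ blkY (b, p.2) = y'), |c b * (h (tgt b) - h (src b))|) * B := by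
        rw [Finset.sum_filter, Finset.sum_mul]
        exact Finset.sum_congr rfl fun b _ => by split_ifs <;> simp
    _ ≤ K (blk p) y' * B := mul_le_mul_of_nonneg_right (hdom p y') hμ.nonneg

/-- **Theorem 3.7 ⇒ entry 3 of (3.42) for G′ = G′(U), with ∇*_U = D* the displayed lattice operator (3.8) in
components** (`covDT`) and the scalar partition functions h_□: the abstract `thm37_rightEntry_of_342` with
`hLeibT` DISCHARGED by `mulOp_comp_covDT` (h^Y_□ = h_□∘b₊, C′ᵗ_□ = `leibRemT h_□`), |h^Y_□| ≦ 1 by |h_□| ≦ 1, and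
`hCLt` by `leibRemT_majorant` from the located domination `hdomT` of Σ|(∂h_□)(b)| over the bonds at a site
component by the column-summable kernel K_{C′,□} (its size κ₄ ~ (M L^jη)^{−1}·L^jη is NOT displayed in print).
What remains hypothesis is listed in the v4 module docstring. [cite: Balaban1985BackgroundPropagators, Thm 3.7
(3.90) p.409 + (3.42) p.397 + (3.8) p.392; Balaban1984PropagatorsII, Lemma 2.1 p.233] -/
theorem thm37_entry3_of_342_lattice [Fintype St] [DecidableEq St] [Fintype Cp] [DecidableEq Cp]
    [Fintype Bd] [DecidableEq Bd] (blk : St × Cp → g.Site) (blkY : Bd × Cp → g.Site) (src tgt : Bd → St)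
    (c : Bd → ℝ) (Rm : Bd → Cp → Cp → ℝ) (d : ℕ) (δ₀ α ρ B₀ κ₁ κ₂ κ₄ Cℓ N N' : ℝ) {ι : Type} [Fintype ι]
    (S S' : ι → Finset g.Site) (hs : ι → St → ℝ) (KP KC KC' : ι → g.Site → g.Site → ℝ)
    {G' Δ : Module.End ℝ (St × Cp → ℝ)}
    (hB₀ : 0 ≤ B₀) (hδ₀ : 0 ≤ δ₀) (hκ₁ : 0 ≤ κ₁) (hκ₂ : 0 ≤ κ₂) (hκ₄ : 0 ≤ κ₄) (hCℓ : 0 ≤ Cℓ) (hN : 0 ≤ N)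
    (hN' : 0 ≤ N') (hαδ : 0 ≤ α * δ₀) (hαδ2 : 0 ≤ (1 - 2 * α) * δ₀)
    (htri : Triangle254 (toB6 g R H)) (hrefl : ∀ y : g.Site, g.dist y y = 0)
    (hsym : ∀ y y' : g.Site, g.dist y y' = g.dist y' y) (hdnn : ∀ y y' : g.Site, 0 ≤ g.dist y y')
    (hlenpos : ∀ y : g.Site, 0 < g.len y)
    (h261 : Ineq261 d (toB6 g R H) δ₀ α) (h263 : Ineq263 d (toB6 g R H) δ₀ α)
    (hsmall : N' * (B₀ * Real.exp (δ₀ * ρ) * (κ₁ + Cℓ * κ₂)) * B6.c1 d δ₀ α < 1)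
    (hh : ∀ i x, |hs i x| ≤ 1) (hS : ∀ i (p : St × Cp), hs i p.1 ≠ 0 → blk p ∈ S i)
    (hcnt : ∀ a : g.Site, (∑ i, if a ∈ S i then (1 : ℝ) else 0) ≤ N)
    (hcnt' : ∀ b : g.Site, (∑ i, if b ∈ S' i then (1 : ℝ) else 0) ≤ N')
    (hcomp : ∀ i (a b : g.Site), a ∈ S i → b ∈ S' i → g.len a ≤ Cℓ * g.len b)
    (hKP : ∀ i a b, 0 ≤ KP i a b) (hlocP : ∀ i y'' b, KP i y'' b ≠ 0 → g.dist y'' b ≤ ρ)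
    (hcolP : ∀ i (b : g.Site), (∑ y'' : g.Site, KP i y'' b) * g.len b ≤ if b ∈ S' i then κ₁ else 0)
    (hKC : ∀ i a b, 0 ≤ KC i a b) (hlocC : ∀ i y'' b, KC i y'' b ≠ 0 → g.dist y'' b ≤ ρ)
    (hcolC : ∀ i (b : g.Site), (∑ y'' : g.Site, KC i y'' b) * g.len b ^ 2 ≤ if b ∈ S' i then κ₂ else 0)
    (hKC' : ∀ i a b, 0 ≤ KC' i a b) (hlocC' : ∀ i y'' b, KC' i y'' b ≠ 0 → g.dist y'' b ≤ ρ)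
    (hcolC' : ∀ i (b : g.Site), (∑ y'' : g.Site, KC' i y'' b) * g.len b ≤ if b ∈ S' i then κ₄ else 0)
    (hdomT : ∀ i (p : St × Cp) (y' : g.Site),
      ∑ b ∈ Finset.univ.filter (fun b => src b = p.1 ∧ blkY (b, p.2) = y'), |c b * (hs i (tgt b) - hs i (src b))| ≤
        KC' i (blk p) y')
    {Gsq Ct : ι → Module.End ℝ (St × Cp → ℝ)} {Pt : ι → (St × Cp → ℝ) →ₗ[ℝ] (Bd × Cp → ℝ)}
    (h342_1 : ∀ i, HasMajorant (g := toB6 g R H) blk (Gsq i)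
      (fun a b => B₀ * g.len a ^ 2 * Real.exp (-(δ₀ * g.dist a b))))
    (h342_3 : ∀ i, HasMajorantHom (g := toB6 g R H) blkY blk (Gsq i ∘ₗ covDT src tgt c Rm)
      (fun a b => B₀ * g.len a * Real.exp (-(δ₀ * g.dist a b))))
    (hPt : ∀ i, HasMajorantHom (g := toB6 g R H) blk blkY (Pt i) (KP i))
    (hCt : ∀ i, HasMajorant (g := toB6 g R H) blk (Ct i) (KC i))
    (hinv : G' * Δ = 1)
    (h388T : (∑ i, mulOp (hs i ∘ Prod.fst) * Gsq i * mulOp (hs i ∘ Prod.fst)) * Δ =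
      1 - ∑ i, mulOp (hs i ∘ Prod.fst) * Gsq i * (covDT src tgt c Rm ∘ₗ Pt i + Ct i)) :
    HasMajorantHom (g := toB6 g R H) blkY blk (G' ∘ₗ covDT src tgt c Rm)
      (fun (a b : g.Site) => B₀ * (N + N' * Real.exp (δ₀ * ρ) * Cℓ * κ₄) * B6.c1 d δ₀ α *
        (1 - N' * (B₀ * Real.exp (δ₀ * ρ) * (κ₁ + Cℓ * κ₂)) * B6.c1 d δ₀ α)⁻¹ * g.len a *
        Real.exp (-((1 - 2 * α) * δ₀ * g.dist a b))) :=
  thm37_rightEntry_of_342 blk blkY d δ₀ α ρ B₀ κ₁ κ₂ κ₄ Cℓ N N' S S' (fun i => hs i ∘ Prod.fst)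
    (fun i => hs i ∘ tgt ∘ Prod.fst) KP KC KC' hB₀ hδ₀ hκ₁ hκ₂ hκ₄ hCℓ hN hN' hαδ hαδ2 htri hrefl hsym hdnn hlenpos
    h261 h263 hsmall (fun i p => hh i p.1) (fun i p hp => hS i p hp) (fun i v => hh i (tgt v.1)) hcnt hcnt' hcomp
    hKP hlocP hcolP hKC hlocC hcolC hKC' hlocC' hcolC' h342_1 h342_3 hPt hCt
    (fun i => leibRemT_majorant blk blkY src tgt c (hs i) (KC' i) (hdomT i))
    (fun i => mulOp_comp_covDT src tgt c Rm (hs i)) hinv h388T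

end LatticeAdjoint

/-! ## v5 ADDENDUM — entry 4 of (3.42) for G′ (Δ_UG′(U)) from the structure of the expansion of Theorem 3.7, with
the covariant Laplace operator Δ_U = D*D of (3.23) in COMPONENTS and its second-order Leibniz rule KERNEL-PROVED
(cell record D-pv21g5.3)

p. 394 (verbatim): *"In the above formulas Δ_U is the covariant Laplce* [sic] *operator Δ^η_U = D^{η*}_U D^η_U =
Σ_{μ=1}^d D^{η*}_{U,μ}D^η_{U,μ}. (3.23) Let us introduce the operator Δ′_a = Δ′_a(U) = (Δ^η_U + Q′*aQ′)↾_{Ω₀}, where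
Q′*aQ′ is defined by the same quadratic form as in (2.14)"*; p. 394, last line (verbatim): *"where G′ = G′(U) =
(Δ′_a)^{−1}."*; p. 397, Theorem 3.1 (verbatim): *"There exist positive constants M₁, δ₀, a₀, B₀ dependent on d and L
only, a constant B₀(β) …, such that for M ≧ M₁ and for an arbitrary configuration U satisfying the regularity
condition (3.35) with Mα₀ ≦ a₀, the operator G′(U) (a = 1) satisfies the inequalities |(G′(U)λ)(x)|,
|(∇_UG′(U)λ)(x)|, |(G′(U)∇*_Uλ)(x)|, |(Δ_UG′(U)λ)(x)| ≦ B₀[(L^jη)², L^jη, L^jη, 1]e^{−δ₀d(y,y′)}|λ| for x∈Δ(y),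
y∈Λ_j, supp λ ⊂ Δ(y′); (3.42)"* — this addendum concerns the FOURTH entry (weight 1); p. 409 (verbatim, the
first line of (3.88)): *"Using (3.50) we get … (Δ′_a hλ)(x) = h(x)(Δ′_aλ)(x) − Σ_{b∈st(x)}(∂h)(b)(Dλ)(b) +
(Δh)(x)λ(x) + …"*, and Theorem 3.7 (3.90) with *"The expansion is convergent in all norms appearing in the
inequalities (3.42)–(3.47)."* (quoted in full in the v4 addendum).

THE COMPONENT MODEL OF Δ_U (only the displayed (3.23), (3.3), (3.8) are in print).  With the v3/v4 model (`St`, `Bd`,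
`src` = b₋, `tgt` = b₊, components `Cp`, weight `c b`, real matrix `Rm b`; D = `covD src tgt c Rm` (3.3), D* =
`covDT src tgt c Rm` (3.8), the latter the component transpose of the former by v4's `sum_covDT_mul`), the covariant
Laplace operator (3.23) is the composite Δ_U = D*D = `covDT src tgt c Rm ∘ₗ covD src tgt c Rm` on site components —
no new definition.  For a SCALAR lattice function h the first-order rules (L) of v3 (`covD_comp_mulOp` : D∘M_h =
M_{h∘b₊}∘D + leibRem h) and (Lᵗ) of v4 (`mulOp_comp_covDT` : M_h∘D* = D*∘M_{h∘b₊} + leibRemT h) compose to the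
second-order Leibniz rule
    Δ_U∘M_h = M_h∘Δ_U + (−leibRemT h)∘D + D*∘(leibRem h)                                                    (L²)
(`covLap_comp_mulOp`, kernel-checked; an algebraic identity, Rm(b), c(b) arbitrary) — the shape `hLeib` of v2's
`thm37_leftEntry_of_342` at E = Δ_U with h^Z = h (Z = the site components), P′ = −leibRemT h (acting on Dλ: the
term −Σ(∂h)(b)(Dλ)(b) of (3.88), here over the bonds with b₋ = x) and C′ = D*∘leibRem h (acting on λ: explicitly
(D*((∂h)λ(b₋)))(x, i) = Σ_{b₊=x} c(b)Σ_k Rm(b)_{ki}(∂h)(b)λ(b₋, k) − (Σ_{b₋=x} c(b)(∂h)(b))λ(x, i), whose second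
coefficient is the "(Δh)(x)λ(x)" term of (3.88); print groups the bonds of st(x) differently — an equivalent
splitting of the same identity, cell record D-pv21g5.3).

* `hasMajorantHom_neg` — a two-space majorant of T is one of −T;
* `covLap_comp_mulOp` — (L²);
* `covDT_leibRem_majorant` — D*∘leibRem h has the two-space majorant K from the located domination `hdomL` of its
  explicit coefficients: Σ_{b₊=x}Σ_{k : (b₋,k) in block y″}|c(b)(∂h)(b)Rm(b)_{ki}| + 1_{(x,i) in block y″}|Σ_{b₋=x}
  c(b)(∂h)(b)| ≦ K(y, y″) for (x, i) in block y (cancellation inside the lattice Laplacian of h allowed);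
* `thm37_entry4_of_342_lattice` — **Theorem 3.7 ⇒ entry 4 of (3.42) for G′ with Δ_U = `covDT … ∘ₗ covD …`** and the
  partition h_□∘pr₁: v2's `thm37_leftEntry_of_342` at E = Δ_U, Z = X, W ≡ 1, with `hLeib` (by (L²)), `hPL` (by v4's
  `leibRemT_majorant` and `hasMajorantHom_neg` from the located domination `hdomT` of Σ_{b₋=x}|(∂h_□)(b)| by
  K′_{P,□}(y, y″)), `hCL` (by `covDT_leibRem_majorant` from `hdomL` with K′_{C,□}), `hhZ` (|h_□| ≦ 1) and `hSZ`
  (supp h_□ within the blocks of S_□) DISCHARGED: Δ_UG′ has the majorant B₀(N + N′e^{δ₀ρ}(κ₃ + κ₄))c₁(α)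
  (1 − N′θc₁(α))^{−1}e^{−(1−α)δ₀d(y,y′)}, θ = B₀e^{δ₀ρ}(κ₁ + κ₂), under the located smallness N′θc₁(α) < 1 (*"for M
  sufficiently large"*) — entry 4 of (3.42) for G′, weight 1.

NOT ASSERTED in this addendum (hypotheses of `thm37_entry4_of_342_lattice`): Corollary 3.6 entries 1, 2, 4 of (3.42)
for every G′_□ (`h342_1`, `h342_2`, `h342_4`, with D = `covD …`, Δ_U = `covDT … ∘ₗ covD …`); `hinv` (G′Δ′_a = I) and
(3.88) in the printed shape `h388` with its local operators P_□ (bonds → sites), C_□ and their kernels K_{P,□},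
K_{C,□} ≧ 0 of range ≦ ρ and row-sums ≦ κ₁1_{S′_□}, κ₂1_{S′_□} against L^{j″}η, (L^{j″}η)²; the dominations
`hdomT`, `hdomL` of the coefficients of the second-order Leibniz remainder by kernels K′_{P,□}, K′_{C,□} ≧ 0 of
range ≦ ρ and row-sums ≦ κ₃1_{S′_□}, κ₄1_{S′_□} against L^{j″}η, (L^{j″}η)² — their SIZES are NOT displayed in print,
exactly as κ₁, κ₂ in v1–v4 (cell GAPS G-pv21g4-1 (i) shape) [v7.1 DOCFIX D1, cell GAPS C-A33-1 / G-pv21g6-1: for the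
partition of unity of [4] Sect. A, κ₃ = O((ML^jη)^{−1})·L^jη = O(M^{−1}), but κ₄ is NOT O(M^{−2}) in THIS grouping —
the first summand of `hdomL` carries the NON-cancelling coefficient c(b)(∂h_□)(b) = O(η^{−1}(ML^jη)^{−1}), so against
(L^{j″}η)² its row sums are O(L^jη/(Mη)) = O(L^j/M), NOT small uniformly in the scale j (only the cancelling second
summand is O((ML^jη)^{−2})·(L^jη)² = O(M^{−2})); the PRINTED grouping over st(x) — every first-order coefficient (∂h)(b)
paired with Dλ (row sums O(M^{−1})), only (Δh)(x) = O((ML^jη)^{−2}) paired with λ (O(M^{−2})) — is the sibling leaf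
`B9Thm37GlueSt`]; the partition data |h_□| ≦ 1,
supp h_□ within the blocks of S_□, the counts N, N′; Lemma 2.1 of [4] (`h261`, `h263`); the geometry d(y, y) = 0,
d ≧ 0, L^jη ≧ 0, (2.54); the located smallness and 0 ≦ (1 − α)δ₀.  The exponent comes out as (1 − α)δ₀ where
print keeps δ₀ by shrinking it tacitly ([4] p. 234).  The identification of matrix valued functions with real
components is the model's (faithful for trace-orthonormal components and equal site/bond weights), not the
paper's.  Value: kernel-checked bookkeeping, NOT summit progress. -/

section Entry4

omit [DecidableEq g.Site] in
/-- A two-space majorant of T is one of −T (the sign of the (∂h)(D·) term of (3.88)). [folklore] -/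
theorem hasMajorantHom_neg (blkX : X → g.Site) (blkY : Y → g.Site) {T : (X → ℝ) →ₗ[ℝ] (Y → ℝ)}
    {K : g.Site → g.Site → ℝ} (hT : HasMajorantHom (g := toB6 g R H) blkX blkY T K) :
    HasMajorantHom (g := toB6 g R H) blkX blkY (-T) K := by
  intro y' μ B hμ v
  rw [LinearMap.neg_apply, Pi.neg_apply, abs_neg]
  exact hT y' μ B hμ v

variable {St Cp Bd : Type}

/-- **The second-order Leibniz rule of the covariant Laplace operator Δ_U = D*D** ((3.23) p. 394: *"In the above
formulas Δ_U is the covariant Laplce* [sic] *operator Δ^η_U = D^{η*}_U D^η_U = Σ_{μ=1}^d D^{η*}_{U,μ}D^η_{U,μ}.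
(3.23)"*) through the multiplication by a SCALAR lattice function h, in components (`covDT ∘ₗ covD` with the SAME
weight c and matrix field Rm): Δ_U∘M_h = M_h∘Δ_U + (−leibRemT h)∘D + D*∘(leibRem h) — obtained by composing the
first-order rules `covD_comp_mulOp` (D∘M_h = M_{h∘b₊}∘D + leibRem h) and `mulOp_comp_covDT` (M_h∘D* = D*∘M_{h∘b₊} +
leibRemT h); this is the algebra behind the first line of (3.88) p. 409 (*"(Δ′_a hλ)(x) = h(x)(Δ′_aλ)(x) −
Σ_{b∈st(x)}(∂h)(b)(Dλ)(b) + (Δh)(x)λ(x) + …"*; print groups the bonds of st(x) differently — here the b₋ = x bonds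
carry (∂h)(b)(Dλ)(b) and D*((∂h)λ(b₋)) carries the rest, an equivalent splitting of the same identity), i.e. the
shape `hLeib` of `thm37_leftEntry_of_342` at E = Δ_U with h^Z = h, P′ = −leibRemT h, C′ = D*∘leibRem h.
[cite: Balaban1985BackgroundPropagators, (3.23) p.394 + (3.3) p.391 + (3.8) p.392 + (3.88) p.409] -/
theorem covLap_comp_mulOp [Fintype Bd] [Fintype Cp] [DecidableEq St] (src tgt : Bd → St) (c : Bd → ℝ)
    (Rm : Bd → Cp → Cp → ℝ) (h : St → ℝ) :
    (covDT src tgt c Rm ∘ₗ covD src tgt c Rm) ∘ₗ mulOp (h ∘ Prod.fst) =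
      mulOp (h ∘ Prod.fst) ∘ₗ (covDT src tgt c Rm ∘ₗ covD src tgt c Rm) +
        ((-leibRemT src tgt c h) ∘ₗ covD src tgt c Rm + covDT src tgt c Rm ∘ₗ leibRem src tgt c h) := by
  have h1 := covD_comp_mulOp src tgt c Rm h
  have h2 := mulOp_comp_covDT src tgt c Rm h
  apply LinearMap.ext
  intro f
  have e1 := LinearMap.congr_fun h1 f
  have e2 := LinearMap.congr_fun h2 (covD src tgt c Rm f)
  simp only [LinearMap.comp_apply, LinearMap.add_apply] at e1 e2
  simp only [LinearMap.comp_apply, LinearMap.add_apply, LinearMap.neg_apply]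
  rw [e1, map_add, e2]
  abel

/-- **The two-space majorant of D*∘(leibRem h)** (the part of the second-order Leibniz remainder of Δ_U through M_h
that acts on λ itself: (D*((∂h)λ(b₋)))(x, i) = Σ_{b₊=x} c(b)Σ_k R(U(b))_{ki}(∂h)(b)λ(b₋, k) − (Σ_{b₋=x} c(b)(∂h)(b))
λ(x, i), whose second coefficient is the lattice Laplacian-type term "(Δh)(x)λ(x)" of (3.88)): if, site component by
site component and block by block, the explicit coefficients are dominated by K(y, y″) (`hdomL`, with |Σ_{b₋=x}
c(b)(∂h)(b)| allowed to cancel), then D*∘leibRem h has the majorant K — the hypothesis `hCL` of `thm37_leftEntry_of_342`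
at E = Δ_U (the SIZE is carried by K and is not displayed in print; v7.1 DOCFIX D1: for the partition of unity of [4]
Sect. A the first summand is O(η^{−1}(ML^jη)^{−1}) per bond WITHOUT cancellation and only the second is
O((ML^jη)^{−2}) — see the note in the v5 addendum docstring and the sibling leaf `B9Thm37GlueSt`). [cite: Balaban1985BackgroundPropagators, (3.8) p.392 + (3.88) p.409; Balaban1984PropagatorsII, (2.39)–(2.40) pp.229–230] -/
theorem covDT_leibRem_majorant [Fintype Bd] [Fintype Cp] [DecidableEq St] (blk : St × Cp → g.Site)
    (src tgt : Bd → St) (c : Bd → ℝ) (Rm : Bd → Cp → Cp → ℝ) (h : St → ℝ) (K : g.Site → g.Site → ℝ)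
    (hdomL : ∀ (p : St × Cp) (y' : g.Site),
      (∑ b ∈ Finset.univ.filter (fun b => tgt b = p.1),
          ∑ k ∈ Finset.univ.filter (fun k => blk (src b, k) = y'),
            |c b * (c b * (h (tgt b) - h (src b))) * Rm b k p.2|) +
        (if blk p = y' then |∑ b ∈ Finset.univ.filter (fun b => src b = p.1), c b * (c b * (h (tgt b) - h (src b)))|
          else 0) ≤ K (blk p) y') :
    HasMajorantHom (g := toB6 g R H) blk blk (covDT src tgt c Rm ∘ₗ leibRem src tgt c h) K := by
  intro y' μ B hμ p
  have hB : 0 ≤ B := hμ.nonneg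
  have habs : ∀ x y : ℝ, |x - y| ≤ |x| + |y| := fun x y => by
    rw [sub_eq_add_neg, ← abs_neg y]
    exact abs_add_le _ _
  rw [LinearMap.comp_apply, covDT_apply]
  simp only [leibRem_apply]
  -- the D*-of-(∂h)λ(b₋) part, bond components ending at x
  have hA : |∑ b, (if tgt b = p.1 then c b else 0) *
        ∑ k, Rm b k p.2 * (c b * (h (tgt b) - h (src b)) * μ (src b, k))| ≤
      (∑ b ∈ Finset.univ.filter (fun b => tgt b = p.1),
          ∑ k ∈ Finset.univ.filter (fun k => blk (src b, k) = y'),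
            |c b * (c b * (h (tgt b) - h (src b))) * Rm b k p.2|) * B := by
    calc |∑ b, (if tgt b = p.1 then c b else 0) *
            ∑ k, Rm b k p.2 * (c b * (h (tgt b) - h (src b)) * μ (src b, k))|
        ≤ ∑ b, |(if tgt b = p.1 then c b else 0) *
            ∑ k, Rm b k p.2 * (c b * (h (tgt b) - h (src b)) * μ (src b, k))| := Finset.abs_sum_le_sum_abs _ _
      _ ≤ ∑ b, (if tgt b = p.1 then
            ∑ k, (if blk (src b, k) = y' then |c b * (c b * (h (tgt b) - h (src b))) * Rm b k p.2| * B else 0)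
            else 0) := by
          refine Finset.sum_le_sum fun b _ => ?_
          by_cases ht : tgt b = p.1
          · rw [if_pos ht, if_pos ht, Finset.mul_sum]
            refine (Finset.abs_sum_le_sum_abs _ _).trans (Finset.sum_le_sum fun k _ => ?_)
            by_cases hk : blk (src b, k) = y'
            · rw [if_pos hk, show c b * (Rm b k p.2 * (c b * (h (tgt b) - h (src b)) * μ (src b, k))) =
                  (c b * (c b * (h (tgt b) - h (src b))) * Rm b k p.2) * μ (src b, k) by ring, abs_mul]
              exact mul_le_mul_of_nonneg_left (hμ.bound _ hk) (abs_nonneg _)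
            · rw [if_neg hk, hμ.off _ hk, mul_zero, mul_zero, mul_zero, abs_zero]
          · rw [if_neg ht, if_neg ht, zero_mul, abs_zero]
      _ = (∑ b ∈ Finset.univ.filter (fun b => tgt b = p.1),
            ∑ k ∈ Finset.univ.filter (fun k => blk (src b, k) = y'),
              |c b * (c b * (h (tgt b) - h (src b))) * Rm b k p.2|) * B := by
          rw [Finset.sum_filter, Finset.sum_mul]
          refine Finset.sum_congr rfl fun b _ => ?_
          split_ifs
          · rw [Finset.sum_filter, Finset.sum_mul]
            exact Finset.sum_congr rfl fun k _ => by split_ifs <;> simp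
          · rw [zero_mul]
  -- the (Δh)(x)λ(x) part, bond components starting at x
  have hBt : |∑ b, (if src b = p.1 then c b else 0) * (c b * (h (tgt b) - h (src b)) * μ (src b, p.2))| ≤
      (if blk p = y' then |∑ b ∈ Finset.univ.filter (fun b => src b = p.1), c b * (c b * (h (tgt b) - h (src b)))|
        else 0) * B := by
    have hsum : ∑ b, (if src b = p.1 then c b else 0) * (c b * (h (tgt b) - h (src b)) * μ (src b, p.2)) =
        (∑ b ∈ Finset.univ.filter (fun b => src b = p.1), c b * (c b * (h (tgt b) - h (src b)))) * μ p := by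
      rw [Finset.sum_filter, Finset.sum_mul]
      refine Finset.sum_congr rfl fun b _ => ?_
      by_cases hs : src b = p.1
      · rw [if_pos hs, if_pos hs, hs, Prod.mk.eta]
        ring
      · rw [if_neg hs, if_neg hs, zero_mul, zero_mul]
    rw [hsum, abs_mul]
    by_cases hp : blk p = y'
    · rw [if_pos hp]
      exact mul_le_mul_of_nonneg_left (hμ.bound _ hp) (abs_nonneg _)
    · rw [if_neg hp, hμ.off _ hp, abs_zero, mul_zero, zero_mul]
  calc |∑ b, ((if tgt b = p.1 then c b else 0) *
          ∑ k, Rm b k p.2 * (c b * (h (tgt b) - h (src b)) * μ (src b, k)) -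
          (if src b = p.1 then c b else 0) * (c b * (h (tgt b) - h (src b)) * μ (src b, p.2)))|
      = |∑ b, (if tgt b = p.1 then c b else 0) *
            ∑ k, Rm b k p.2 * (c b * (h (tgt b) - h (src b)) * μ (src b, k)) -
          ∑ b, (if src b = p.1 then c b else 0) * (c b * (h (tgt b) - h (src b)) * μ (src b, p.2))| := by
        rw [Finset.sum_sub_distrib]
    _ ≤ _ := habs _ _
    _ ≤ _ := add_le_add hA hBt
    _ = ((∑ b ∈ Finset.univ.filter (fun b => tgt b = p.1),
            ∑ k ∈ Finset.univ.filter (fun k => blk (src b, k) = y'),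
              |c b * (c b * (h (tgt b) - h (src b))) * Rm b k p.2|) +
          (if blk p = y' then
            |∑ b ∈ Finset.univ.filter (fun b => src b = p.1), c b * (c b * (h (tgt b) - h (src b)))| else 0)) * B := by
        ring
    _ ≤ K (blk p) y' * B := mul_le_mul_of_nonneg_right (hdomL p y') hB

/-- **Theorem 3.7 ⇒ entry 4 of (3.42) for G′ = G′(U), with Δ_U = D*D the displayed covariant Laplace operator
(3.23) in components** (`covDT src tgt c Rm ∘ₗ covD src tgt c Rm`) and the scalar partition functions h_□: the
abstract `thm37_leftEntry_of_342` (v2) at E = Δ_U, Z = the site components, W ≡ 1 (p. 397 (3.42): *"|(G′(U)λ)(x)|,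
|(∇_UG′(U)λ)(x)|, |(G′(U)∇*_Uλ)(x)|, |(Δ_UG′(U)λ)(x)| ≦ B₀[(L^jη)², L^jη, L^jη, 1]e^{−δ₀d(y,y′)}|λ|"*), with its
structural hypotheses DISCHARGED by the component model: `hLeib` by `covLap_comp_mulOp` (h^Z_□ = h_□, P′_□ =
−leibRemT h_□, C′_□ = D*∘leibRem h_□), `hPL` by `leibRemT_majorant` + `hasMajorantHom_neg` from the located
domination `hdomT` of Σ|(∂h_□)(b)| over the bonds starting at a site component, `hCL` by `covDT_leibRem_majorant`
from the located domination `hdomL` of the explicit coefficients of D*∘leibRem h_□, and `hhZ`, `hSZ` by |h_□| ≦ 1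
and supp h_□ within the blocks of S_□.  What REMAINS hypothesis (not asserted, cf. the v5 module docstring):
Corollary 3.6 entries 1, 2, 4 for the G′_□ (`h342_1`, `h342_2`, `h342_4`), K(h_□) = P_□∘D + C_□ with located
row-sums (`hP`, `hC`, `hrowP`, `hrowC`), G′Δ′_a = I, (3.88) in the printed shape, Lemma 2.1 of [4], the counts
N, N′, the located smallness N′θc₁(α) < 1, and the kernels K′_{P,□}, K′_{C,□} ≧ 0 of range ≦ ρ and row-sums
≦ κ₃1_{S′_□}, κ₄1_{S′_□} against L^{j″}η, (L^{j″}η)² (their sizes are NOT displayed in print; v7.1 DOCFIX D1: for the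
partition of unity of [4] Sect. A, κ₃ = O(M^{−1}) while κ₄ as dominated through `hdomL` is O(L^j/M), NOT O(M^{−2}) —
see the note in the v5 addendum docstring and the sibling leaf `B9Thm37GlueSt`).  Conclusion: |(Δ_UG′λ)(x)| ≦ B₀(N +
N′e^{δ₀ρ}(κ₃ + κ₄))c₁(α)(1 − N′θc₁(α))^{−1}e^{−(1−α)δ₀d(y,y′)}|λ| for x in the block of y, supp λ ⊂ Δ(y′) —
entry 4 of (3.42) for G′ (weight 1). [cite: Balaban1985BackgroundPropagators, (3.23) p.394, Thm 3.7 (3.87)–(3.90)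
pp.409–410, Thm 3.1 (3.42) p.397; Balaban1984PropagatorsII, Lemma 2.1 p.233, Prop 2.2 (2.67) p.234] -/
theorem thm37_entry4_of_342_lattice [Fintype St] [DecidableEq St] [Fintype Cp] [DecidableEq Cp] [Fintype Bd]
    (blk : St × Cp → g.Site) (blkY : Bd × Cp → g.Site) (src tgt : Bd → St) (c : Bd → ℝ)
    (Rm : Bd → Cp → Cp → ℝ) (d : ℕ) (δ₀ α ρ B₀ κ₁ κ₂ κ₃ κ₄ N N' : ℝ) {ι : Type} [Fintype ι]
    (S S' : ι → Finset g.Site) (hs : ι → St → ℝ) (KP KC KP' KC' : ι → g.Site → g.Site → ℝ)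
    {G' Δ : Module.End ℝ (St × Cp → ℝ)}
    (hB₀ : 0 ≤ B₀) (hδ₀ : 0 ≤ δ₀) (hκ : 0 ≤ κ₁ + κ₂) (hκ' : 0 ≤ κ₃ + κ₄) (hN : 0 ≤ N) (hN' : 0 ≤ N')
    (hαδ : 0 ≤ (1 - α) * δ₀)
    (htri : Triangle254 (toB6 g R H)) (hrefl : ∀ y : g.Site, g.dist y y = 0)
    (hdnn : ∀ y y' : g.Site, 0 ≤ g.dist y y') (hlen : ∀ y : g.Site, 0 ≤ g.len y)
    (h261 : Ineq261 d (toB6 g R H) δ₀ α) (h263 : Ineq263 d (toB6 g R H) δ₀ α)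
    (hsmall : N' * (B₀ * Real.exp (δ₀ * ρ) * (κ₁ + κ₂)) * B6.c1 d δ₀ α < 1)
    (hh : ∀ i x, |hs i x| ≤ 1) (hS : ∀ i (p : St × Cp), hs i p.1 ≠ 0 → blk p ∈ S i)
    (hcnt : ∀ a : g.Site, (∑ i, if a ∈ S i then (1 : ℝ) else 0) ≤ N)
    (hcnt' : ∀ a : g.Site, (∑ i, if a ∈ S' i then (1 : ℝ) else 0) ≤ N')
    (hKP : ∀ i a b, 0 ≤ KP i a b) (hlocP : ∀ i a y'', KP i a y'' ≠ 0 → g.dist a y'' ≤ ρ)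
    (hrowP : ∀ i (a : g.Site), ∑ y'' : g.Site, KP i a y'' * g.len y'' ≤ if a ∈ S' i then κ₁ else 0)
    (hKC : ∀ i a b, 0 ≤ KC i a b) (hlocC : ∀ i a y'', KC i a y'' ≠ 0 → g.dist a y'' ≤ ρ)
    (hrowC : ∀ i (a : g.Site), ∑ y'' : g.Site, KC i a y'' * g.len y'' ^ 2 ≤ if a ∈ S' i then κ₂ else 0)
    (hKP' : ∀ i a b, 0 ≤ KP' i a b) (hlocP' : ∀ i a y'', KP' i a y'' ≠ 0 → g.dist a y'' ≤ ρ)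
    (hrowP' : ∀ i (a : g.Site), ∑ y'' : g.Site, KP' i a y'' * g.len y'' ≤ if a ∈ S' i then κ₃ else 0)
    (hKC' : ∀ i a b, 0 ≤ KC' i a b) (hlocC' : ∀ i a y'', KC' i a y'' ≠ 0 → g.dist a y'' ≤ ρ)
    (hrowC' : ∀ i (a : g.Site), ∑ y'' : g.Site, KC' i a y'' * g.len y'' ^ 2 ≤ if a ∈ S' i then κ₄ else 0)
    (hdomT : ∀ i (p : St × Cp) (y' : g.Site),
      ∑ b ∈ Finset.univ.filter (fun b => src b = p.1 ∧ blkY (b, p.2) = y'),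
        |c b * (hs i (tgt b) - hs i (src b))| ≤ KP' i (blk p) y')
    (hdomL : ∀ i (p : St × Cp) (y' : g.Site),
      (∑ b ∈ Finset.univ.filter (fun b => tgt b = p.1),
          ∑ k ∈ Finset.univ.filter (fun k => blk (src b, k) = y'),
            |c b * (c b * (hs i (tgt b) - hs i (src b))) * Rm b k p.2|) +
        (if blk p = y' then
          |∑ b ∈ Finset.univ.filter (fun b => src b = p.1), c b * (c b * (hs i (tgt b) - hs i (src b)))| else 0) ≤
        KC' i (blk p) y')
    {Gsq Cop : ι → Module.End ℝ (St × Cp → ℝ)} {P : ι → (Bd × Cp → ℝ) →ₗ[ℝ] (St × Cp → ℝ)}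
    (h342_1 : ∀ i, HasMajorant (g := toB6 g R H) blk (Gsq i)
      (fun a b => B₀ * g.len a ^ 2 * Real.exp (-(δ₀ * g.dist a b))))
    (h342_2 : ∀ i, HasMajorantHom (g := toB6 g R H) blk blkY (covD src tgt c Rm ∘ₗ Gsq i)
      (fun a b => B₀ * g.len a * Real.exp (-(δ₀ * g.dist a b))))
    (h342_4 : ∀ i, HasMajorantHom (g := toB6 g R H) blk blk ((covDT src tgt c Rm ∘ₗ covD src tgt c Rm) ∘ₗ Gsq i)
      (fun a b => B₀ * Real.exp (-(δ₀ * g.dist a b))))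
    (hP : ∀ i, HasMajorantHom (g := toB6 g R H) blkY blk (P i) (KP i))
    (hC : ∀ i, HasMajorant (g := toB6 g R H) blk (Cop i) (KC i))
    (hinv : G' * Δ = 1)
    (h388 : Δ * (∑ i, mulOp (hs i ∘ Prod.fst) * Gsq i * mulOp (hs i ∘ Prod.fst)) =
      1 - ∑ i, (P i ∘ₗ covD src tgt c Rm + Cop i) * Gsq i * mulOp (hs i ∘ Prod.fst)) :
    HasMajorantHom (g := toB6 g R H) blk blk ((covDT src tgt c Rm ∘ₗ covD src tgt c Rm) ∘ₗ G')
      (fun (a b : g.Site) => B₀ * (N + N' * Real.exp (δ₀ * ρ) * (κ₃ + κ₄)) * B6.c1 d δ₀ α *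
        (1 - N' * (B₀ * Real.exp (δ₀ * ρ) * (κ₁ + κ₂)) * B6.c1 d δ₀ α)⁻¹ *
        Real.exp (-((1 - α) * δ₀ * g.dist a b))) := by
  -- the structural inputs of `thm37_leftEntry_of_342` at E = Δ_U, supplied by the component model
  have hLeib : ∀ i, (covDT src tgt c Rm ∘ₗ covD src tgt c Rm) ∘ₗ mulOp (hs i ∘ Prod.fst) =
      mulOp (hs i ∘ Prod.fst) ∘ₗ (covDT src tgt c Rm ∘ₗ covD src tgt c Rm) +
        ((-leibRemT src tgt c (hs i)) ∘ₗ covD src tgt c Rm + covDT src tgt c Rm ∘ₗ leibRem src tgt c (hs i)) :=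
    fun i => covLap_comp_mulOp src tgt c Rm (hs i)
  have hPL : ∀ i, HasMajorantHom (g := toB6 g R H) blkY blk (-leibRemT src tgt c (hs i)) (KP' i) :=
    fun i => hasMajorantHom_neg blkY blk (leibRemT_majorant blk blkY src tgt c (hs i) (KP' i) (hdomT i))
  have hCL : ∀ i, HasMajorantHom (g := toB6 g R H) blk blk (covDT src tgt c Rm ∘ₗ leibRem src tgt c (hs i))
      (KC' i) := fun i => covDT_leibRem_majorant blk src tgt c Rm (hs i) (KC' i) (hdomL i)
  have hrowP'1 : ∀ i (a : g.Site), ∑ y'' : g.Site, KP' i a y'' * g.len y'' ≤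
      if a ∈ S' i then κ₃ * (fun _ : g.Site => (1 : ℝ)) a else 0 := fun i a => by
    rw [mul_one]
    exact hrowP' i a
  have hrowC'1 : ∀ i (a : g.Site), ∑ y'' : g.Site, KC' i a y'' * g.len y'' ^ 2 ≤
      if a ∈ S' i then κ₄ * (fun _ : g.Site => (1 : ℝ)) a else 0 := fun i a => by
    rw [mul_one]
    exact hrowC' i a
  have h342_E : ∀ i, HasMajorantHom (g := toB6 g R H) blk blk
      ((covDT src tgt c Rm ∘ₗ covD src tgt c Rm) ∘ₗ Gsq i)
      (fun a b => B₀ * (fun _ : g.Site => (1 : ℝ)) a * Real.exp (-(δ₀ * g.dist a b))) :=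
    fun i => hasMajorantHom_mono (g := toB6 g R H) blk blk (h342_4 i) fun (a b : g.Site) => le_of_eq (by ring)
  have hmain := thm37_leftEntry_of_342 (R := R) (H := H) blk blkY blk d δ₀ α ρ B₀ κ₁ κ₂ κ₃ κ₄ N N'
    (fun _ => (1 : ℝ)) S S' (fun i => hs i ∘ Prod.fst) (fun i => hs i ∘ Prod.fst) KP KC KP' KC' hB₀ hδ₀ hκ hκ' hN
    hN' (fun _ => zero_le_one) hαδ htri hrefl hdnn hlen h261 h263 hsmall (fun i p => hh i p.1) (fun i p => hh i p.1)
    hS hcnt hcnt' hKP hlocP hrowP hKC hlocC hrowC hKP' hlocP' hrowP'1 hKC' hlocC' hrowC'1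
    (PL := fun i => -leibRemT src tgt c (hs i)) (CL := fun i => covDT src tgt c Rm ∘ₗ leibRem src tgt c (hs i))
    h342_1 h342_2 h342_E hP hC hPL hCL hLeib hinv h388
  refine hasMajorantHom_mono (g := toB6 g R H) blk blk hmain fun (a b : g.Site) => le_of_eq ?_
  simp only [mul_one]

end Entry4

/-! ## v6 ADDENDUM — the transposed (3.88) of v4 DERIVED from the printed (3.88): a transpose calculus for the
component pairing (cell record D-pv21g5.4)

p. 391 (verbatim): *"In the sequel we will frequently use adjoint operators to derivatives D. The adjoints are taken
with respect to natural L² scalar products for functions with values in N × N hermitian matrices."*; p. 394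
(verbatim): *"In the above formulas Δ_U is the covariant Laplce* [sic] *operator Δ^η_U = D^{η*}_U D^η_U =
Σ_{μ=1}^d D^{η*}_{U,μ}D^η_{U,μ}. (3.23) Let us introduce the operator Δ′_a = Δ′_a(U) = (Δ^η_U + Q′*aQ′)↾_{Ω₀}, where
Q′*aQ′ is defined by the same quadratic form as in (2.14), i.e. ⟨λ, Q′*aQ′λ⟩ = Σ_{j=0}^k a_j Σ_{y∈Λ_j}
(L^jη)^{d−2}|(Q′_j(U)λ)(y)|², (3.24)"*; p. 395 (verbatim): *"Assuming some regularity of the configuration U it can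
be easily shown that the operator Δ′_a is positive. This implies positivity of the operators G′, Q′G′²Q′\*, hence
the existence of the operator R."*; p. 409 (verbatim): *"hence Δ′_aG′₀ = I − Σ_{□∈𝒟} K(h_□)G′_□h_□ = I − R′."*

THE POINT.  v4 typed the right entry G′∇*_U of (3.42) through the TRANSPOSE of (3.88), `h388T` : G′₀Δ′_a = I −
Σ_□h_□G′_□(D*Pᵗ_□ + Cᵗ_□), taken as a hypothesis (cell GAPS C-pv21g5-3, located residual (ii)).  This addendum
DERIVES `h388T` from (3.88) in its printed shape `h388` : Δ′_aG′₀ = I − Σ_□(P_□∘D + C_□)G′_□h_□ and the SYMMETRY of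
Δ′_a and of the G′_□ for the component pairing ⟨u, v⟩ = Σ_x u(x)v(x) — print's setting: Δ′_a is defined by the
quadratic forms (3.23)–(3.24) and is positive (p. 395), the G′_□ are (restricted) inverses of such operators, and
all adjoints are L² adjoints (p. 391) — by a small transpose calculus: `IsTransposePair A B` (Σ_y(Au)(y)v(y) =
Σ_x u(x)(Bv)(x)), closed under identity, M_h (symmetric), composition ((A′A)ᵗ = AᵗA′ᵗ), sums and differences, with
UNIQUENESS of the transpose on a finite index type (`IsTransposePair.right_unique`, via the nondegeneracy of the
pairing: test against the indicator functions).  The transpose of D = `covD` IS D* = `covDT` (`isTransposePair_covD`,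
= v4's kernel certificate `sum_covDT_mul`), and Δ_U = D*D is symmetric in the model (`isTransposePair_covLap`,
kernel).  Transposing both sides of (3.88): (Δ′_aG′₀)ᵗ = G′₀Δ′_a (G′₀ = Σ_□h_□G′_□h_□ symmetric), (I − Σ_□(P_□D +
C_□)G′_□h_□)ᵗ = I − Σ_□h_□G′_□(D*Pᵗ_□ + Cᵗ_□); uniqueness of the transpose of the common value gives `h388T`
(`h388T_of_h388`).

* `IsTransposePair` [model notion] and its calculus: `.symm`, `.congr_right`, `.right_unique`, `isTransposePair_one`,
  `isTransposePair_mulOp`, `.comp`, `.mul`, `.add`, `.sub`, `.sum`;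
* `isTransposePair_covD` (D ↔ D*, from `sum_covDT_mul`), `isTransposePair_covLap` (Δ_U = D*D symmetric);
* `h388T_of_h388` — (3.88) printed + Δ′_a, G′_□ symmetric + named transposes Pᵗ_□, Cᵗ_□ of the local operators +
  D* the transpose of D ⇒ the transposed (3.88);
* `thm37_entry3_of_342_lattice_of_388` — **Theorem 3.7 ⇒ entry 3 of (3.42) for G′ from the PRINTED (3.88)**: v4's
  `thm37_entry3_of_342_lattice` with `h388T` replaced by `h388` + `hΔ` (Δ′_a symmetric) + `hG` (G′_□ symmetric) +
  `hP`, `hC` (Pᵗ_□, Cᵗ_□ are the transposes of P_□, C_□), the transpose of D certified.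

NOT ASSERTED in this addendum (hypotheses of `thm37_entry3_of_342_lattice_of_388`): everything listed for v4's
`thm37_entry3_of_342_lattice` except `h388T`, now replaced by: (3.88) in the printed shape `h388` (as in v1/v2/v3/v5);
the symmetry of Δ′_a and of every G′_□ for the component pairing (`hΔ`, `hG` — for print's operators a consequence
of their definition by quadratic forms and of G′_□ = (Δ′_a-type operator restricted to □)^{−1}, NOT re-derived here:
the module has no component model of Q′*aQ′ or of the G′_□); the transposes Pᵗ_□ : sites → bonds, Cᵗ_□ of the
local operators of K(h_□) = P_□∘D + C_□ (`hP`, `hC`; for kernel operators these are the kernels read backwards —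
their column-sum sizes κ₁, κ₂ remain the binders of v4, not displayed in print).  Located residual (ii) of cell GAPS
C-pv21g5-3 ("`h388T` is the transposed reading of (3.88)") is thereby REPLACED by the typed symmetry hypotheses
`hΔ`, `hG`.  Value: kernel-checked bookkeeping (finite-dimensional transpose algebra made load-bearing), NOT summit
progress. -/

section TransposeCalculus

variable {Z : Type}

/-- **Transpose pairs for the component pairing** ⟨u, v⟩ = Σ_x u(x)v(x): B is the transpose of A, i.e.
Σ_y (Au)(y)v(y) = Σ_x u(x)(Bv)(x) for all u, v — the model of the L² adjoints of p. 391 (*"The adjoints are taken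
with respect to natural L² scalar products for functions with values in N × N hermitian matrices"*) for
trace-orthonormal real components and equal site/bond weights (cell record D-pv21g5.2 (e)); `IsTransposePair A A`
says A is symmetric. [folklore] -/
def IsTransposePair [Fintype X] [Fintype Y] (A : (X → ℝ) →ₗ[ℝ] (Y → ℝ)) (B : (Y → ℝ) →ₗ[ℝ] (X → ℝ)) : Prop :=
  ∀ (u : X → ℝ) (v : Y → ℝ), ∑ y, A u y * v y = ∑ x, u x * B v x

/-- Transposition is symmetric. [folklore] -/
theorem IsTransposePair.symm [Fintype X] [Fintype Y] {A : (X → ℝ) →ₗ[ℝ] (Y → ℝ)} {B : (Y → ℝ) →ₗ[ℝ] (X → ℝ)}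
    (h : IsTransposePair A B) : IsTransposePair B A := by
  intro v u
  calc ∑ x, B v x * u x = ∑ x, u x * B v x := Finset.sum_congr rfl fun x _ => mul_comm _ _
    _ = ∑ y, A u y * v y := (h u v).symm
    _ = ∑ y, v y * A u y := Finset.sum_congr rfl fun y _ => mul_comm _ _

/-- Replacing the transpose by an equal operator. [folklore] -/
theorem IsTransposePair.congr_right [Fintype X] [Fintype Y] {A : (X → ℝ) →ₗ[ℝ] (Y → ℝ)}
    {B B' : (Y → ℝ) →ₗ[ℝ] (X → ℝ)} (h : IsTransposePair A B) (e : B = B') : IsTransposePair A B' :=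
  e ▸ h

/-- **Uniqueness of the transpose** (the component pairing is nondegenerate on a finite index type). [folklore] -/
theorem IsTransposePair.right_unique [Fintype X] [DecidableEq X] [Fintype Y] {A : (X → ℝ) →ₗ[ℝ] (Y → ℝ)}
    {B B' : (Y → ℝ) →ₗ[ℝ] (X → ℝ)} (h : IsTransposePair A B) (h' : IsTransposePair A B') : B = B' := by
  apply LinearMap.ext
  intro v
  funext x
  have hsingle : ∀ w : X → ℝ, ∑ x', Pi.single (M := fun _ : X => ℝ) x (1 : ℝ) x' * w x' = w x := fun w => by
    rw [Fintype.sum_eq_single x (fun x' hx' => by rw [Pi.single_eq_of_ne hx', zero_mul]), Pi.single_eq_same,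
      one_mul]
  rw [← hsingle (B v), ← hsingle (B' v), ← h, ← h']

/-- The identity is symmetric. [folklore] -/
theorem isTransposePair_one [Fintype X] : IsTransposePair (1 : Module.End ℝ (X → ℝ)) 1 := fun _ _ => rfl

/-- A multiplication operator M_h is symmetric. [folklore] -/
theorem isTransposePair_mulOp [Fintype X] (h : X → ℝ) : IsTransposePair (mulOp h) (mulOp h) :=
  fun u v => Finset.sum_congr rfl fun x _ => by rw [mulOp_apply, mulOp_apply]; ring

/-- (A′A)ᵗ = AᵗA′ᵗ. [folklore] -/
theorem IsTransposePair.comp [Fintype X] [Fintype Y] [Fintype Z] {A : (X → ℝ) →ₗ[ℝ] (Y → ℝ)}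
    {B : (Y → ℝ) →ₗ[ℝ] (X → ℝ)} {A' : (Y → ℝ) →ₗ[ℝ] (Z → ℝ)} {B' : (Z → ℝ) →ₗ[ℝ] (Y → ℝ)}
    (hA : IsTransposePair A B) (hA' : IsTransposePair A' B') : IsTransposePair (A' ∘ₗ A) (B ∘ₗ B') := by
  intro u w
  rw [LinearMap.comp_apply, LinearMap.comp_apply, hA' (A u) w, hA u (B' w)]

/-- (A′A)ᵗ = AᵗA′ᵗ in `Module.End`. [folklore] -/
theorem IsTransposePair.mul [Fintype X] {A A' B B' : Module.End ℝ (X → ℝ)} (hA' : IsTransposePair A' B')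
    (hA : IsTransposePair A B) : IsTransposePair (A' * A) (B * B') :=
  hA.comp hA'

/-- (A + A′)ᵗ = Aᵗ + A′ᵗ. [folklore] -/
theorem IsTransposePair.add [Fintype X] [Fintype Y] {A A' : (X → ℝ) →ₗ[ℝ] (Y → ℝ)}
    {B B' : (Y → ℝ) →ₗ[ℝ] (X → ℝ)} (hA : IsTransposePair A B) (hA' : IsTransposePair A' B') :
    IsTransposePair (A + A') (B + B') := by
  intro u v
  simp only [LinearMap.add_apply, Pi.add_apply, add_mul, mul_add, Finset.sum_add_distrib, hA u v, hA' u v]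

/-- (A − A′)ᵗ = Aᵗ − A′ᵗ. [folklore] -/
theorem IsTransposePair.sub [Fintype X] [Fintype Y] {A A' : (X → ℝ) →ₗ[ℝ] (Y → ℝ)}
    {B B' : (Y → ℝ) →ₗ[ℝ] (X → ℝ)} (hA : IsTransposePair A B) (hA' : IsTransposePair A' B') :
    IsTransposePair (A - A') (B - B') := by
  intro u v
  simp only [LinearMap.sub_apply, Pi.sub_apply, sub_mul, mul_sub, Finset.sum_sub_distrib, hA u v, hA' u v]

/-- (Σ_i A_i)ᵗ = Σ_i A_iᵗ. [folklore] -/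
theorem IsTransposePair.sum [Fintype X] [Fintype Y] {ι : Type} [Fintype ι] {A : ι → (X → ℝ) →ₗ[ℝ] (Y → ℝ)}
    {B : ι → (Y → ℝ) →ₗ[ℝ] (X → ℝ)} (h : ∀ i, IsTransposePair (A i) (B i)) :
    IsTransposePair (∑ i, A i) (∑ i, B i) := by
  intro u v
  calc ∑ y, (∑ i, A i) u y * v y = ∑ y, ∑ i, A i u y * v y := by
          refine Finset.sum_congr rfl fun y _ => ?_
          rw [LinearMap.sum_apply, Finset.sum_apply, Finset.sum_mul]
    _ = ∑ i, ∑ y, A i u y * v y := Finset.sum_comm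
    _ = ∑ i, ∑ x, u x * B i v x := Finset.sum_congr rfl fun i _ => h i u v
    _ = ∑ x, ∑ i, u x * B i v x := Finset.sum_comm
    _ = ∑ x, u x * (∑ i, B i) v x := by
          refine Finset.sum_congr rfl fun x _ => ?_
          rw [LinearMap.sum_apply, Finset.sum_apply, Finset.mul_sum]

variable {St Cp Bd : Type}

/-- **D* = `covDT` is the transpose of D = `covD` for the component pairing** — v4's certificate `sum_covDT_mul`
in the language of transpose pairs ((3.8) is the adjoint of (3.3), p. 392). [cite: Balaban1985BackgroundPropagators, (3.3) p.391 + (3.8) p.392] -/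
theorem isTransposePair_covD [Fintype St] [Fintype Bd] [Fintype Cp] [DecidableEq St] (src tgt : Bd → St)
    (c : Bd → ℝ) (Rm : Bd → Cp → Cp → ℝ) : IsTransposePair (covD src tgt c Rm) (covDT src tgt c Rm) := by
  intro f gb
  calc ∑ q, covD src tgt c Rm f q * gb q = ∑ q, gb q * covD src tgt c Rm f q :=
        Finset.sum_congr rfl fun q _ => mul_comm _ _
    _ = ∑ p, covDT src tgt c Rm gb p * f p := (sum_covDT_mul src tgt c Rm gb f).symm
    _ = ∑ p, f p * covDT src tgt c Rm gb p := Finset.sum_congr rfl fun p _ => mul_comm _ _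

/-- **The covariant Laplace operator Δ_U = D*D of (3.23) is symmetric** for the component pairing (kernel, every
Rm, c). [cite: Balaban1985BackgroundPropagators, (3.23) p.394] -/
theorem isTransposePair_covLap [Fintype St] [Fintype Bd] [Fintype Cp] [DecidableEq St] (src tgt : Bd → St)
    (c : Bd → ℝ) (Rm : Bd → Cp → Cp → ℝ) :
    IsTransposePair (covDT src tgt c Rm ∘ₗ covD src tgt c Rm) (covDT src tgt c Rm ∘ₗ covD src tgt c Rm) :=
  (isTransposePair_covD src tgt c Rm).comp (isTransposePair_covD src tgt c Rm).symm

/-- **(3.88) transposed — DERIVED**: if Δ′_a and the G′_□ are symmetric for the component pairing (print: L²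
adjoints, p. 391; Δ′_a = Δ_U + Q′*aQ′ is defined by the quadratic forms (3.23)–(3.24), p. 394, and is positive,
p. 395: *"Assuming some regularity of the configuration U it can be easily shown that the operator Δ′_a is
positive. This implies positivity of the operators G′, Q′G′²Q′\*, hence the existence of the operator R."*), D* is
the transpose of D and Pᵗ_□, Cᵗ_□ are transposes of the local operators P_□, C_□ of K(h_□) = P_□∘D + C_□, then the
printed identity (3.88) Δ′_aG′₀ = I − Σ_□K(h_□)G′_□h_□ (`h388`, p. 409: *"hence Δ′_aG′₀ = I − Σ_{□∈𝒟} K(h_□)G′_□h_□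
= I − R′"*) implies its transpose G′₀Δ′_a = I − Σ_□h_□G′_□(D*Pᵗ_□ + Cᵗ_□) — the hypothesis `h388T` of v4's
`thm37_rightEntry_of_342`, here obtained by the transpose calculus and the uniqueness of transposes (finite X).
[cite: Balaban1985BackgroundPropagators, (3.88) p.409 + p.391 + (3.23)–(3.24) p.394 + p.395] -/
theorem h388T_of_h388 [Fintype X] [DecidableEq X] [Fintype Y] {ι : Type} [Fintype ι] (h : ι → X → ℝ)
    {Δ : Module.End ℝ (X → ℝ)} {Gsq Cop Ct : ι → Module.End ℝ (X → ℝ)} {D : (X → ℝ) →ₗ[ℝ] (Y → ℝ)}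
    {Dstar : (Y → ℝ) →ₗ[ℝ] (X → ℝ)} {P : ι → (Y → ℝ) →ₗ[ℝ] (X → ℝ)} {Pt : ι → (X → ℝ) →ₗ[ℝ] (Y → ℝ)}
    (hΔ : IsTransposePair Δ Δ) (hG : ∀ i, IsTransposePair (Gsq i) (Gsq i)) (hD : IsTransposePair D Dstar)
    (hP : ∀ i, IsTransposePair (P i) (Pt i)) (hC : ∀ i, IsTransposePair (Cop i) (Ct i))
    (h388 : Δ * (∑ i, mulOp (h i) * Gsq i * mulOp (h i)) =
      1 - ∑ i, (P i ∘ₗ D + Cop i) * Gsq i * mulOp (h i)) :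
    (∑ i, mulOp (h i) * Gsq i * mulOp (h i)) * Δ = 1 - ∑ i, mulOp (h i) * Gsq i * (Dstar ∘ₗ Pt i + Ct i) := by
  have hM : ∀ i, IsTransposePair (mulOp (h i)) (mulOp (h i)) := fun i => isTransposePair_mulOp (h i)
  -- G′₀ = Σ_□ h_□G′_□h_□ is symmetric
  have hS : IsTransposePair (∑ i, mulOp (h i) * Gsq i * mulOp (h i)) (∑ i, mulOp (h i) * Gsq i * mulOp (h i)) := by
    refine (IsTransposePair.sum fun i => ((hM i).mul (hG i)).mul (hM i)).congr_right
      (Finset.sum_congr rfl fun i _ => ?_)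
    rw [mul_assoc]
  -- (Δ′_aG′₀)ᵗ = G′₀Δ′_a and (I − Σ_□K(h_□)G′_□h_□)ᵗ = I − Σ_□h_□G′_□K(h_□)ᵗ, K(h_□)ᵗ = D*Pᵗ_□ + Cᵗ_□
  have h1 : IsTransposePair (Δ * ∑ i, mulOp (h i) * Gsq i * mulOp (h i))
      ((∑ i, mulOp (h i) * Gsq i * mulOp (h i)) * Δ) := hΔ.mul hS
  have h2 : IsTransposePair (1 - ∑ i, (P i ∘ₗ D + Cop i) * Gsq i * mulOp (h i))
      (1 - ∑ i, mulOp (h i) * Gsq i * (Dstar ∘ₗ Pt i + Ct i)) := by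
    refine isTransposePair_one.sub ?_
    refine (IsTransposePair.sum fun i => ((((hD.comp (hP i)).add (hC i)).mul (hG i)).mul (hM i))).congr_right
      (Finset.sum_congr rfl fun i _ => ?_)
    rw [mul_assoc]
  rw [h388] at h1
  exact h1.right_unique h2

/-- **Theorem 3.7 ⇒ entry 3 of (3.42) for G′ = G′(U) from the PRINTED (3.88)** — v4's `thm37_entry3_of_342_lattice`
with its transposed-(3.88) hypothesis `h388T` DERIVED (`h388T_of_h388`) from (3.88) in the printed shape `h388`
(Δ′_aG′₀ = I − Σ_□(P_□∘D + C_□)G′_□h_□, D = `covD …`) and the symmetry of Δ′_a and of the G′_□ for the component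
pairing (`hΔ`, `hG` — print: operators defined by the quadratic forms (3.23)–(3.24) p. 394 and their (restricted)
inverses, L² adjoints p. 391), the transposes Pᵗ_□, Cᵗ_□ of the local operators being NAMED by `hP`, `hC` and the
transpose D* = `covDT …` of D CERTIFIED (`isTransposePair_covD`).  Every other hypothesis is that of
`thm37_entry3_of_342_lattice` (NOT asserted; listed in the v4 and v6 module docstrings).
[cite: Balaban1985BackgroundPropagators, Thm 3.7 (3.88)–(3.90) p.409 + (3.42) p.397 + (3.8) p.392 + p.391; Balaban1984PropagatorsII, Lemma 2.1 p.233] -/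
theorem thm37_entry3_of_342_lattice_of_388 [Fintype St] [DecidableEq St] [Fintype Cp] [DecidableEq Cp]
    [Fintype Bd] [DecidableEq Bd] (blk : St × Cp → g.Site) (blkY : Bd × Cp → g.Site) (src tgt : Bd → St)
    (c : Bd → ℝ) (Rm : Bd → Cp → Cp → ℝ) (d : ℕ) (δ₀ α ρ B₀ κ₁ κ₂ κ₄ Cℓ N N' : ℝ) {ι : Type} [Fintype ι]
    (S S' : ι → Finset g.Site) (hs : ι → St → ℝ) (KP KC KC' : ι → g.Site → g.Site → ℝ)
    {G' Δ : Module.End ℝ (St × Cp → ℝ)}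
    (hB₀ : 0 ≤ B₀) (hδ₀ : 0 ≤ δ₀) (hκ₁ : 0 ≤ κ₁) (hκ₂ : 0 ≤ κ₂) (hκ₄ : 0 ≤ κ₄) (hCℓ : 0 ≤ Cℓ) (hN : 0 ≤ N)
    (hN' : 0 ≤ N') (hαδ : 0 ≤ α * δ₀) (hαδ2 : 0 ≤ (1 - 2 * α) * δ₀)
    (htri : Triangle254 (toB6 g R H)) (hrefl : ∀ y : g.Site, g.dist y y = 0)
    (hsym : ∀ y y' : g.Site, g.dist y y' = g.dist y' y) (hdnn : ∀ y y' : g.Site, 0 ≤ g.dist y y')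
    (hlenpos : ∀ y : g.Site, 0 < g.len y)
    (h261 : Ineq261 d (toB6 g R H) δ₀ α) (h263 : Ineq263 d (toB6 g R H) δ₀ α)
    (hsmall : N' * (B₀ * Real.exp (δ₀ * ρ) * (κ₁ + Cℓ * κ₂)) * B6.c1 d δ₀ α < 1)
    (hh : ∀ i x, |hs i x| ≤ 1) (hS : ∀ i (p : St × Cp), hs i p.1 ≠ 0 → blk p ∈ S i)
    (hcnt : ∀ a : g.Site, (∑ i, if a ∈ S i then (1 : ℝ) else 0) ≤ N)
    (hcnt' : ∀ b : g.Site, (∑ i, if b ∈ S' i then (1 : ℝ) else 0) ≤ N')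
    (hcomp : ∀ i (a b : g.Site), a ∈ S i → b ∈ S' i → g.len a ≤ Cℓ * g.len b)
    (hKP : ∀ i a b, 0 ≤ KP i a b) (hlocP : ∀ i y'' b, KP i y'' b ≠ 0 → g.dist y'' b ≤ ρ)
    (hcolP : ∀ i (b : g.Site), (∑ y'' : g.Site, KP i y'' b) * g.len b ≤ if b ∈ S' i then κ₁ else 0)
    (hKC : ∀ i a b, 0 ≤ KC i a b) (hlocC : ∀ i y'' b, KC i y'' b ≠ 0 → g.dist y'' b ≤ ρ)
    (hcolC : ∀ i (b : g.Site), (∑ y'' : g.Site, KC i y'' b) * g.len b ^ 2 ≤ if b ∈ S' i then κ₂ else 0)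
    (hKC' : ∀ i a b, 0 ≤ KC' i a b) (hlocC' : ∀ i y'' b, KC' i y'' b ≠ 0 → g.dist y'' b ≤ ρ)
    (hcolC' : ∀ i (b : g.Site), (∑ y'' : g.Site, KC' i y'' b) * g.len b ≤ if b ∈ S' i then κ₄ else 0)
    (hdomT : ∀ i (p : St × Cp) (y' : g.Site),
      ∑ b ∈ Finset.univ.filter (fun b => src b = p.1 ∧ blkY (b, p.2) = y'), |c b * (hs i (tgt b) - hs i (src b))| ≤
        KC' i (blk p) y')
    {Gsq Ct : ι → Module.End ℝ (St × Cp → ℝ)} {Pt : ι → (St × Cp → ℝ) →ₗ[ℝ] (Bd × Cp → ℝ)}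
    (h342_1 : ∀ i, HasMajorant (g := toB6 g R H) blk (Gsq i)
      (fun a b => B₀ * g.len a ^ 2 * Real.exp (-(δ₀ * g.dist a b))))
    (h342_3 : ∀ i, HasMajorantHom (g := toB6 g R H) blkY blk (Gsq i ∘ₗ covDT src tgt c Rm)
      (fun a b => B₀ * g.len a * Real.exp (-(δ₀ * g.dist a b))))
    (hPt : ∀ i, HasMajorantHom (g := toB6 g R H) blk blkY (Pt i) (KP i))
    (hCt : ∀ i, HasMajorant (g := toB6 g R H) blk (Ct i) (KC i))
    (hinv : G' * Δ = 1)
    (hΔ : IsTransposePair Δ Δ) (hG : ∀ i, IsTransposePair (Gsq i) (Gsq i))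
    {P : ι → (Bd × Cp → ℝ) →ₗ[ℝ] (St × Cp → ℝ)} {Cop : ι → Module.End ℝ (St × Cp → ℝ)}
    (hP : ∀ i, IsTransposePair (P i) (Pt i)) (hC : ∀ i, IsTransposePair (Cop i) (Ct i))
    (h388 : Δ * (∑ i, mulOp (hs i ∘ Prod.fst) * Gsq i * mulOp (hs i ∘ Prod.fst)) =
      1 - ∑ i, (P i ∘ₗ covD src tgt c Rm + Cop i) * Gsq i * mulOp (hs i ∘ Prod.fst)) :
    HasMajorantHom (g := toB6 g R H) blkY blk (G' ∘ₗ covDT src tgt c Rm)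
      (fun (a b : g.Site) => B₀ * (N + N' * Real.exp (δ₀ * ρ) * Cℓ * κ₄) * B6.c1 d δ₀ α *
        (1 - N' * (B₀ * Real.exp (δ₀ * ρ) * (κ₁ + Cℓ * κ₂)) * B6.c1 d δ₀ α)⁻¹ * g.len a *
        Real.exp (-((1 - 2 * α) * δ₀ * g.dist a b))) :=
  thm37_entry3_of_342_lattice blk blkY src tgt c Rm d δ₀ α ρ B₀ κ₁ κ₂ κ₄ Cℓ N N' S S' hs KP KC KC' hB₀ hδ₀ hκ₁ hκ₂
    hκ₄ hCℓ hN hN' hαδ hαδ2 htri hrefl hsym hdnn hlenpos h261 h263 hsmall hh hS hcnt hcnt' hcomp hKP hlocP hcolP hKC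
    hlocC hcolC hKC' hlocC' hcolC' hdomT h342_1 h342_3 hPt hCt hinv
    (h388T_of_h388 (fun i => hs i ∘ Prod.fst) hΔ hG (isTransposePair_covD src tgt c Rm) hP hC h388)

end TransposeCalculus

/-! ## v7 ADDENDUM — (3.88) in the lattice model: the first equality DERIVED (K(h) concrete in its D-part, the
Q′*aQ′-commutator abstract) and the printed-shape hypothesis `h388` of v2–v6 DISCHARGED (cell record D-pv21g5.5)

p. 408 (verbatim): *"We take the partition of unity {h_□} defined at the end of Sect. A in [4]. We have
Σ_{□∈𝒟} h²_□ = 1."*; p. 409 (verbatim, BOTH display lines of (3.88)): *"G′₀ = Σ_{□∈𝒟} h_□G′_□h_□, C₀ = Σ_{□∈𝒟}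
h_□C_□h_□, G₀ = Σ_{□∈𝒟} h_□G_□h_□. (3.87) As in [4] we have to express the operators Δ′_aG′₀, (Q′G′²Q′)C₀, Δ_aG₀ as
small perturbations of identity. Let us start with the operator Δ′_aG′₀. Using (3.50) we get for x∈Δ(y), y∈Λ_j,
(Δ′_ahλ)(x) = h(x)(Δ′_aλ)(x) − Σ_{b∈st(x)}(∂h)(b)(Dλ)(b) + (Δh)(x)λ(x) + a_j(L^jη)^{−2} Σ_{x′∈B^j(y)}
L^{−jd}(∂h)(Γ^{(j)}_{x,y} ∪ Γ^{(j)}_{y,x′})R((U(Γ^{(j)}_{y,x}))^{−1}R(U(Γ^{(j)}_{y,x′}))λ(x′) = h(x)(Δ′_aλ)(x) −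
(K(h)λ)(x), (3.88) hence Δ′_aG′₀ = I − Σ_□K(h_□)G′_□h_□ = I − R′."*; [4] p. 230 (verbatim): *"(K(h_□)G′(□)h_□λ)(L^jηx)
= Σ_{b∈st(x)}(∂^{L^{−j}}h_□)(b)(∂^{L^{−j}}G′(□)h_□λ)(b) − (Δ^{L^{−j}}h_□)(x)(G′(□)h_□λ)(x) − a_j Σ_{x′∈B^j(y^j(x))}
L^{−jd}(∂^{L^{−j}}h_□)(Γ^{(j)}_{x,y^j(x),x′})(G′(□)h_□λ)(x′) if x ∈ B^j(Λ_j) ⊂ T_{L^{−j}}, (2.40)"*.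

THE POINT.  Since v1 the identity "Δ′_aG′₀ = I − Σ_□K(h_□)G′_□h_□" entered the B9Thm37Glue line as the HYPOTHESIS
`h388` with ABSTRACT local operators K(h_□) = P_□∘D + C_□.  In the lattice model of v3–v6 (D = `covD`, D* = `covDT`,
Δ_U = D*D of (3.23)) the commutator of Δ′_a = Δ_U + Q′*aQ′ with M_{h_□} is COMPUTABLE up to the averaging part:
`covLapQ_mul_mulOp` — for Δ′_a := D*D + Q with Q an ABSTRACT site operator (the module has no component model of
the block averages Q′_j(U) of (3.24)), Δ′_a∘M_h = M_h∘Δ′_a − K(h) with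
K(h) = (leibRemT h)∘D + (−D*∘(leibRem h) + (M_hQ − QM_h)): the D-part is v5's kernel second-order Leibniz rule
`covLap_comp_mulOp` (print's first display line: the ∂h·D term and the Δh term, grouped by the module's bond
orientation), the Q-part is the commutator [M_h, Q] — print's SECOND display line of (3.88) (the term with the
block paths Γ^{(j)}; [4] (2.40) third term), which does NOT vanish for the smooth profiles h_□ of (1.118)/(2.36)
and is kept abstract here.  Then `h388_lattice`: with the LOCAL INVERSE property h_□Δ′_aG′_□h_□ = h²_□ of the cube
propagators (`hloc`, the reading of `B9Thm37Sum.eq388_sum`) and Σ_□h²_□ = 1 (`hsq`), the ring identity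
`B9Thm37Sum.eq388_sum` gives Δ′_aG′₀ = I − Σ_□(P_□∘D + C_□)G′_□h_□ with the CONCRETE P_□ = leibRemT h_□,
C_□ = −D*∘leibRem h_□ + [M_{h_□}, Q] — exactly the `h388` of v3/v5/v6.  The corollaries
`thm37_entry4_of_342_lattice_of_387` and `thm37_entry2_of_342_lattice_of_387` feed it into v5's entry-4 and v3's
entry-2 theorems: the majorant of P_□ comes from `leibRemT_majorant` (`hdomT`), that of −D*∘leibRem h_□ from
`covDT_leibRem_majorant` (`hdomL`) and `hasMajorantHom_neg`, that of [M_{h_□}, Q] is a HYPOTHESIS (`hQ` with kernel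
K_Q: `hKQ`, `hlocQ`, `hrowQ`); kernels add (`hasMajorantHom_add`, `rowSum_add_le`).  Bonus: `isTransposePair_leibRemT`
— leibRem h is the transpose of leibRemT h (the datum `hP` of v6's `thm37_entry3_of_342_lattice_of_388` for the
concrete P_□; the entry-3 analogue additionally needs the transpose of C_□ and is not typed here).

* `covLapQ_mul_mulOp` — (3.88) first equality in the lattice model (kernel; Q abstract);
* `h388_lattice` — "hence Δ′_aG′₀ = I − Σ_□K(h_□)G′_□h_□" from the local inverse + Σh²_□ = 1 (via `eq388_sum`);
* `isTransposePair_leibRemT` (kernel); `rowSum_add_le` (bookkeeping);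
* `thm37_entry4_of_342_lattice_of_387` — **Theorem 3.7 ⇒ entry 4 of (3.42) for G′ with (3.88) DERIVED**;
* `thm37_entry2_of_342_lattice_of_387` — **Theorem 3.7 ⇒ entry 2 of (3.42) for G′ with (3.88) DERIVED**.

NOT ASSERTED in this addendum (hypotheses of the two corollaries): Corollary 3.6 entries 1, 2 (, 4) for the G′_□
(`h342_1`, `h342_2`, `h342_4`); the LOCAL INVERSE property `hloc` : M_{h_□}Δ′_aG′_□M_{h_□} = M²_{h_□} (print: G′_□ is the
propagator of the local sequence {Ω_n(□)}, p. 409, and Δ′_a is local — NOT re-derived: no component model of the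
G′_□); Σ_□h_□(x)² = 1 (`hsq`, p. 408 / [4] (2.36)); G′Δ′_a = I (`hinv`) for Δ′_a = D*D + Q; the averaging part Q of
Δ′_a ABSTRACT with the block majorant K_Q of its commutators [M_{h_□}, Q] a HYPOTHESIS (`hQ`, `hKQ`, `hlocQ`, `hrowQ`;
print: second display line of (3.88), size O(M^{−1})(L^jη)^{−2} within the blocks B^j(y) — the SIZE is not
re-derived); the kernel bounds `hdomT` (κ₁ resp. κ₃), `hdomL` (κ₂ resp. κ₄), `hdh` (κ₄, entry 2) of ∂h_□ — the sizes
O((ML^jη)^{−1}), O((ML^jη)^{−2}) of ∂h_□, Δh_□ are implicit in (1.118)/(2.36) and NOT displayed in print (cell GAPS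
G-pv21g4-1 (i)); v7.1 DOCFIX D1 (cell GAPS G-pv21g6-1): the row sums κ₂, κ₄ obtainable through `hdomL` are O(L^j/M),
NOT uniformly small in the scale j (non-cancelling first summand), so the located smallness below is not inhabitable
along print's sizes in THIS grouping — the printed grouping over st(x), with uniform sizes, is the sibling leaf
`B9Thm37GlueSt`;
partition data S_□, S′_□, N, N′, |h_□| ≦ 1; Lemma 2.1 of [4] (`h261`, `h263`); geometry; the located smallness
N′B₀e^{δ₀ρ}(κ_P + κ_C + κ_Q)c₁(α) < 1 ("for M sufficiently large").  What is NEW relative to v2–v6: `h388` is no longer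
a hypothesis — it is the kernel consequence of (3.87), the local inverse property, Σh²_□ = 1 and the DEFINITION of
K(h_□) as the commutator, whose D-part is computed.  Value: kernel-checked bookkeeping, NOT summit progress. -/

section Lattice388

variable {St Cp Bd : Type}

/-- **(3.88), first equality, in the lattice model** — Δ′_a∘M_h = M_h∘Δ′_a − K(h) for Δ′_a = D*D + Q (D = `covD`,
D* = `covDT`, Q = the averaging part Q′*aQ′ of (3.24), ABSTRACT) and a scalar lattice function h, with
K(h) = (leibRemT h)∘D + (−D*∘(leibRem h) + [M_h, Q]): the D-part is the kernel second-order Leibniz rule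
`covLap_comp_mulOp` (v5) — print's first display line of (3.88), p. 409 (verbatim): *"Using (3.50) we get for
x∈Δ(y), y∈Λ_j, (Δ′_ahλ)(x) = h(x)(Δ′_aλ)(x) − Σ_{b∈st(x)}(∂h)(b)(Dλ)(b) + (Δh)(x)λ(x)"* — and the Q-part is the
commutator M_hQ − QM_h, print's second display line of (3.88) (verbatim): *"+ a_j(L^jη)^{−2} Σ_{x′∈B^j(y)}
L^{−jd}(∂h)(Γ^{(j)}_{x,y} ∪ Γ^{(j)}_{y,x′})R((U(Γ^{(j)}_{y,x}))^{−1}R(U(Γ^{(j)}_{y,x′}))λ(x′) = h(x)(Δ′_aλ)(x) −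
(K(h)λ)(x), (3.88)"*, kept ABSTRACT (the module has no component model of Q′*aQ′).  An algebraic identity in
`Module.End` (every c, Rm, Q, h). [cite: Balaban1985BackgroundPropagators, (3.88) p.409 + (3.23)–(3.24) p.394; Balaban1984PropagatorsII, (2.39)–(2.40) pp.229–230] -/
theorem covLapQ_mul_mulOp [Fintype Bd] [Fintype Cp] [DecidableEq St] (src tgt : Bd → St) (c : Bd → ℝ)
    (Rm : Bd → Cp → Cp → ℝ) (Qf : Module.End ℝ (St × Cp → ℝ)) (h : St → ℝ) :
    (covDT src tgt c Rm ∘ₗ covD src tgt c Rm + Qf) * mulOp (h ∘ Prod.fst) =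
      mulOp (h ∘ Prod.fst) * (covDT src tgt c Rm ∘ₗ covD src tgt c Rm + Qf) -
        (leibRemT src tgt c h ∘ₗ covD src tgt c Rm +
          (-(covDT src tgt c Rm ∘ₗ leibRem src tgt c h) + (mulOp (h ∘ Prod.fst) * Qf - Qf * mulOp (h ∘ Prod.fst)))) := by
  have h5 := covLap_comp_mulOp src tgt c Rm h
  rw [LinearMap.neg_comp] at h5
  simp only [Module.End.mul_eq_comp, LinearMap.add_comp, LinearMap.comp_add]
  rw [h5]
  abel

/-- **"hence Δ′_aG′₀ = I − Σ_{□∈𝒟} K(h_□)G′_□h_□"** ((3.88), p. 409) **in the lattice model, DERIVED** — from the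
first equality of (3.88) cube by cube (`covLapQ_mul_mulOp`), the LOCAL INVERSE property h_□Δ′_aG′_□h_□ = h²_□ of
the cube propagators G′_□ (hypothesis `hloc`, the reading of `B9Thm37Sum.eq388_sum`) and the partition of unity
Σ_□h²_□ = 1 (p. 408: *"We take the partition of unity {h_□} defined at the end of Sect. A in [4]. We have
Σ_{□∈𝒟} h²_□ = 1."*, hypothesis `hsq`; `B9Thm37Sum.sum_mulOp_sq`), by the ring identity `B9Thm37Sum.eq388_sum`.
This is the hypothesis `h388` of `thm37_entry2_of_342_lattice` (v3) / `thm37_entry4_of_342_lattice` (v5) /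
`thm37_entry3_of_342_lattice_of_388` (v6) with its local operators made CONCRETE: P_□ = leibRemT h_□ (kernel ∂h_□),
C_□ = −D*∘leibRem h_□ + [M_{h_□}, Q]. [cite: Balaban1985BackgroundPropagators, (3.87)–(3.88) pp.408–409] -/
theorem h388_lattice [Fintype Bd] [Fintype Cp] [DecidableEq St] {ι : Type} [Fintype ι] (src tgt : Bd → St)
    (c : Bd → ℝ) (Rm : Bd → Cp → Cp → ℝ) (Qf : Module.End ℝ (St × Cp → ℝ)) (hs : ι → St → ℝ)
    (Gsq : ι → Module.End ℝ (St × Cp → ℝ)) (hsq : ∀ x : St, ∑ i, hs i x ^ 2 = 1)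
    (hloc : ∀ i, mulOp (hs i ∘ Prod.fst) * (covDT src tgt c Rm ∘ₗ covD src tgt c Rm + Qf) * Gsq i *
      mulOp (hs i ∘ Prod.fst) = mulOp (hs i ∘ Prod.fst) * mulOp (hs i ∘ Prod.fst)) :
    (covDT src tgt c Rm ∘ₗ covD src tgt c Rm + Qf) * (∑ i, mulOp (hs i ∘ Prod.fst) * Gsq i * mulOp (hs i ∘ Prod.fst)) =
      1 - ∑ i, (leibRemT src tgt c (hs i) ∘ₗ covD src tgt c Rm +
        (-(covDT src tgt c Rm ∘ₗ leibRem src tgt c (hs i)) +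
          (mulOp (hs i ∘ Prod.fst) * Qf - Qf * mulOp (hs i ∘ Prod.fst)))) * Gsq i * mulOp (hs i ∘ Prod.fst) :=
  eq388_sum (A := Module.End ℝ (St × Cp → ℝ)) (covDT src tgt c Rm ∘ₗ covD src tgt c Rm + Qf)
    (fun i => mulOp (hs i ∘ Prod.fst)) Gsq
    (fun i => leibRemT src tgt c (hs i) ∘ₗ covD src tgt c Rm +
      (-(covDT src tgt c Rm ∘ₗ leibRem src tgt c (hs i)) + (mulOp (hs i ∘ Prod.fst) * Qf - Qf * mulOp (hs i ∘ Prod.fst))))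
    (fun i => covLapQ_mul_mulOp src tgt c Rm Qf (hs i)) hloc
    (sum_mulOp_sq (fun i => hs i ∘ Prod.fst) fun p => hsq p.1)

/-- **leibRem h is the transpose of leibRemT h** for the component pairing (the ∂h-kernel read in both
directions; kernel, every c, h) — the datum `hP` of `thm37_entry3_of_342_lattice_of_388` (v6) for the concrete
P_□ = leibRemT h_□. [folklore] -/
theorem isTransposePair_leibRemT [Fintype St] [Fintype Bd] [Fintype Cp] [DecidableEq St] (src tgt : Bd → St)
    (c : Bd → ℝ) (h : St → ℝ) :
    IsTransposePair (leibRemT (Cp := Cp) src tgt c h) (leibRem src tgt c h) := by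
  intro u v
  calc ∑ p, leibRemT (Cp := Cp) src tgt c h u p * v p
        = ∑ p : St × Cp, ∑ b, (if src b = p.1 then c b * (h (tgt b) - h (src b)) else 0) * u (b, p.2) * v p := by
          refine Finset.sum_congr rfl fun p _ => ?_
          rw [leibRemT_apply, Finset.sum_mul]
    _ = ∑ b, ∑ p : St × Cp, (if src b = p.1 then c b * (h (tgt b) - h (src b)) else 0) * u (b, p.2) * v p :=
          Finset.sum_comm
    _ = ∑ b, ∑ i : Cp, c b * (h (tgt b) - h (src b)) * u (b, i) * v (src b, i) := by
          refine Finset.sum_congr rfl fun b _ => ?_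
          rw [Fintype.sum_prod_type, Finset.sum_comm]
          refine Finset.sum_congr rfl fun i _ => ?_
          rw [Finset.sum_eq_single (src b)]
          · simp
          · intro x _ hx
            rw [if_neg (Ne.symm hx), zero_mul, zero_mul]
          · intro hx
            exact absurd (Finset.mem_univ _) hx
    _ = ∑ q : Bd × Cp, u q * leibRem src tgt c h v q := by
          rw [Fintype.sum_prod_type]
          refine Finset.sum_congr rfl fun b _ => Finset.sum_congr rfl fun i _ => ?_
          rw [leibRem_apply]
          ring

/-- Row sums of a sum of two kernels against a weight, each bounded on S′ and vanishing off S′. [folklore] -/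
theorem rowSum_add_le {K₁ K₂ : g.Site → g.Site → ℝ} {w : g.Site → ℝ} {s₁ s₂ : ℝ} {S' : Finset g.Site}
    (a : g.Site) (h₁ : ∑ y, K₁ a y * w y ≤ if a ∈ S' then s₁ else 0)
    (h₂ : ∑ y, K₂ a y * w y ≤ if a ∈ S' then s₂ else 0) :
    ∑ y, (K₁ a y + K₂ a y) * w y ≤ if a ∈ S' then s₁ + s₂ else 0 := by
  have hsplit : ∑ y, (K₁ a y + K₂ a y) * w y = ∑ y, K₁ a y * w y + ∑ y, K₂ a y * w y := by
    rw [← Finset.sum_add_distrib]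
    exact Finset.sum_congr rfl fun y _ => add_mul _ _ _
  rw [hsplit]
  refine (add_le_add h₁ h₂).trans (le_of_eq ?_)
  split_ifs <;> ring

/-- **Theorem 3.7 ⇒ entry 4 of (3.42) for G′ = G′(U) with (3.88) DERIVED** — `thm37_entry4_of_342_lattice` (v5) with
its printed-shape hypothesis `h388` DISCHARGED by `h388_lattice`: Δ′_a = D*D + Q (Q = Q′*aQ′ of (3.24), abstract),
K(h_□) CONCRETE in its D-part (P_□ = leibRemT h_□ with the kernel bound `hdomT` already present in v5,
C_□ ⊇ −D*∘leibRem h_□ with `hdomL`) and the Q-commutator [M_{h_□}, Q] (second display line of (3.88)) carrying its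
own block majorant K_Q (`hQ`, `hKQ`, `hlocQ`, `hrowQ`: row sums ≦ κ_Q1_{S′_□} against (L^{j″}η)²; print: size
O(M^{−1})(L^jη)^{−2} within blocks, NOT re-derived).  Remaining print inputs: Corollary 3.6 entries 1, 2, 4 for the
G′_□ (`h342_1`, `h342_2`, `h342_4`), the LOCAL INVERSE property h_□Δ′_aG′_□h_□ = h²_□ (`hloc`), Σ_□h²_□ = 1 (`hsq`),
G′Δ′_a = I (`hinv`), the kernel bounds `hdomT`, `hdomL` of ∂h_□ (sizes κ₃, κ₄ — NOT displayed in print), Lemma 2.1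
of [4], the counts N, N′ and the located smallness N′B₀e^{δ₀ρ}(κ₃ + κ₄ + κ_Q)c₁(α) < 1.
[cite: Balaban1985BackgroundPropagators, Thm 3.7 (3.87)–(3.90) pp.408–410 + (3.42) p.397 + (3.23)–(3.24) p.394; Balaban1984PropagatorsII, Prop 2.2 (2.67) p.234] -/
theorem thm37_entry4_of_342_lattice_of_387 [Fintype St] [DecidableEq St] [Fintype Cp] [DecidableEq Cp] [Fintype Bd]
    (blk : St × Cp → g.Site) (blkY : Bd × Cp → g.Site) (src tgt : Bd → St) (c : Bd → ℝ)
    (Rm : Bd → Cp → Cp → ℝ) (Qf : Module.End ℝ (St × Cp → ℝ)) (d : ℕ) (δ₀ α ρ B₀ κ₃ κ₄ κQ N N' : ℝ) {ι : Type}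
    [Fintype ι] (S S' : ι → Finset g.Site) (hs : ι → St → ℝ) (KP' KC' KQ : ι → g.Site → g.Site → ℝ)
    {G' : Module.End ℝ (St × Cp → ℝ)}
    (hB₀ : 0 ≤ B₀) (hδ₀ : 0 ≤ δ₀) (hκ' : 0 ≤ κ₃ + κ₄) (hκQ : 0 ≤ κQ) (hN : 0 ≤ N) (hN' : 0 ≤ N')
    (hαδ : 0 ≤ (1 - α) * δ₀)
    (htri : Triangle254 (toB6 g R H)) (hrefl : ∀ y : g.Site, g.dist y y = 0)
    (hdnn : ∀ y y' : g.Site, 0 ≤ g.dist y y') (hlen : ∀ y : g.Site, 0 ≤ g.len y)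
    (h261 : Ineq261 d (toB6 g R H) δ₀ α) (h263 : Ineq263 d (toB6 g R H) δ₀ α)
    (hsmall : N' * (B₀ * Real.exp (δ₀ * ρ) * (κ₃ + (κ₄ + κQ))) * B6.c1 d δ₀ α < 1)
    (hh : ∀ i x, |hs i x| ≤ 1) (hS : ∀ i (p : St × Cp), hs i p.1 ≠ 0 → blk p ∈ S i)
    (hcnt : ∀ a : g.Site, (∑ i, if a ∈ S i then (1 : ℝ) else 0) ≤ N)
    (hcnt' : ∀ a : g.Site, (∑ i, if a ∈ S' i then (1 : ℝ) else 0) ≤ N')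
    (hKP' : ∀ i a b, 0 ≤ KP' i a b) (hlocP' : ∀ i a y'', KP' i a y'' ≠ 0 → g.dist a y'' ≤ ρ)
    (hrowP' : ∀ i (a : g.Site), ∑ y'' : g.Site, KP' i a y'' * g.len y'' ≤ if a ∈ S' i then κ₃ else 0)
    (hKC' : ∀ i a b, 0 ≤ KC' i a b) (hlocC' : ∀ i a y'', KC' i a y'' ≠ 0 → g.dist a y'' ≤ ρ)
    (hrowC' : ∀ i (a : g.Site), ∑ y'' : g.Site, KC' i a y'' * g.len y'' ^ 2 ≤ if a ∈ S' i then κ₄ else 0)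
    (hKQ : ∀ i a b, 0 ≤ KQ i a b) (hlocQ : ∀ i a y'', KQ i a y'' ≠ 0 → g.dist a y'' ≤ ρ)
    (hrowQ : ∀ i (a : g.Site), ∑ y'' : g.Site, KQ i a y'' * g.len y'' ^ 2 ≤ if a ∈ S' i then κQ else 0)
    (hdomT : ∀ i (p : St × Cp) (y' : g.Site),
      ∑ b ∈ Finset.univ.filter (fun b => src b = p.1 ∧ blkY (b, p.2) = y'),
        |c b * (hs i (tgt b) - hs i (src b))| ≤ KP' i (blk p) y')
    (hdomL : ∀ i (p : St × Cp) (y' : g.Site),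
      (∑ b ∈ Finset.univ.filter (fun b => tgt b = p.1),
          ∑ k ∈ Finset.univ.filter (fun k => blk (src b, k) = y'),
            |c b * (c b * (hs i (tgt b) - hs i (src b))) * Rm b k p.2|) +
        (if blk p = y' then
          |∑ b ∈ Finset.univ.filter (fun b => src b = p.1), c b * (c b * (hs i (tgt b) - hs i (src b)))| else 0) ≤
        KC' i (blk p) y')
    (hsq : ∀ x : St, ∑ i, hs i x ^ 2 = 1)
    {Gsq : ι → Module.End ℝ (St × Cp → ℝ)}
    (h342_1 : ∀ i, HasMajorant (g := toB6 g R H) blk (Gsq i)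
      (fun a b => B₀ * g.len a ^ 2 * Real.exp (-(δ₀ * g.dist a b))))
    (h342_2 : ∀ i, HasMajorantHom (g := toB6 g R H) blk blkY (covD src tgt c Rm ∘ₗ Gsq i)
      (fun a b => B₀ * g.len a * Real.exp (-(δ₀ * g.dist a b))))
    (h342_4 : ∀ i, HasMajorantHom (g := toB6 g R H) blk blk ((covDT src tgt c Rm ∘ₗ covD src tgt c Rm) ∘ₗ Gsq i)
      (fun a b => B₀ * Real.exp (-(δ₀ * g.dist a b))))
    (hQ : ∀ i, HasMajorant (g := toB6 g R H) blk (mulOp (hs i ∘ Prod.fst) * Qf - Qf * mulOp (hs i ∘ Prod.fst)) (KQ i))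
    (hloc : ∀ i, mulOp (hs i ∘ Prod.fst) * (covDT src tgt c Rm ∘ₗ covD src tgt c Rm + Qf) * Gsq i *
      mulOp (hs i ∘ Prod.fst) = mulOp (hs i ∘ Prod.fst) * mulOp (hs i ∘ Prod.fst))
    (hinv : G' * (covDT src tgt c Rm ∘ₗ covD src tgt c Rm + Qf) = 1) :
    HasMajorantHom (g := toB6 g R H) blk blk ((covDT src tgt c Rm ∘ₗ covD src tgt c Rm) ∘ₗ G')
      (fun (a b : g.Site) => B₀ * (N + N' * Real.exp (δ₀ * ρ) * (κ₃ + κ₄)) * B6.c1 d δ₀ α *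
        (1 - N' * (B₀ * Real.exp (δ₀ * ρ) * (κ₃ + (κ₄ + κQ))) * B6.c1 d δ₀ α)⁻¹ *
        Real.exp (-((1 - α) * δ₀ * g.dist a b))) := by
  have hP : ∀ i, HasMajorantHom (g := toB6 g R H) blkY blk (leibRemT src tgt c (hs i)) (KP' i) :=
    fun i => leibRemT_majorant blk blkY src tgt c (hs i) (KP' i) (hdomT i)
  have hC : ∀ i, HasMajorant (g := toB6 g R H) blk
      (-(covDT src tgt c Rm ∘ₗ leibRem src tgt c (hs i)) + (mulOp (hs i ∘ Prod.fst) * Qf - Qf * mulOp (hs i ∘ Prod.fst)))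
      (fun a b => KC' i a b + KQ i a b) := fun i =>
    (hasMajorantHom_iff (g := toB6 g R H) blk _ _).mp
      (hasMajorantHom_add (g := toB6 g R H) blk blk
        (hasMajorantHom_neg blk blk (covDT_leibRem_majorant blk src tgt c Rm (hs i) (KC' i) (hdomL i)))
        ((hasMajorantHom_iff (g := toB6 g R H) blk _ _).mpr (hQ i)))
  have hKC : ∀ i a b, 0 ≤ KC' i a b + KQ i a b := fun i a b => add_nonneg (hKC' i a b) (hKQ i a b)
  have hlocC : ∀ i a y'', KC' i a y'' + KQ i a y'' ≠ 0 → g.dist a y'' ≤ ρ := fun i a y'' hne => by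
    by_cases h1 : KC' i a y'' = 0
    · rw [h1, zero_add] at hne
      exact hlocQ i a y'' hne
    · exact hlocC' i a y'' h1
  have hrowC : ∀ i (a : g.Site), ∑ y'' : g.Site, (KC' i a y'' + KQ i a y'') * g.len y'' ^ 2 ≤
      if a ∈ S' i then κ₄ + κQ else 0 := fun i a => rowSum_add_le a (hrowC' i a) (hrowQ i a)
  have hκ : 0 ≤ κ₃ + (κ₄ + κQ) := by linarith
  exact thm37_entry4_of_342_lattice (P := fun i => leibRemT src tgt c (hs i))
    (Cop := fun i => -(covDT src tgt c Rm ∘ₗ leibRem src tgt c (hs i)) +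
      (mulOp (hs i ∘ Prod.fst) * Qf - Qf * mulOp (hs i ∘ Prod.fst)))
    blk blkY src tgt c Rm d δ₀ α ρ B₀ κ₃ (κ₄ + κQ) κ₃ κ₄ N N' S S' hs KP' (fun i a b => KC' i a b + KQ i a b) KP' KC'
    hB₀ hδ₀ hκ hκ' hN hN' hαδ htri hrefl hdnn hlen h261 h263 hsmall hh hS hcnt hcnt' hKP' hlocP' hrowP' hKC hlocC hrowC
    hKP' hlocP' hrowP' hKC' hlocC' hrowC' hdomT hdomL h342_1 h342_2 h342_4 hP hC hinv
    (h388_lattice src tgt c Rm Qf hs Gsq hsq hloc)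

/-- **Theorem 3.7 ⇒ entry 2 of (3.42) for G′ = G′(U) with (3.88) DERIVED** — `thm37_entry2_of_342_lattice` (v3) with
`h388` DISCHARGED by `h388_lattice` (Δ′_a = D*D + Q, Q abstract; P_□ = leibRemT h_□ with kernel bound `hdomT`
(κ₁), C_□ = −D*∘leibRem h_□ + [M_{h_□}, Q] with kernel bounds `hdomL` (κ₂) and `hQ` (κ_Q); local inverse `hloc`,
Σ_□h²_□ = 1 `hsq`); every other input as in v3 (Cor. 3.6 entries 1, 2 for the G′_□, `hdh` (κ₄) for the Leibniz
remainder of D through M_{h_□}, Lemma 2.1 of [4], counts, located smallness N′B₀e^{δ₀ρ}(κ₁ + κ₂ + κ_Q)c₁(α) < 1).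
[cite: Balaban1985BackgroundPropagators, Thm 3.7 (3.87)–(3.90) pp.408–410 + (3.42) p.397 + (3.3) pp.390–391; Balaban1984PropagatorsII, Prop 2.2 (2.67) p.234] -/
theorem thm37_entry2_of_342_lattice_of_387 [Fintype St] [DecidableEq St] [Fintype Bd] [DecidableEq Bd] [Fintype Cp]
    [DecidableEq Cp]
    (src tgt : Bd → St) (c : Bd → ℝ) (Rm : Bd → Cp → Cp → ℝ) (Qf : Module.End ℝ (St × Cp → ℝ))
    (blk : St × Cp → g.Site) (blkY : Bd × Cp → g.Site) (d : ℕ) (δ₀ α ρ B₀ κ₁ κ₂ κQ κ₄ N N' : ℝ) {ι : Type}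
    [Fintype ι] (S S' : ι → Finset g.Site) (hs : ι → St → ℝ) (KP KL KQ KC' : ι → g.Site → g.Site → ℝ)
    {G' : Module.End ℝ (St × Cp → ℝ)}
    (hB₀ : 0 ≤ B₀) (hδ₀ : 0 ≤ δ₀) (hκ : 0 ≤ κ₁ + κ₂) (hκQ : 0 ≤ κQ) (hκ₄ : 0 ≤ κ₄) (hN : 0 ≤ N) (hN' : 0 ≤ N')
    (hαδ : 0 ≤ (1 - α) * δ₀)
    (htri : Triangle254 (toB6 g R H)) (hrefl : ∀ y : g.Site, g.dist y y = 0)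
    (hdnn : ∀ y y' : g.Site, 0 ≤ g.dist y y') (hlen : ∀ y : g.Site, 0 ≤ g.len y)
    (h261 : Ineq261 d (toB6 g R H) δ₀ α) (h263 : Ineq263 d (toB6 g R H) δ₀ α)
    (hsmall : N' * (B₀ * Real.exp (δ₀ * ρ) * (κ₁ + (κ₂ + κQ))) * B6.c1 d δ₀ α < 1)
    (hh : ∀ i x, |hs i x| ≤ 1) (hSY : ∀ i (v : Bd × Cp), hs i (tgt v.1) ≠ 0 → blkY v ∈ S i)
    (hcnt : ∀ a : g.Site, (∑ i, if a ∈ S i then (1 : ℝ) else 0) ≤ N)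
    (hcnt' : ∀ a : g.Site, (∑ i, if a ∈ S' i then (1 : ℝ) else 0) ≤ N')
    (hKP : ∀ i a b, 0 ≤ KP i a b) (hlocP : ∀ i a y'', KP i a y'' ≠ 0 → g.dist a y'' ≤ ρ)
    (hrowP : ∀ i (a : g.Site), ∑ y'' : g.Site, KP i a y'' * g.len y'' ≤ if a ∈ S' i then κ₁ else 0)
    (hKL : ∀ i a b, 0 ≤ KL i a b) (hlocL : ∀ i a y'', KL i a y'' ≠ 0 → g.dist a y'' ≤ ρ)
    (hrowL : ∀ i (a : g.Site), ∑ y'' : g.Site, KL i a y'' * g.len y'' ^ 2 ≤ if a ∈ S' i then κ₂ else 0)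
    (hKQ : ∀ i a b, 0 ≤ KQ i a b) (hlocQ : ∀ i a y'', KQ i a y'' ≠ 0 → g.dist a y'' ≤ ρ)
    (hrowQ : ∀ i (a : g.Site), ∑ y'' : g.Site, KQ i a y'' * g.len y'' ^ 2 ≤ if a ∈ S' i then κQ else 0)
    (hKC' : ∀ i a b, 0 ≤ KC' i a b) (hlocC' : ∀ i a y'', KC' i a y'' ≠ 0 → g.dist a y'' ≤ ρ)
    (hrowC' : ∀ i (a : g.Site), ∑ y'' : g.Site, KC' i a y'' * g.len y'' ^ 2 ≤
      if a ∈ S' i then κ₄ * g.len a else 0)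
    (hdh : ∀ i (v : Bd × Cp), |c v.1 * (hs i (tgt v.1) - hs i (src v.1))| ≤ KC' i (blkY v) (blk (src v.1, v.2)))
    (hdomT : ∀ i (p : St × Cp) (y' : g.Site),
      ∑ b ∈ Finset.univ.filter (fun b => src b = p.1 ∧ blkY (b, p.2) = y'),
        |c b * (hs i (tgt b) - hs i (src b))| ≤ KP i (blk p) y')
    (hdomL : ∀ i (p : St × Cp) (y' : g.Site),
      (∑ b ∈ Finset.univ.filter (fun b => tgt b = p.1),
          ∑ k ∈ Finset.univ.filter (fun k => blk (src b, k) = y'),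
            |c b * (c b * (hs i (tgt b) - hs i (src b))) * Rm b k p.2|) +
        (if blk p = y' then
          |∑ b ∈ Finset.univ.filter (fun b => src b = p.1), c b * (c b * (hs i (tgt b) - hs i (src b)))| else 0) ≤
        KL i (blk p) y')
    (hsq : ∀ x : St, ∑ i, hs i x ^ 2 = 1)
    {Gsq : ι → Module.End ℝ (St × Cp → ℝ)}
    (h342_1 : ∀ i, HasMajorant (g := toB6 g R H) blk (Gsq i)
      (fun a b => B₀ * g.len a ^ 2 * Real.exp (-(δ₀ * g.dist a b))))
    (h342_2 : ∀ i, HasMajorantHom (g := toB6 g R H) blk blkY (covD src tgt c Rm ∘ₗ Gsq i)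
      (fun a b => B₀ * g.len a * Real.exp (-(δ₀ * g.dist a b))))
    (hQ : ∀ i, HasMajorant (g := toB6 g R H) blk (mulOp (hs i ∘ Prod.fst) * Qf - Qf * mulOp (hs i ∘ Prod.fst)) (KQ i))
    (hloc : ∀ i, mulOp (hs i ∘ Prod.fst) * (covDT src tgt c Rm ∘ₗ covD src tgt c Rm + Qf) * Gsq i *
      mulOp (hs i ∘ Prod.fst) = mulOp (hs i ∘ Prod.fst) * mulOp (hs i ∘ Prod.fst))
    (hinv : G' * (covDT src tgt c Rm ∘ₗ covD src tgt c Rm + Qf) = 1) :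
    HasMajorantHom (g := toB6 g R H) blk blkY (covD src tgt c Rm ∘ₗ G')
      (fun (a b : g.Site) => B₀ * (N + N' * Real.exp (δ₀ * ρ) * κ₄) * B6.c1 d δ₀ α *
        (1 - N' * (B₀ * Real.exp (δ₀ * ρ) * (κ₁ + (κ₂ + κQ))) * B6.c1 d δ₀ α)⁻¹ * g.len a *
        Real.exp (-((1 - α) * δ₀ * g.dist a b))) := by
  have hP : ∀ i, HasMajorantHom (g := toB6 g R H) blkY blk (leibRemT src tgt c (hs i)) (KP i) :=
    fun i => leibRemT_majorant blk blkY src tgt c (hs i) (KP i) (hdomT i)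
  have hC : ∀ i, HasMajorant (g := toB6 g R H) blk
      (-(covDT src tgt c Rm ∘ₗ leibRem src tgt c (hs i)) + (mulOp (hs i ∘ Prod.fst) * Qf - Qf * mulOp (hs i ∘ Prod.fst)))
      (fun a b => KL i a b + KQ i a b) := fun i =>
    (hasMajorantHom_iff (g := toB6 g R H) blk _ _).mp
      (hasMajorantHom_add (g := toB6 g R H) blk blk
        (hasMajorantHom_neg blk blk (covDT_leibRem_majorant blk src tgt c Rm (hs i) (KL i) (hdomL i)))
        ((hasMajorantHom_iff (g := toB6 g R H) blk _ _).mpr (hQ i)))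
  have hKC : ∀ i a b, 0 ≤ KL i a b + KQ i a b := fun i a b => add_nonneg (hKL i a b) (hKQ i a b)
  have hlocC : ∀ i a y'', KL i a y'' + KQ i a y'' ≠ 0 → g.dist a y'' ≤ ρ := fun i a y'' hne => by
    by_cases h1 : KL i a y'' = 0
    · rw [h1, zero_add] at hne
      exact hlocQ i a y'' hne
    · exact hlocL i a y'' h1
  have hrowC : ∀ i (a : g.Site), ∑ y'' : g.Site, (KL i a y'' + KQ i a y'') * g.len y'' ^ 2 ≤
      if a ∈ S' i then κ₂ + κQ else 0 := fun i a => rowSum_add_le a (hrowL i a) (hrowQ i a)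
  have hκ'' : 0 ≤ κ₁ + (κ₂ + κQ) := by linarith
  exact thm37_entry2_of_342_lattice (P := fun i => leibRemT src tgt c (hs i))
    (Cop := fun i => -(covDT src tgt c Rm ∘ₗ leibRem src tgt c (hs i)) +
      (mulOp (hs i ∘ Prod.fst) * Qf - Qf * mulOp (hs i ∘ Prod.fst)))
    src tgt c Rm blk blkY d δ₀ α ρ B₀ κ₁ (κ₂ + κQ) κ₄ N N' S S' hs KP (fun i a b => KL i a b + KQ i a b) KC'
    hB₀ hδ₀ hκ'' hκ₄ hN hN' hαδ htri hrefl hdnn hlen h261 h263 hsmall hh hSY hcnt hcnt' hKP hlocP hrowP hKC hlocC hrowC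
    hKC' hlocC' hrowC' hdh h342_1 h342_2 hP hC hinv (h388_lattice src tgt c Rm Qf hs Gsq hsq hloc)

end Lattice388

end Literature.MathematicalPhysics.QuantumFieldTheory.Balaban1983to89.B9Thm37Glue
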